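import Mathlib.Analysis.Fourier.AddCircle
import Mathlib.Analysis.InnerProductSpace.Projection.Basic
import Mathlib.Analysis.InnerProductSpace.LinearMap
import Mathlib.Analysis.InnerProductSpace.Adjoint
import Mathlib.Analysis.InnerProductSpace.Positive
import Mathlib.Analysis.InnerProductSpace.l2Space
import Mathlib.Analysis.Normed.Operator.Compact.Basic
import Mathlib.Analysis.Meromorphic.Order
import Mathlib.MeasureTheory.Function.Holder
import Mathlib.Analysis.SpecialFunctions.Gamma.Deligne
import Mathlib.Analysis.SpecialFunctions.Pow.Deriv
import Mathlib.Analysis.Complex.CauchyIntegral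
import Mathlib.Analysis.SpecialFunctions.Integrals.Basic
import Mathlib.Analysis.SpecialFunctions.ContinuousFunctionalCalculus.Rpow.Basic
import Mathlib.Analysis.CStarAlgebra.ContinuousLinearMap
import Mathlib.Analysis.InnerProductSpace.StarOrder
import Mathlib.Analysis.SpecialFunctions.Gamma.BohrMollerup
import Mathlib.Analysis.SpecificLimits.Normed
import Literature.NumberTheory.ConnesConsani2021.ArchimedeanTraceFormula
import Literature.NumberTheory.ConnesConsani2021.ScalingHamiltonian
import Literature.NumberTheory.ConnesConsani2021.ApproxNumberCalculus
import HarnessLib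

/-!
# Connes–Consani 2021 (JNT) — quasi-inner functions and local factors, §2–§3: `ρ_∞` is quasi-inner; the functions `ρ_p`

LINE 1 — LABEL: RH-FREE corpus literature (function theory of the ratios of local `L`-factors on the
critical line; no positivity statement, no statement about zeros of `ζ`); bears_on: W-C/W-P (sequel typing,
no leaf role); WHAT THIS IS NOT: any claim about RH — nothing in this file bears on the truth of RH.

Source: A. Connes, C. Consani, *Quasi-inner functions and local factors*, J. Number Theory **226** (2021)
139–167, doi:10.1016/j.jnt.2021.01.024 = arXiv:2008.10974 [bib: `ConnesConsani2021QuasiInner`]. Locators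
below are arXiv tex chunks `pNNNN:Lnn` of the held text `paper:arxiv-2008.10974` (cell rh-crit/cc, seat t17,
STATEMENTS-FIRST typing of §2–§3, namespace `Literature.NumberTheory.ConnesConsani2021.QuasiInner`; §4–§5
are the sibling file `QuasiInnerSoninSpace.lean`, seat t18, same namespace, whose operator-side statements
import THIS vocabulary — `rhoArch`, `rhoPrime`, `cayley`, `hardyProjection`, `IsQuasiInner`, `xiVec`,
`etaVec`, `hardyIsoPlus/Minus`, `zetaVec` — and write `ρ_∞`, `ρ_p` inline exactly as defined here).

## What is typed, and how (design choices)

* **Quasi-inner, as printed** (Intro, Definition p0003:L5): «Let `Ω ⊂ ℂ` be an open disk or a half-space.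
  A function `u ∈ L^∞(∂Ω)` of modulus `1` is *quasi-inner* if the operator `(1 − 𝒫) u 𝒫` is compact, where
  `𝒫` is the orthogonal projection of `L²(∂Ω)` on the Hardy space `H²(Ω)` and `u` acts by multiplication.»
  The tree and Mathlib have NO Hardy-space / inner-function declarations (cell note cc/STATUS 01:32:47Z), so
  this file types the **boundary-value form used in print**: on the circle `AddCircle T` (Haar probability
  measure, Mathlib's `fourierLp`), `H²(𝕌)` IS the closed subspace of `L²(S¹)` of functions whose negative
  Fourier coefficients vanish (`hardySpace`, defined as the orthogonal complement of the negative modes, so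
  that Mathlib's `Submodule.starProjection` is available without any new instance), `𝒫 = hardyProjection`,
  multiplication by `u ∈ L^∞` is Mathlib's Hölder action (`mulOp`), and `IsQuasiInner u` is the printed
  definition.  The abstract form «the matrix of `u` in `H² ⊕ (H²)^⊥` is triangular modulo compacts»
  (p0003:L7) is `IsQuasiInnerRel P u := IsCompactOperator ((1 − P) u P)` for ANY projection `P` on a Hilbert
  space; the two printed elementary consequences (inner ⇒ quasi-inner; products) are PROVED at that level.
* **The half-plane `ℂ₋ = {Re z ≤ ½}`** (boundary = critical line): the paper works throughout by conformal
  transport to the disk («we use the invariance of the quantized calculus under conformal transformations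
  to switch back and forth from the unit disk to the half plane `ℂ₋`, by implementing
  `ψ(v) = ½ + (v+1)/(v−1)` … the unitary `U : L²(S¹) → L²(∂ℂ₋)`, `(Uξ)(z) = π^{-1/2}(z − 3/2)⁻¹ ξ(ψ⁻¹(z))`
  … conjugates the corresponding operators `𝒫`», p0003:L26–p0004:L1), and every proof of §2–§3 is carried
  out for `κ = ρ ∘ ψ` on `S¹`.  Accordingly `IsQuasiInnerLeftHalfPlane ρ := IsQuasiInner (ρ ∘ ψ restricted
  to S¹)` — we SAY SO here: the half-plane Hardy space `H²(ℂ₋)` itself is not constructed.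
* **Infinitesimals** (Thm 2.1 «infinitesimal of infinite order»): Connes' characteristic values
  `μ_n(T) = inf{‖T − R‖ : rank R ≤ n}` and «of infinite order ⟺ μ_n(T) = O(n^{-k})` for all `k`»
  [Connes, *Noncommutative Geometry* (1994), Introduction §D] are the tree's
  `Literature.NumberTheory.ConnesConsani2021.approxNumber` / `IsInfiniteOrder`
  (`ArchimedeanTraceFormula.lean`, CC 2021 App. D) — IMPORTED and cited, not restated.
* `ρ_∞(z) = Γ_ℝ(z)/Γ_ℝ(1 − z)` with Mathlib's `Complex.Gammaℝ s = π^{-s/2} Γ(s/2)` (first display of §2) is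
  an ALIAS of the tree's name of record `ScalingHamiltonian.archLocalRatio` (cell ruling R16; `rfl`), and
  `ρ_p` is linked to `ScalingHamiltonian.localFactorRatio` by the proved `rhoPrime_eq_localFactorRatio`;
  the printed form `ρ_∞(z) = 2 cos(πz/2)(2π)^{-z}Γ(z)` (third display of §2) is PROVED (`rhoArch_eq_two_mul_cos`) from Mathlib's
  `Complex.Gammaℝ_div_Gammaℝ_one_sub`; it is the tree's `Literature.NumberTheory.LFunctions.ZetaM4.feFactor`
  / `TateLocalZetaArchimedean.rho_real_trivial` form (cited, not imported: those files carry heavy imports).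
* Functions given by formulas are turned into `L^p` vectors by `toLpOrZero` (junk value `0` off `L^p`,
  documented); operators the paper introduces only through their action on a basis and whose boundedness is
  part of a printed lemma (`V δ_n = ζ_n` of Lemma 3.4/3.5, the involutions `I`, `J`) enter the typed
  statements CHARACTERISED BY THAT ACTION (universally quantified), never as opaque constants.
* Numbered statements typed: Thm 2.1, Lemma 2.2 (typed AND discharged in-file: `lemma_2_2_holds`, by the
  geometric Fourier expansions of `ξ_x`, `η_x` and Parseval, §G), Thm 2.3, Remark (arXiv Rem. 1), Prop 2.4, display
  «aminusk» (`a_{−k}`); Lemma 3.1 (i)(iii) PROVED, (ii) typed and discharged in-file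
  (`lemma_3_1_ii_holds`, meromorphic orders); display «offdiag2»; Lemma 3.2 (typed AND
  discharged in-file: `lemma_3_2_holds`), Lemma 3.3 (spectrum interval typed in CORRECTED form
  `[(p−1)^{-1/2}, (p/(p−1))^{1/2}]` — the printed `[1, √p]` is inconsistent with the printed Gram
  normalisation for `p ≠ 2`; misprint recorded in the docstring), Lemma 3.4–3.5, Fact 3.6 (labelled «Fact»
  in print),
  Prop 3.7.  Unproved printed results are named facts `def <kind>_<n> : Prop` in namespace `QuasiInner` (D-0014); no
  conjecture, no positivity statement, no floating-point input occurs in §2–§3.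
* NOT here: §4 (products `ρ_∞ ∏ ρ_p`, Gauss multiplication), §5 (Sonin spaces `S(u)`), the figures, the
  numerical remarks; the Hardy space of the half-plane as an independent object.

Nothing in this file bears on the truth of RH.
-/

noncomputable section

open _root_.MeasureTheory _root_.Complex AddCircle Filter Set
open scoped Real ENNReal InnerProductSpace Topology ComplexConjugate

namespace Literature.NumberTheory.ConnesConsani2021

namespace QuasiInner

/-! ### A. Quasi-inner relative to a projection: «triangular modulo compact operators» -/

section Abstract

variable {H : Type*} [NormedAddCommGroup H] [InnerProductSpace ℂ H]

/-- RH-FREE. The off-diagonal corner `u₂₁ = (1 − P) u P` of an operator `u` in the decomposition given by a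
projection `P` (for `P` the Hardy projection: «the operator `(1 − 𝒫) u 𝒫`»).
[cite: ConnesConsani2021QuasiInner, Introduction, Definition (arXiv chunk p0003:L5)] -/
def offDiag (P u : H →L[ℂ] H) : H →L[ℂ] H := (1 - P) * u * P

/-- RH-FREE. Unfolding lemma for `offDiag`. [cite: ConnesConsani2021QuasiInner, Introduction (p0003:L5)] -/
theorem offDiag_def (P u : H →L[ℂ] H) : offDiag P u = (1 - P) * u * P := rfl

/-- RH-FREE. **Quasi-inner relative to a projection `P`** (abstract form): `(1 − P) u P` is a compact operator,
i.e. «the matrix of the action of `u` on the orthogonal decomposition … is triangular modulo compact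
operators». [cite: ConnesConsani2021QuasiInner, Introduction (arXiv chunk p0003:L5–L7)] -/
def IsQuasiInnerRel (P u : H →L[ℂ] H) : Prop := IsCompactOperator (offDiag P u)

/-- RH-FREE. «Inner functions are quasi-inner since when `u ∈ H^∞(Ω)` then `(1 − 𝒫)u𝒫 = 0`»: abstractly, a
vanishing off-diagonal corner is compact. [cite: ConnesConsani2021QuasiInner, Introduction (p0003:L7)] -/
theorem isQuasiInnerRel_of_offDiag_eq_zero {P u : H →L[ℂ] H} (h : offDiag P u = 0) :
    IsQuasiInnerRel P u := by
  rw [IsQuasiInnerRel, h]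
  exact isCompactOperator_zero

/-- RH-FREE. The algebra behind «the product of two quasi-inner functions is also quasi-inner»:
`(1 − P)(uv)P = [(1 − P)uP](vP) + [(1 − P)u][(1 − P)vP]` (insert `1 = P + (1 − P)`).
[cite: ConnesConsani2021QuasiInner, Introduction (p0003:L7)] -/
theorem offDiag_mul (P u v : H →L[ℂ] H) :
    offDiag P (u * v) = offDiag P u * (v * P) + ((1 - P) * u) * offDiag P v := by
  simp only [offDiag]
  noncomm_ring

/-- RH-FREE. **Products of quasi-inner operators are quasi-inner** («It follows that the product of two quasi-inner
functions is also quasi-inner»). [cite: ConnesConsani2021QuasiInner, Introduction (arXiv chunk p0003:L7)] -/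
theorem IsQuasiInnerRel.mul {P u v : H →L[ℂ] H} (hu : IsQuasiInnerRel P u) (hv : IsQuasiInnerRel P v) :
    IsQuasiInnerRel P (u * v) := by
  unfold IsQuasiInnerRel at hu hv ⊢
  have h3 := (hu.comp_clm (v * P)).add (hv.clm_comp ((1 - P) * u))
  have heq : (⇑(offDiag P u * (v * P) + (1 - P) * u * offDiag P v) : H → H) =
      ⇑(offDiag P u) ∘ ⇑(v * P) + ⇑((1 - P) * u) ∘ ⇑(offDiag P v) := by
    ext x
    rfl
  rw [offDiag_mul, heq]
  exact h3

end Abstract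

/-! ### C. The circle: Hardy space in boundary-value form, multiplication operators, quasi-inner functions -/

section Lp

variable {α : Type*} [MeasurableSpace α]

open Classical in
/-- RH-FREE. A function as a vector of `L^p(μ)`; junk value `0` when `f ∉ L^p(μ)` (the statements below that use it
on a specific `f` either assert `MemLp f p μ` alongside or concern functions bounded and continuous off one
point of the circle). [folklore] -/
def toLpOrZero (p : ℝ≥0∞) (μ : Measure α) (f : α → ℂ) : Lp ℂ p μ :=
  if h : MemLp f p μ then h.toLp f else 0

/-- RH-FREE. `toLpOrZero` agrees with `MemLp.toLp` on `L^p` (unfolding lemma for the vectors `u ∈ L^∞(∂Ω)`,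
`ξ_x, η_x ∈ L²` of the printed statements). [cite: ConnesConsani2021QuasiInner, Introduction, Definition (arXiv chunk p0003:L5)] -/
theorem toLpOrZero_eq_toLp {p : ℝ≥0∞} {μ : Measure α} {f : α → ℂ} (h : MemLp f p μ) :
    toLpOrZero p μ f = h.toLp f := by
  simp [toLpOrZero, h]

/-- RH-FREE. **Multiplication operator** `M_u : L²(μ) → L²(μ)` by `u ∈ L^∞(μ)` («`u` acts on `L²(∂Ω)` by
multiplication»): Mathlib's Hölder action `L^∞ × L² → L²`.
[cite: ConnesConsani2021QuasiInner, Introduction, Definition (p0003:L5)] -/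
def mulOp (μ : Measure α) (u : Lp ℂ ∞ μ) : Lp ℂ 2 μ →L[ℂ] Lp ℂ 2 μ :=
  (ContinuousLinearMap.mul ℂ ℂ).holderL μ ∞ 2 2 u

/-- RH-FREE. `M_u f = u · f` almost everywhere («`u` acts on `L²(∂Ω)` by multiplication» — unfolding lemma).
[cite: ConnesConsani2021QuasiInner, Introduction, Definition (arXiv chunk p0003:L5)] -/
theorem coeFn_mulOp (μ : Measure α) (u : Lp ℂ ∞ μ) (f : Lp ℂ 2 μ) :
    (mulOp μ u f : α → ℂ) =ᵐ[μ] fun x => u x * f x := by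
  simpa [mulOp] using (ContinuousLinearMap.mul ℂ ℂ).coeFn_holder (μ := μ) (r := 2) u f

end Lp

section Circle

variable (T : ℝ) [hT : Fact (0 < T)]

/-- RH-FREE. The span of the negative Fourier modes `e_{−1}, e_{−2}, …` of `L²(S¹)`. [folklore] -/
def hardyNegModes : Submodule ℂ (Lp ℂ 2 (haarAddCircle (T := T))) :=
  Submodule.span ℂ (Set.range fun n : ℕ => fourierLp (T := T) 2 (-(n + 1 : ℤ)))

/-- RH-FREE. **The Hardy space `H²(𝕌)` in boundary-value form**: the closed subspace of `L²(S¹)` orthogonal to all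
negative Fourier modes, i.e. the `L²` functions on the circle whose negative Fourier coefficients vanish
(= boundary values of holomorphic functions on the disk with square-summable Taylor coefficients).  An
`abbrev` of an orthogonal complement, so that `CompleteSpace`/`HasOrthogonalProjection` are found by Mathlib.
[cite: ConnesConsani2021QuasiInner, Introduction, Definition (arXiv chunk p0003:L5)] -/
abbrev hardySpace : Submodule ℂ (Lp ℂ 2 (haarAddCircle (T := T))) := (hardyNegModes T)ᗮ

/-- RH-FREE. Membership in `H²(𝕌)` (boundary form): orthogonality to every negative mode `e_{−1}, e_{−2}, …`
(unfolding lemma of the typed Hardy space). [cite: ConnesConsani2021QuasiInner, Introduction, Definition (arXiv chunk p0003:L5)] -/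
theorem mem_hardySpace_iff (f : Lp ℂ 2 (haarAddCircle (T := T))) :
    f ∈ hardySpace T ↔ ∀ n : ℕ, ⟪fourierLp (T := T) 2 (-(n + 1 : ℤ)), f⟫_ℂ = 0 := by
  rw [hardySpace, hardyNegModes, Submodule.mem_orthogonal]
  constructor
  · intro h n
    exact h _ (Submodule.subset_span ⟨n, rfl⟩)
  · intro h u hu
    refine Submodule.span_induction (p := fun u _ => ⟪u, f⟫_ℂ = 0) ?_ ?_ ?_ ?_ hu
    · rintro _ ⟨n, rfl⟩
      exact h n
    · exact inner_zero_left f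
    · intro x y _ _ hx hy
      rw [inner_add_left, hx, hy, add_zero]
    · intro c x _ hx
      rw [inner_smul_left, hx, mul_zero]

/-- RH-FREE. Membership in `H²` via Fourier coefficients: `f ∈ H² ↔ f̂(n) = 0` for all `n < 0` (the
criterion the paper invokes as «[Rudin] Theorem 17.12»: an `L²` function on `S¹` with vanishing negative
Fourier coefficients belongs to `H²(𝒰)`). [cite: ConnesConsani2021QuasiInner, §2, proof of Prop 2.4 (arXiv chunk p0007:L8), citing Rudin, Real and Complex Analysis, Thm 17.12] -/
theorem mem_hardySpace_iff_fourierCoeff (f : Lp ℂ 2 (haarAddCircle (T := T))) :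
    f ∈ hardySpace T ↔ ∀ n : ℤ, n < 0 → fourierCoeff (T := T) f n = 0 := by
  rw [mem_hardySpace_iff]
  have key : ∀ n : ℤ, ⟪fourierLp (T := T) 2 n, f⟫_ℂ = fourierCoeff (T := T) f n := fun n => by
    rw [← fourierBasis_repr, ← coe_fourierBasis]
    exact (fourierBasis.repr_apply_apply f n).symm
  constructor
  · intro h n hn
    obtain ⟨m, rfl⟩ : ∃ m : ℕ, n = -(m + 1 : ℤ) := ⟨(-n - 1).toNat, by omega⟩
    rw [← key]; exact h m
  · intro h m
    rw [key]; exact h _ (by omega)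

/-- RH-FREE. **The Hardy projection `𝒫`**: the orthogonal projection of `L²(S¹)` onto `H²(𝕌)`.
[cite: ConnesConsani2021QuasiInner, Introduction, Definition (arXiv chunk p0003:L5)] -/
def hardyProjection : Lp ℂ 2 (haarAddCircle (T := T)) →L[ℂ] Lp ℂ 2 (haarAddCircle (T := T)) :=
  (hardySpace T).starProjection

/-- RH-FREE. The off-diagonal corner `(1 − 𝒫) u 𝒫` of multiplication by `u ∈ L^∞(S¹)`.
[cite: ConnesConsani2021QuasiInner, Introduction, Definition (arXiv chunk p0003:L5)] -/
def hardyOffDiag (u : Lp ℂ ∞ (haarAddCircle (T := T))) :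
    Lp ℂ 2 (haarAddCircle (T := T)) →L[ℂ] Lp ℂ 2 (haarAddCircle (T := T)) :=
  offDiag (hardyProjection T) (mulOp haarAddCircle u)

/-- RH-FREE. **Quasi-inner function on the circle** (`Ω = 𝕌`, boundary-value form): `u ∈ L^∞(S¹)` of modulus one
a.e. such that `(1 − 𝒫) u 𝒫` is compact.
[cite: ConnesConsani2021QuasiInner, Introduction, Definition (arXiv chunk p0003:L5)] -/
def IsQuasiInner (u : Lp ℂ ∞ (haarAddCircle (T := T))) : Prop :=
  (∀ᵐ x ∂(haarAddCircle (T := T)), ‖u x‖ = 1) ∧ IsQuasiInnerRel (hardyProjection T) (mulOp haarAddCircle u)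

/-- RH-FREE. A function on `ℂ` sampled on the unit circle `S¹ = ∂𝕌`, as a function on `AddCircle T`
(`x ↦ g(e^{2πix/T})`). [folklore] -/
def circleRestrict (g : ℂ → ℂ) (x : AddCircle T) : ℂ := g (toCircle x)

end Circle

/-! ### D. The conformal transport `ψ : 𝕌 → ℂ₋` and quasi-inner functions on the critical line -/

/-- RH-FREE. `ψ(v) = ½ + (v + 1)/(v − 1)`, mapping the unit disk onto `ℂ₋ = {Re z ≤ ½}` (`ψ(−1) = ½`, `ψ(0) = −½`,
`ψ(1) = −∞`; junk value `ψ(1) = ½` in Lean). [cite: ConnesConsani2021QuasiInner, Introduction (p0003:L26)] -/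
def cayley (v : ℂ) : ℂ := 1 / 2 + (v + 1) / (v - 1)

/-- RH-FREE. `ψ⁻¹(z) = (2z + 1)/(2z − 3)`. [cite: ConnesConsani2021QuasiInner, Introduction (arXiv chunk p0003:L26)] -/
def cayleyInv (z : ℂ) : ℂ := (2 * z + 1) / (2 * z - 3)

/-- RH-FREE. `ψ(−1) = ½`. [cite: ConnesConsani2021QuasiInner, Introduction (arXiv chunk p0003:L26)] -/
theorem cayley_neg_one : cayley (-1) = 1 / 2 := by norm_num [cayley]

/-- RH-FREE. `ψ(0) = −½`. [cite: ConnesConsani2021QuasiInner, Introduction (arXiv chunk p0003:L26)] -/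
theorem cayley_zero : cayley 0 = -(1 / 2) := by norm_num [cayley]

/-- RH-FREE. `ψ(ψ⁻¹(z)) = z` for `z ≠ 3/2`. [cite: ConnesConsani2021QuasiInner, Introduction (arXiv chunk p0003:L26)] -/
theorem cayley_cayleyInv {z : ℂ} (hz : z ≠ 3 / 2) : cayley (cayleyInv z) = z := by
  have h1 : (2 * z - 3 : ℂ) ≠ 0 := by
    intro h; apply hz; linear_combination h / 2
  have h2 : ((2 * z + 1) / (2 * z - 3) - 1 : ℂ) ≠ 0 := by
    rw [div_sub_one h1]; exact div_ne_zero (by ring_nf; norm_num) h1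
  simp only [cayley, cayleyInv]
  field_simp
  ring

/-- RH-FREE. `ψ⁻¹(ψ(v)) = v` for `v ≠ 1`. [cite: ConnesConsani2021QuasiInner, Introduction (arXiv chunk p0003:L26)] -/
theorem cayleyInv_cayley {v : ℂ} (hv : v ≠ 1) : cayleyInv (cayley v) = v := by
  have h1 : (v - 1 : ℂ) ≠ 0 := sub_ne_zero.2 hv
  have hnum : (2 * (1 / 2 + (v + 1) / (v - 1)) + 1 : ℂ) = 4 * v / (v - 1) := by
    field_simp
    ring
  have hden : (2 * (1 / 2 + (v + 1) / (v - 1)) - 3 : ℂ) = 4 / (v - 1) := by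
    field_simp
    ring
  simp only [cayley, cayleyInv]
  rw [hnum, hden]
  field_simp

/-- RH-FREE. `ψ` maps the unit circle INTO the critical line: `Re ψ(v) = ½` for `|v| = 1` («the conformal
transformation `ψ` … from the unit disk to the half plane `ℂ₋`», whose boundary is the critical line; at
`v = 1`, where `ψ = ∞` in print, Lean's junk value `ψ(1) = ½` also has real part `½`).
[cite: ConnesConsani2021QuasiInner, Introduction (arXiv chunk p0003:L26)] -/
theorem cayley_re_of_norm_eq_one {v : ℂ} (hv : ‖v‖ = 1) : (cayley v).re = 1 / 2 := by
  have hab : v.re * v.re + v.im * v.im = 1 := by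
    rw [← normSq_apply, normSq_eq_norm_sq, hv, one_pow]
  rw [cayley, add_re, div_re (v + 1) (v - 1), ← add_div]
  simp only [add_re, one_re, sub_re, add_im, one_im, sub_im, add_zero, sub_zero]
  rw [show (v.re + 1) * (v.re - 1) + v.im * v.im = 0 by linear_combination hab, zero_div, add_zero]
  norm_num [Complex.div_re, Complex.normSq_apply]

/-- RH-FREE. **Quasi-inner relative to `ℂ₋ = {Re z ≤ ½}`** (boundary the critical line), in the boundary-value form
used in print: `ρ` is quasi-inner relative to `ℂ₋` iff `κ = ρ ∘ ψ` is quasi-inner on the circle — the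
unitary `(Uξ)(z) = π^{-1/2}(z − 3/2)⁻¹ξ(ψ⁻¹(z))` «transforms an element of the Hardy space `H²(𝒰)` into a
holomorphic function in `ℂ₋` whose restriction to the critical line is square integrable, and it conjugates
the corresponding operators `𝒫`» and intertwines multiplication by `κ` with multiplication by `ρ`.  The
Hardy space `H²(ℂ₋)` is not constructed independently (module docstring).
[cite: ConnesConsani2021QuasiInner, Introduction (arXiv chunks p0003:L26–p0004:L1)] -/
def IsQuasiInnerLeftHalfPlane (ρ : ℂ → ℂ) : Prop :=
  MemLp (circleRestrict 1 (ρ ∘ cayley)) ∞ (haarAddCircle (T := 1)) ∧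
    IsQuasiInner 1 (toLpOrZero ∞ haarAddCircle (circleRestrict 1 (ρ ∘ cayley)))

/-! ### E. §2 — the archimedean ratio `ρ_∞` -/

/-- RH-FREE. **The archimedean ratio of local factors** `ρ_∞(z) = π^{-z/2}Γ(z/2) / (π^{-(1-z)/2}Γ((1-z)/2))
= Γ_ℝ(z)/Γ_ℝ(1 − z)` (first display of §2; `γ_∞ = Γ_ℝ` is Mathlib's `Complex.Gammaℝ`).  NAME OF RECORD in the
tree (cell ruling R16): `ScalingHamiltonian.archLocalRatio` (Connes–Consani, *The scaling Hamiltonian*, eq. (3.4),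
`= Gammaℝ z / Gammaℝ (1 − z)`); `rhoArch` is this paper's notation for THE SAME function, defined as an alias
(`rhoArch_eq_archLocalRatio : rhoArch = archLocalRatio` is `rfl`).  Off the odd negative integers it equals
the tree's `ZetaM4.feFactor` form (`rhoArch_eq_two_mul_cos`).
[cite: ConnesConsani2021QuasiInner, §1 display defining γ_∞, γ_p, ρ (p0003:L19) and §2 first display (arXiv chunk p0005:L6)] -/
def rhoArch (z : ℂ) : ℂ := ScalingHamiltonian.archLocalRatio z

/-- RH-FREE. `ρ_∞` IS the tree's `ScalingHamiltonian.archLocalRatio` (name of record, R16). [cite: ConnesConsani2021QuasiInner, §2 first display (arXiv chunk p0005:L6)] -/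
theorem rhoArch_eq_archLocalRatio : rhoArch = ScalingHamiltonian.archLocalRatio := rfl

/-- RH-FREE. Unfolding `ρ_∞(z) = Γ_ℝ(z)/Γ_ℝ(1 − z)`. [cite: ConnesConsani2021QuasiInner, §2 first display (arXiv chunk p0005:L6)] -/
theorem rhoArch_def (z : ℂ) : rhoArch z = Gammaℝ z / Gammaℝ (1 - z) := rfl

/-- RH-FREE. **Third display of §2**: `ρ_∞(z) = 2 cos(πz/2) (2π)^{-z} Γ(z)` («proven using the duplication and complement
formulas» — Mathlib's `Complex.Gammaℝ_div_Gammaℝ_one_sub`), for `z ∉ −1 − 2ℕ` (at the odd negative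
integers Mathlib's junk value `Γ(−m) = 0` makes the right side `0` while `ρ_∞ ≠ 0`).
[cite: ConnesConsani2021QuasiInner, §2 third display (arXiv chunk p0005:L19)] -/
theorem rhoArch_eq_two_mul_cos {z : ℂ} (hz : ∀ n : ℕ, z ≠ -(2 * n + 1)) :
    rhoArch z = 2 * Complex.cos (π * z / 2) * (2 * π : ℂ) ^ (-z) * Complex.Gamma z := by
  rw [rhoArch_def, Gammaℝ_div_Gammaℝ_one_sub hz, Gammaℂ_def]
  ring

/-- RH-FREE. **Second display of §2 («archimfact1»)**, the functional equation `ρ_∞(z + 2) = −(2π)^{-2} z (z + 1) ρ_∞(z)` (an identity of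
meromorphic functions; pointwise for `z ≠ 0` — at the pole `z = 0` Mathlib's junk values break it).
[cite: ConnesConsani2021QuasiInner, §2 second display «archimfact1» (arXiv chunk p0005:L13)] -/
theorem rhoArch_add_two {z : ℂ} (hz : z ≠ 0) :
    rhoArch (z + 2) = -((2 * π : ℂ) ^ (-2 : ℤ)) * z * (z + 1) * rhoArch z := by
  have hπ : (π : ℂ) ≠ 0 := ofReal_ne_zero.2 Real.pi_ne_zero
  rw [rhoArch_def, rhoArch_def, Gammaℝ_add_two hz]
  by_cases h1 : z = -1
  · subst h1
    norm_num [Gammaℝ]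
  have hz1 : (-1 - z : ℂ) ≠ 0 := by
    intro h; apply h1; linear_combination -h
  have key : Gammaℝ (1 - z) = Gammaℝ (-1 - z) * (-1 - z) / 2 / π := by
    rw [← Gammaℝ_add_two hz1]; ring_nf
  rw [show (1 : ℂ) - (z + 2) = -1 - z by ring]
  by_cases h0 : Gammaℝ (-1 - z) = 0
  · rw [h0, key, h0]; simp
  rw [key]
  field_simp
  ring

/-- RH-FREE. `ρ_∞(1 − z) ρ_∞(z) = 1` (away from the zeros and poles `z ∈ −2ℕ ∪ (1 + 2ℕ)`, where Mathlib's junk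
values intervene). [cite: ConnesConsani2021QuasiInner, §2 Remark (arXiv Rem. 1; chunk p0006:L76)] -/
theorem rhoArch_one_sub_mul {z : ℂ} (h₁ : ∀ n : ℕ, z ≠ -(2 * n)) (h₂ : ∀ n : ℕ, z ≠ 2 * n + 1) :
    rhoArch (1 - z) * rhoArch z = 1 := by
  have hz : Gammaℝ z ≠ 0 := fun h => by
    obtain ⟨n, hn⟩ := Gammaℝ_eq_zero_iff.1 h
    exact h₁ n hn
  have hz' : Gammaℝ (1 - z) ≠ 0 := fun h => by
    obtain ⟨n, hn⟩ := Gammaℝ_eq_zero_iff.1 h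
    exact h₂ n (by linear_combination -hn)
  rw [rhoArch_def, rhoArch_def, sub_sub_cancel]
  field_simp

/-- RH-FREE. **`|ρ_∞| = 1` on the critical line** («the ratio of local `L`-factors … is a function of modulus one
on the critical line») — the tree's `ScalingHamiltonian.norm_archLocalRatio_half_add` (cited, not re-proved).
[cite: ConnesConsani2021QuasiInner, §1 (p0003:L3) and §2 (p0006:L87)] -/
theorem norm_rhoArch_critical_line (t : ℝ) : ‖rhoArch (1 / 2 + t * I)‖ = 1 :=
  ScalingHamiltonian.norm_archLocalRatio_half_add t

/-- RH-FREE. `κ(v) := ρ_∞(½ + (v+1)/(v−1)) = ρ_∞ ∘ ψ`, the archimedean ratio transported to the disk.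
[cite: ConnesConsani2021QuasiInner, §2 (arXiv chunk p0005:L28)] -/
def kappaArch (v : ℂ) : ℂ := rhoArch (cayley v)

/-- RH-FREE. On the circle `ψ(v) = ½ + i·Im ψ(v)` (a point of the critical line).
[cite: ConnesConsani2021QuasiInner, Introduction (arXiv chunk p0003:L26)] -/
theorem cayley_eq_half_add_of_norm_eq_one {v : ℂ} (hv : ‖v‖ = 1) :
    cayley v = 1 / 2 + (cayley v).im * I := by
  apply Complex.ext
  · simp [cayley_re_of_norm_eq_one hv]
  · simp

variable (T : ℝ) in
/-- RH-FREE. **`κ = ρ_∞ ∘ ψ` is unimodular on `S¹`** (at every point, junk value at `v = 1` included):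
the modulus-one hypothesis of the quasi-inner definition for `ρ_∞`.
[cite: ConnesConsani2021QuasiInner, §2 (arXiv chunk p0006:L87) with Introduction, Definition (p0003:L5)] -/
theorem norm_circleRestrict_kappaArch (x : AddCircle T) : ‖circleRestrict T kappaArch x‖ = 1 := by
  have hv : ‖((toCircle x : Circle) : ℂ)‖ = 1 := Circle.norm_coe _
  simp only [circleRestrict, kappaArch]
  rw [cayley_eq_half_add_of_norm_eq_one hv]
  exact norm_rhoArch_critical_line _

/-- RH-FREE. The poles of `κ` in the disk: `x(n) = ψ⁻¹(−2n) = 1 − 4/(4n + 3)` («the `x(n)` increase to `1` with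
`1 − x(n) ∼ 1/n`»; `x_n` of Thm 2.3). [cite: ConnesConsani2021QuasiInner, §2 (p0005:L122) and Thm 2.3 (p0006:L57)] -/
def xArch (n : ℕ) : ℝ := 1 - 4 / (4 * n + 3)

/-- RH-FREE. `x(n) = ψ⁻¹(−2n)`. [cite: ConnesConsani2021QuasiInner, §2 (arXiv chunk p0005:L94–L115)] -/
theorem xArch_eq_cayleyInv (n : ℕ) : (xArch n : ℂ) = cayleyInv (-(2 * n)) := by
  have h : (4 * (n : ℂ) + 3) ≠ 0 := by
    intro h
    have := congrArg Complex.re h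
    simp at this
    linarith [n.cast_nonneg (α := ℝ)]
  have h' : (2 * (-(2 * (n : ℂ))) - 3) ≠ 0 := by
    intro h''; apply h; linear_combination -h''
  simp only [xArch, cayleyInv]
  push_cast
  rw [eq_div_iff h']
  field_simp
  ring

/-- RH-FREE. `0 ≤ x(n) < 1`, i.e. `x(n)` lies in the unit disk. [cite: ConnesConsani2021QuasiInner, §2 (p0005:L122)] -/
theorem xArch_lt_one (n : ℕ) : |xArch n| < 1 := by
  have h : (0 : ℝ) < 4 * n + 3 := by positivity
  have h1 : 4 / (4 * (n : ℝ) + 3) < 2 := by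
    rw [div_lt_iff₀ h]; nlinarith [n.cast_nonneg (α := ℝ)]
  have h2 : 0 < 4 / (4 * (n : ℝ) + 3) := by positivity
  rw [abs_lt, xArch]
  constructor <;> linarith

/-- RH-FREE. The coefficients `α(n) = (−1)^{n+1} 16 π^{2n+½} (4n+3)^{-2} / (Γ(n+1)Γ(n+½))` of display
«aminusk» (`a_{-k} = Σ α(n) x(n)^{k-1}`). [cite: ConnesConsani2021QuasiInner, §2 display «aminusk» (arXiv chunk p0005:L115)] -/
def alphaArch (n : ℕ) : ℝ :=
  (-1) ^ (n + 1) * 16 * (Real.sqrt π * π ^ (2 * n)) * ((4 * (n : ℝ) + 3) ^ 2)⁻¹ /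
    (Real.Gamma ((n : ℝ) + 1) * Real.Gamma ((n : ℝ) + 1 / 2))

/-- RH-FREE. **Display «aminusk»**: the negative Fourier coefficients of `κ`,
`a_{−k} = Σ_{n∈ℕ} (−1)^{n+1} 16 π^{2n+½}(4n+3)^{−2} (Γ(n+1)Γ(n+½))^{−1} (1 − 4/(4n+3))^{k−1}` (`k ≥ 1`).
[cite: ConnesConsani2021QuasiInner, §2 display «aminusk» (arXiv chunk p0005:L115)] -/
def archNegCoeff (k : ℕ) : ℝ := ∑' n : ℕ, alphaArch n * xArch n ^ (k - 1)

/-- RH-FREE. **Display «aminusk» as a statement about `κ`** (derived in print by Cauchy's residue theorem on the contours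
`C_{R,m}`, p0005:L46–L112): for `k ≥ 1`, `(1/2π)∫ κ(e^{iθ})e^{ikθ}dθ = a_{−k}`, i.e. the Fourier
coefficient of index `−k` of `κ|_{S¹}` is `archNegCoeff k`. Named fact (RH-FREE).
[cite: ConnesConsani2021QuasiInner, §2 display «aminusk» (arXiv chunk p0005:L34–L115)] -/
def display_aminusk : Prop :=
  ∀ k : ℕ, 1 ≤ k → fourierCoeff (T := 1) (circleRestrict 1 kappaArch) (-(k : ℤ)) = archNegCoeff k

/-- RH-FREE. **Theorem 2.1**: «The function `ρ_∞` is quasi-inner relative to `ℂ₋ = {z | Re z ≤ ½}`.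
The operator `(1 − 𝒫) ρ_∞ 𝒫` is an infinitesimal of infinite order.»  Typed on the disk
(`κ = ρ_∞ ∘ ψ`, boundary-value form; module docstring), «infinite order» = the tree's `IsInfiniteOrder`
(approximation numbers of rapid decay, `ArchimedeanTraceFormula.lean`). Named fact.
[cite: ConnesConsani2021QuasiInner, Thm 2.1 «thmquasiinner0» (arXiv chunk p0005:L124)] -/
def thm_2_1 : Prop :=
  IsQuasiInnerLeftHalfPlane rhoArch ∧
    IsInfiniteOrder (hardyOffDiag 1 (toLpOrZero ∞ haarAddCircle (circleRestrict 1 kappaArch)))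

/-- RH-FREE. The function `f_x(z) = z⁻¹(1 − x z⁻¹)⁻¹` on the circle (`|x| < 1`), which is also the vector `ξ_x`
of Lemma 2.2. [cite: ConnesConsani2021QuasiInner, Lemma 2.2 «uinftyqi1», display (arXiv chunk p0006:L11–L14)] -/
def szegoNeg (x : ℂ) : ℂ → ℂ := fun z => z⁻¹ * (1 - x * z⁻¹)⁻¹

/-- RH-FREE. The function `η_x(z) = (1 − x̄ z)⁻¹` on the circle (the Szegő kernel at `x`).
[cite: ConnesConsani2021QuasiInner, Lemma 2.2 «uinftyqi1», display (arXiv chunk p0006:L14)] -/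
def szegoPos (x : ℂ) : ℂ → ℂ := fun z => (1 - conj x * z)⁻¹

variable (T : ℝ) [hT : Fact (0 < T)] in
/-- RH-FREE. `ξ_x = z⁻¹(1 − x z⁻¹)⁻¹ ∈ L²(S¹)`. [cite: ConnesConsani2021QuasiInner, Lemma 2.2 «uinftyqi1», display (p0006:L14)] -/
def xiVec (x : ℂ) : Lp ℂ 2 (haarAddCircle (T := T)) :=
  toLpOrZero 2 haarAddCircle (circleRestrict T (szegoNeg x))

variable (T : ℝ) [hT : Fact (0 < T)] in
/-- RH-FREE. `η_x = (1 − x̄ z)⁻¹ ∈ L²(S¹)`. [cite: ConnesConsani2021QuasiInner, Lemma 2.2 «uinftyqi1», display (p0006:L14)] -/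
def etaVec (x : ℂ) : Lp ℂ 2 (haarAddCircle (T := T)) :=
  toLpOrZero 2 haarAddCircle (circleRestrict T (szegoPos x))

/-- RH-FREE. **Lemma 2.2** (`|x| < 1`): «The off diagonal part `(1 − 𝒫) f_x 𝒫` associated to the
multiplication operator in `L²(S¹)` by `f_x(z) := z⁻¹(1 − xz⁻¹)⁻¹` is the rank one operator
`|ξ_x⟩⟨η_x|`, `ξ_x = z⁻¹(1 − xz⁻¹)⁻¹`, `η_x = (1 − x̄z)⁻¹`.  One has `‖ξ_x‖² = ‖η_x‖² = (1 − |x|²)⁻¹`,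
`‖ξ_x‖‖η_x‖ = (1 − |x|²)⁻¹`.»  (`|ξ⟩⟨η| = InnerProductSpace.rankOne ℂ ξ η`, `v ↦ ⟨η|v⟩ξ`.) Named fact,
DISCHARGED in-file (`lemma_2_2_holds`, §G).
[cite: ConnesConsani2021QuasiInner, Lemma 2.2 «uinftyqi1» (arXiv chunk p0006:L11–L21)] -/
def lemma_2_2 : Prop :=
  ∀ (T : ℝ) (_ : Fact (0 < T)) (x : ℂ), ‖x‖ < 1 →
    hardyOffDiag T (toLpOrZero ∞ haarAddCircle (circleRestrict T (szegoNeg x))) =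
        InnerProductSpace.rankOne ℂ (xiVec T x) (etaVec T x) ∧
      ‖xiVec T x‖ ^ 2 = (1 - ‖x‖ ^ 2)⁻¹ ∧ ‖etaVec T x‖ ^ 2 = (1 - ‖x‖ ^ 2)⁻¹ ∧
      ‖xiVec T x‖ * ‖etaVec T x‖ = (1 - ‖x‖ ^ 2)⁻¹

/-- RH-FREE. The coefficients of Thm 2.3: `(−1)^{n+1} 2π^{2n+½} / ((4n+1) Γ(n+1) Γ(n+½))`.
[cite: ConnesConsani2021QuasiInner, Thm 2.3 «thmkappa», display «uinftyoff1» (arXiv chunk p0006:L54)] -/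
def thm23Coeff (n : ℕ) : ℝ :=
  (-1) ^ (n + 1) * 2 * (Real.sqrt π * π ^ (2 * n)) /
    ((4 * (n : ℝ) + 1) * Real.Gamma ((n : ℝ) + 1) * Real.Gamma ((n : ℝ) + 1 / 2))

/-- RH-FREE. **Theorem 2.3**: «The off diagonal part `(1 − 𝒫)ρ_∞𝒫` is the infinitesimal in `L²(S¹)`
`(1 − 𝒫)κ𝒫 = Σ_ℕ (−1)^{n+1} 2π^{2n+½} ((4n+1)Γ(n+1)Γ(n+½))^{−1} |ξ_n⟩⟨η_n|` using the unit vectors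
`ξ_n = ξ_{x_n}/‖ξ_{x_n}‖`, `η_n = η_{x_n}/‖η_{x_n}‖`, `x_n = 1 − 4/(4n+3)`» (norm-convergent series of
rank-one operators, `T = 1` circle). Named fact.
[cite: ConnesConsani2021QuasiInner, Thm 2.3 «thmkappa» (arXiv chunk p0006:L51–L57)] -/
def thm_2_3 : Prop :=
  HasSum
    (fun n : ℕ => (thm23Coeff n : ℂ) •
      InnerProductSpace.rankOne ℂ ((‖xiVec 1 (xArch n)‖⁻¹ : ℂ) • xiVec 1 (xArch n))
        ((‖etaVec 1 (xArch n)‖⁻¹ : ℂ) • etaVec 1 (xArch n)))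
    (hardyOffDiag 1 (toLpOrZero ∞ haarAddCircle (circleRestrict 1 kappaArch)))

/-- RH-FREE. **Remark following Thm 2.3** (arXiv Remark 1): «The operator `(1 − 𝒫)ρ_∞𝒫` is injective and
has dense range» — read, as in print, as an operator FROM `H²` TO `(H²)^⊥` (its kernel meets `H²`
trivially since `Σ(1 − |x(n)|) = ∞`; its range is dense in `(H²)^⊥`). Named fact.
[cite: ConnesConsani2021QuasiInner, §2 Remark after Thm 2.3 (arXiv Rem. 1; chunk p0006:L72–L85)] -/
def remark_2_3 : Prop :=
  let A := hardyOffDiag 1 (toLpOrZero ∞ haarAddCircle (circleRestrict 1 kappaArch))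
  (∀ f ∈ hardySpace 1, A f = 0 → f = 0) ∧
    (hardySpace 1)ᗮ ≤ (Submodule.map A.toLinearMap (hardySpace 1)).topologicalClosure

/-- RH-FREE. **Proposition 2.4**: «The function `κ(v) := ρ_∞(½ + (v+1)/(v−1))` belongs to
`C^∞(S¹) + H^∞(𝒰)`» — boundary-value form: there are a smooth `1`-periodic `c` (the function
`θ ↦ C(e^{2πiθ})`, `C ∈ C^∞(S¹)`) and a bounded holomorphic `h` on the open unit disk whose radial boundary
values exist a.e. and equal `κ − c` (in print `c = πκ` of display «pikap», `h = κ − πκ`). Named fact.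
[cite: ConnesConsani2021QuasiInner, Prop 2.4 «propsum» (arXiv chunk p0006:L89; proof p0006:L91–p0007:L8)] -/
def prop_2_4 : Prop :=
  ∃ (c : ℝ → ℂ) (h : ℂ → ℂ), ContDiff ℝ (⊤ : ℕ∞) c ∧ Function.Periodic c 1 ∧
    DifferentiableOn ℂ h (Metric.ball 0 1) ∧ (∃ M : ℝ, ∀ v ∈ Metric.ball (0 : ℂ) 1, ‖h v‖ ≤ M) ∧
    ∀ᵐ x : ℝ, Tendsto (fun r : ℝ => h (r * Complex.exp (2 * π * I * x))) (𝓝[<] 1)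
      (𝓝 (kappaArch (Complex.exp (2 * π * I * x)) - c x))

/-! ### F. §3 — the functions `ρ_p` -/

/-- RH-FREE. **The non-archimedean ratio of local factors** `ρ_p(z) = (1 − p^{z−1})/(1 − p^{−z})`
(`= γ_p(z)/γ_p(1−z)`, `γ_p(z) = (1 − p^{−z})^{−1}`).
[cite: ConnesConsani2021QuasiInner, §1 display defining γ_∞, γ_p, ρ (p0003:L19) and §3 first display (arXiv chunk p0008:L6)] -/
def rhoPrime (p : ℕ) (z : ℂ) : ℂ := (1 - (p : ℂ) ^ (z - 1)) / (1 - (p : ℂ) ^ (-z))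

/-- RH-FREE. `ρ_p` equals the tree's NAME OF RECORD `ScalingHamiltonian.localFactorRatio` (cell ruling R16;
Connes–Consani, *The scaling Hamiltonian*, eq. (3.3) prints the exponent as `−(1 − z)`, this paper as `z − 1`).
[cite: ConnesConsani2021QuasiInner, §3 first display (arXiv chunk p0008:L6)] -/
theorem rhoPrime_eq_localFactorRatio (p : ℕ) (z : ℂ) :
    rhoPrime p z = ScalingHamiltonian.localFactorRatio p z := by
  rw [rhoPrime, ScalingHamiltonian.localFactorRatio, neg_sub]

/-- RH-FREE. `κ_p(v) := ρ_p(½ + (v+1)/(v−1)) = ρ_p ∘ ψ`. [cite: ConnesConsani2021QuasiInner, §3 (arXiv chunk p0008:L21)] -/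
def kappaPrime (p : ℕ) (v : ℂ) : ℂ := rhoPrime p (cayley v)

/-- RH-FREE. `p^{z + 2πi/log p} = p^z` (`p > 1`). [folklore] -/
private theorem natCast_cpow_add_period {p : ℕ} (hp : 1 < p) (z : ℂ) :
    (p : ℂ) ^ (z + 2 * π * I / Real.log p) = (p : ℂ) ^ z := by
  have hp0 : (p : ℂ) ≠ 0 := Nat.cast_ne_zero.2 (by omega)
  have hlog : (Real.log p : ℂ) ≠ 0 := ofReal_ne_zero.2 (Real.log_pos (by exact_mod_cast hp)).ne'
  rw [cpow_def_of_ne_zero hp0, cpow_def_of_ne_zero hp0, ← ofReal_natCast, ← ofReal_log (by positivity),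
    mul_add, Complex.exp_add]
  rw [show (Real.log p : ℂ) * (2 * π * I / Real.log p) = 2 * π * I by field_simp]
  rw [Complex.exp_two_pi_mul_I, mul_one]

/-- RH-FREE. **Lemma 3.1 (i)** (PROVED): «The function `ρ_p(z)` is periodic with period `2πi/log p`.»
[cite: ConnesConsani2021QuasiInner, Lemma 3.1 (i) (arXiv chunk p0008:L11; proof L13)] -/
theorem rhoPrime_periodic {p : ℕ} (hp : 1 < p) :
    Function.Periodic (rhoPrime p) (2 * π * I / Real.log p) := by
  intro z
  simp only [rhoPrime]
  rw [show z + 2 * π * I / Real.log p - 1 = (z - 1) + 2 * π * I / Real.log p by ring,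
    show -(z + 2 * π * I / Real.log p) = (-z - 2 * π * I / Real.log p) by ring,
    natCast_cpow_add_period hp]
  congr 2
  have := natCast_cpow_add_period hp (-z - 2 * π * I / Real.log p)
  rw [show -z - 2 * π * I / Real.log p + 2 * π * I / Real.log p = -z by ring] at this
  exact this.symm

/-- RH-FREE. **Lemma 3.1 (ii)**: «The poles of `ρ_p(z)` are simple and form the subset
`(2πi/log p)ℤ ⊂ ℂ₋`» — typed as: `ρ_p` has meromorphic order `−1` at each `2πik/log p`, is analytic at
every other point, and these points lie on `Re z = 0 ≤ ½`. Named fact, DISCHARGED below (`lemma_3_1_ii_holds`).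
[cite: ConnesConsani2021QuasiInner, Lemma 3.1 (ii) (arXiv chunk p0008:L11; proof L13–L17)] -/
def lemma_3_1_ii : Prop :=
  ∀ p : ℕ, p.Prime →
    (∀ k : ℤ, meromorphicOrderAt (rhoPrime p) (2 * π * I * k / Real.log p) = (-1 : ℤ)) ∧
    (∀ z : ℂ, (∀ k : ℤ, z ≠ 2 * π * I * k / Real.log p) → AnalyticAt ℂ (rhoPrime p) z) ∧
    (∀ k : ℤ, (2 * π * I * k / Real.log p : ℂ).re ≤ 1 / 2)

/-- RH-FREE. The numerator `1 − p^{z−1}` of `ρ_p` as a function (plumbing for Lemma 3.1 (ii)). [folklore] -/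
private def numF (p : ℕ) : ℂ → ℂ := fun z => 1 - (p : ℂ) ^ (z - 1)

/-- RH-FREE. The denominator `1 − p^{−z}` of `ρ_p` as a function (plumbing for Lemma 3.1 (ii)). [folklore] -/
private def denF (p : ℕ) : ℂ → ℂ := fun z => 1 - (p : ℂ) ^ (-z)

/-- RH-FREE. `ρ_p = numF / denF` as functions. [folklore] -/
private theorem rhoPrime_eq_div (p : ℕ) : rhoPrime p = numF p / denF p := by
  funext z; rfl

/-- RH-FREE. The numerator is entire. [folklore] -/
private theorem differentiable_numF {p : ℕ} (hp : 1 < p) : Differentiable ℂ (numF p) := by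
  have hp0 : (p : ℂ) ≠ 0 := Nat.cast_ne_zero.2 (by omega)
  unfold numF
  exact (differentiable_const _).sub ((differentiable_id.sub (differentiable_const _)).const_cpow
    (Or.inl hp0))

/-- RH-FREE. The denominator is entire. [folklore] -/
private theorem differentiable_denF {p : ℕ} (hp : 1 < p) : Differentiable ℂ (denF p) := by
  have hp0 : (p : ℂ) ≠ 0 := Nat.cast_ne_zero.2 (by omega)
  unfold denF
  exact (differentiable_const _).sub (differentiable_id.neg.const_cpow (Or.inl hp0))

/-- RH-FREE. The zeros of `1 − p^{−z}` are exactly `(2πi/log p)ℤ` («(ii) follows from periodicity and the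
expansion at `z = 0`»). [cite: ConnesConsani2021QuasiInner, Lemma 3.1 (ii), proof (arXiv chunk p0008:L13–L17)] -/
private theorem denF_eq_zero_iff {p : ℕ} (hp : 1 < p) (z : ℂ) :
    denF p z = 0 ↔ ∃ k : ℤ, z = 2 * π * I * k / Real.log p := by
  have hp0 : (p : ℂ) ≠ 0 := Nat.cast_ne_zero.2 (by omega)
  have hlog : (Real.log p : ℂ) ≠ 0 := ofReal_ne_zero.2 (Real.log_pos (by exact_mod_cast hp)).ne'
  have hlogp : Complex.log (p : ℂ) = (Real.log p : ℂ) := by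
    rw [← ofReal_natCast, ← ofReal_log (by positivity)]
  unfold denF
  rw [sub_eq_zero, eq_comm, cpow_def_of_ne_zero hp0, Complex.exp_eq_one_iff, hlogp]
  constructor
  · rintro ⟨k, hk⟩
    refine ⟨-k, ?_⟩
    rw [eq_div_iff hlog, Int.cast_neg]
    linear_combination -hk
  · rintro ⟨k, hk⟩
    refine ⟨-k, ?_⟩
    rw [hk, Int.cast_neg]
    field_simp

/-- RH-FREE. At a pole the numerator does not vanish: there `p^{−z} = 1`, so `p^{z−1} = p^{−1} ≠ 1` (the
poles are genuine, residue `(1 − 1/p)/log p ≠ 0`, p0008:L16).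
[cite: ConnesConsani2021QuasiInner, Lemma 3.1 (ii), proof (arXiv chunk p0008:L13–L17)] -/
private theorem numF_ne_zero_of_denF_eq_zero {p : ℕ} (hp : 1 < p) {z : ℂ} (hz : denF p z = 0) :
    numF p z ≠ 0 := by
  have hp0 : (p : ℂ) ≠ 0 := Nat.cast_ne_zero.2 (by omega)
  have h1 : (p : ℂ) ^ (-z) = 1 := by
    unfold denF at hz; exact (sub_eq_zero.1 hz).symm
  have h2 : (p : ℂ) ^ (z - 1) = (p : ℂ)⁻¹ := by
    have : (p : ℂ) ^ (z - 1) = ((p : ℂ) ^ (-z))⁻¹ * (p : ℂ)⁻¹ := by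
      rw [cpow_neg, inv_inv, cpow_sub _ _ hp0, cpow_one, div_eq_mul_inv]
    rw [this, h1, inv_one, one_mul]
  unfold numF
  rw [h2, sub_ne_zero]
  intro h
  have : (p : ℂ) = 1 := by
    have h' := congrArg (· * (p : ℂ)) h
    simpa [hp0] using h'
  exact absurd (by exact_mod_cast this : (p : ℕ) = 1) (by omega)

/-- RH-FREE. `d/dz (1 − p^{−z}) = p^{−z} log p`. [folklore] -/
private theorem deriv_denF {p : ℕ} (hp : 1 < p) (z : ℂ) :
    deriv (denF p) z = (p : ℂ) ^ (-z) * Complex.log p := by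
  have hp0 : (p : ℂ) ≠ 0 := Nat.cast_ne_zero.2 (by omega)
  have h : HasDerivAt (fun w : ℂ => (p : ℂ) ^ (-w)) ((p : ℂ) ^ (-z) * Complex.log p * (-1)) z :=
    (hasDerivAt_neg z).const_cpow (Or.inl hp0)
  have h2 : HasDerivAt (denF p) (0 - (p : ℂ) ^ (-z) * Complex.log p * (-1)) z :=
    (hasDerivAt_const z (1 : ℂ)).sub h
  rw [h2.deriv]
  ring

/-- RH-FREE. **Lemma 3.1 (ii) PROVED**: at each `2πik/log p` the denominator has a simple zero
(non-vanishing derivative `p^{−z} log p`) and the numerator does not vanish, so the meromorphic order of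
`ρ_p` is `0 − 1 = −1` (Mathlib `meromorphicOrderAt_div`); off these points `ρ_p` is a quotient of entire
functions with non-vanishing denominator. [cite: ConnesConsani2021QuasiInner, Lemma 3.1 (ii) (arXiv chunk p0008:L11–L17)] -/
theorem lemma_3_1_ii_holds : lemma_3_1_ii := by
  intro p hp
  have hp1 : 1 < p := hp.one_lt
  have hp0 : (p : ℂ) ≠ 0 := Nat.cast_ne_zero.2 (by omega)
  have hlogR : 0 < Real.log p := Real.log_pos (by exact_mod_cast hp1)
  have hlogC : Complex.log (p : ℂ) ≠ 0 := by
    rw [← ofReal_natCast, ← ofReal_log (by positivity)]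
    exact ofReal_ne_zero.2 hlogR.ne'
  have hN : ∀ z, AnalyticAt ℂ (numF p) z := fun z => (differentiable_numF hp1).analyticAt z
  have hD : ∀ z, AnalyticAt ℂ (denF p) z := fun z => (differentiable_denF hp1).analyticAt z
  refine ⟨fun k => ?_, fun z hz => ?_, fun k => ?_⟩
  · -- order `−1` at the poles
    set z₀ : ℂ := 2 * π * I * k / Real.log p with hz₀
    have hD0 : denF p z₀ = 0 := (denF_eq_zero_iff hp1 z₀).2 ⟨k, rfl⟩
    have hN0 : numF p z₀ ≠ 0 := numF_ne_zero_of_denF_eq_zero hp1 hD0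
    have hpw : ∀ w : ℂ, (p : ℂ) ^ w ≠ 0 := fun w h => by
      rw [cpow_eq_zero_iff] at h
      exact hp0 h.1
    have hD' : deriv (denF p) z₀ ≠ 0 := by
      rw [deriv_denF hp1]
      exact mul_ne_zero (hpw _) hlogC
    have h1 : meromorphicOrderAt (numF p) z₀ = 0 := by
      rw [(hN z₀).meromorphicOrderAt_eq, (hN z₀).analyticOrderAt_eq_zero.2 hN0]
      rfl
    have h2 : meromorphicOrderAt (denF p) z₀ = 1 := by
      rw [(hD z₀).meromorphicOrderAt_eq, (hD z₀).analyticOrderAt_eq_one_of_zero_deriv_ne_zero hD0 hD']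
      rfl
    rw [rhoPrime_eq_div, meromorphicOrderAt_div (hN z₀).meromorphicAt (hD z₀).meromorphicAt, h1, h2]
    rfl
  · -- analytic off the poles
    rw [rhoPrime_eq_div]
    refine (hN z).div (hD z) fun h => ?_
    obtain ⟨k, hk⟩ := (denF_eq_zero_iff hp1 z).1 h
    exact hz k hk
  · -- the poles lie on `Re z = 0 ≤ ½`
    have : (2 * π * I * k / Real.log p : ℂ).re = 0 := by
      rw [Complex.div_ofReal_re]
      simp
    rw [this]; norm_num

/-- RH-FREE. **Lemma 3.1 (iii)** (PROVED, with the printed constant): «The function `ρ_p(z)` is bounded in the half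
plane `{Re z ≤ −ε < 0}`» — «the numerator `1 − p^{z−1}` is bounded in absolute value by `1 + p^{−1}`. The
denominator is larger in absolute value than `p^ε − 1`.»
[cite: ConnesConsani2021QuasiInner, Lemma 3.1 (iii) (arXiv chunk p0008:L11; proof L19)] -/
theorem norm_rhoPrime_le_of_re_le {p : ℕ} (hp : 1 < p) {ε : ℝ} (hε : 0 < ε) {z : ℂ} (hz : z.re ≤ -ε) :
    ‖rhoPrime p z‖ ≤ (1 + (p : ℝ)⁻¹) / ((p : ℝ) ^ ε - 1) := by
  have hp1 : (1 : ℝ) < p := by exact_mod_cast hp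
  have hp0 : (0 : ℝ) < p := by positivity
  have hpε : 1 < (p : ℝ) ^ ε := Real.one_lt_rpow hp1 hε
  have hnorm : ∀ w : ℂ, ‖(p : ℂ) ^ w‖ = (p : ℝ) ^ w.re := fun w => by
    rw [← ofReal_natCast, norm_cpow_eq_rpow_re_of_pos hp0]
  -- numerator
  have hnum : ‖1 - (p : ℂ) ^ (z - 1)‖ ≤ 1 + (p : ℝ)⁻¹ := by
    refine (norm_sub_le _ _).trans ?_
    rw [norm_one, hnorm, sub_re, one_re, ← Real.rpow_neg_one]
    gcongr
    · exact hp1.le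
    · linarith
  -- denominator
  have hden : (p : ℝ) ^ ε - 1 ≤ ‖1 - (p : ℂ) ^ (-z)‖ := by
    have h1 : (p : ℝ) ^ ε ≤ ‖(p : ℂ) ^ (-z)‖ := by
      rw [hnorm, neg_re]
      exact Real.rpow_le_rpow_of_exponent_le hp1.le (by linarith)
    have h2 : ‖(p : ℂ) ^ (-z)‖ - ‖(1 : ℂ)‖ ≤ ‖1 - (p : ℂ) ^ (-z)‖ := by
      rw [← norm_neg (1 - (p : ℂ) ^ (-z)), neg_sub]
      exact norm_sub_norm_le _ _
    rw [norm_one] at h2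
    linarith
  rw [rhoPrime, norm_div]
  calc ‖1 - (p : ℂ) ^ (z - 1)‖ / ‖1 - (p : ℂ) ^ (-z)‖
      ≤ (1 + (p : ℝ)⁻¹) / ‖1 - (p : ℂ) ^ (-z)‖ :=
        div_le_div_of_nonneg_right hnum (norm_nonneg _)
    _ ≤ (1 + (p : ℝ)⁻¹) / ((p : ℝ) ^ ε - 1) :=
        div_le_div_of_nonneg_left (by positivity) (by linarith) hden

/-- RH-FREE. **`|ρ_p| = 1` on the critical line** (the denominator `1 − p^{−z}` is the complex conjugate of
the numerator `1 − p^{z−1}` when `Re z = ½`; «the ratio of local `L`-factors … is a function of modulus one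
on the critical line»). [cite: ConnesConsani2021QuasiInner, §1 (arXiv chunk p0003:L3) and §3 (p0008:L33–L39)] -/
theorem norm_rhoPrime_critical_line {p : ℕ} (hp : 1 < p) (t : ℝ) :
    ‖rhoPrime p (1 / 2 + t * I)‖ = 1 := by
  have hp0 : (0 : ℝ) < p := by positivity
  have hp1 : (1 : ℝ) < p := by exact_mod_cast hp
  have harg : ((p : ℂ)).arg ≠ π := by
    rw [natCast_arg]; exact Real.pi_ne_zero.symm
  -- the denominator is the conjugate of the numerator
  have hconj : (p : ℂ) ^ (-(1 / 2 + t * I)) = conj ((p : ℂ) ^ (1 / 2 + t * I - 1)) := by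
    have h1 : (-(1 / 2 + t * I) : ℂ) = conj (1 / 2 + t * I - 1) := by
      simp only [map_sub, map_add, map_mul, map_div₀, map_one, map_ofNat, conj_ofReal, conj_I]
      ring
    rw [h1, cpow_conj _ _ harg, map_natCast]
  have hre : ((1 / 2 + t * I - 1 : ℂ)).re = -(1 / 2) := by
    simp; norm_num
  have hN : (1 : ℂ) - (p : ℂ) ^ (1 / 2 + t * I - 1) ≠ 0 := by
    intro h
    have h1 : ‖(p : ℂ) ^ (1 / 2 + t * I - 1)‖ = 1 := by
      rw [(sub_eq_zero.1 h).symm, norm_one]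
    rw [← ofReal_natCast, norm_cpow_eq_rpow_re_of_pos hp0, hre] at h1
    have : (p : ℝ) ^ (-(1 / 2 : ℝ)) < 1 := Real.rpow_lt_one_of_one_lt_of_neg hp1 (by norm_num)
    linarith
  rw [rhoPrime, hconj, ← map_one conj, ← map_sub, norm_div, RCLike.norm_conj, map_one,
    div_self (norm_ne_zero_iff.2 hN)]

variable (T : ℝ) in
/-- RH-FREE. **`κ_p = ρ_p ∘ ψ` is unimodular on `S¹`** (`p > 1`; at every point): the modulus-one clause of
Fact 3.6 / of the quasi-inner definition for `ρ_p`.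
[cite: ConnesConsani2021QuasiInner, §3 (arXiv chunk p0008:L21) with Introduction, Definition (p0003:L5)] -/
theorem norm_circleRestrict_kappaPrime {p : ℕ} (hp : 1 < p) (x : AddCircle T) :
    ‖circleRestrict T (kappaPrime p) x‖ = 1 := by
  have hv : ‖((toCircle x : Circle) : ℂ)‖ = 1 := Circle.norm_coe _
  simp only [circleRestrict, kappaPrime]
  rw [cayley_eq_half_add_of_norm_eq_one hv]
  exact norm_rhoPrime_critical_line hp _

/-- RH-FREE. The poles of `κ_p` in the disk: `x_p(n) = ψ⁻¹(2πin/log p) = (4πn − i log p)/(4πn + 3i log p)`.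
[cite: ConnesConsani2021QuasiInner, §3 (arXiv chunk p0008:L50)] -/
def xPrime (p : ℕ) (n : ℤ) : ℂ := (4 * π * n - I * Real.log p) / (4 * π * n + 3 * I * Real.log p)

/-- RH-FREE. `x_p(n) = ψ⁻¹(2πin/log p)`. [cite: ConnesConsani2021QuasiInner, §3 (arXiv chunk p0008:L50)] -/
theorem xPrime_eq_cayleyInv {p : ℕ} (hp : 1 < p) (n : ℤ) :
    xPrime p n = cayleyInv (2 * π * I * n / Real.log p) := by
  have hlogpos : 0 < Real.log p := Real.log_pos (by exact_mod_cast hp)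
  set L : ℝ := Real.log p
  have hL0 : (L : ℂ) ≠ 0 := ofReal_ne_zero.2 hlogpos.ne'
  have hden : (4 * π * n + 3 * I * L : ℂ) ≠ 0 := by
    intro h
    have := congrArg Complex.im h
    simp at this
    linarith
  have hden' : (2 * (2 * π * I * n / L) - 3 : ℂ) ≠ 0 := by
    intro h
    have := congrArg Complex.re h
    simp at this
  rw [xPrime, cayleyInv, div_eq_div_iff hden hden']
  field_simp
  ring_nf
  rw [I_sq]
  ring

/-- RH-FREE. `|x_p(n)|² = (log²p + 16π²n²)/(9 log²p + 16π²n²) < 1`: the `x_p(n)` lie in the open unit disk.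
[cite: ConnesConsani2021QuasiInner, Prop 3.7, proof (arXiv chunk p0009:L57–L61)] -/
theorem norm_xPrime_lt_one {p : ℕ} (hp : 1 < p) (n : ℤ) : ‖xPrime p n‖ < 1 := by
  have hlog : 0 < Real.log p := Real.log_pos (by exact_mod_cast hp)
  unfold xPrime
  generalize Real.log (p : ℝ) = L at hlog ⊢
  have hden : 0 < ‖(4 * π * n + 3 * I * L : ℂ)‖ := by
    rw [norm_pos_iff]
    intro h
    have := congrArg Complex.im h
    simp at this
    linarith
  rw [norm_div, div_lt_one hden]
  rw [← sq_lt_sq₀ (norm_nonneg _) (norm_nonneg _), Complex.sq_norm, Complex.sq_norm]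
  simp [normSq_apply]
  nlinarith [hlog, Real.pi_pos]

/-- RH-FREE. **Display «offdiag2»**: the off-diagonal part of `κ_p` as a series of rank-one operators over
the poles, `(1 − 𝒫)κ_p𝒫 = 8(1 − 1/p) log p Σ_{n∈ℤ} (4πn + 3i log p)^{−2} |ξ_{x_p(n)}⟩⟨η_{x_p(n)}|` (derived in
print from the residue computation p0008:L24–L69 and Lemma 2.2).  Typed with the series converging in the
STRONG operator topology (pointwise on `L²(S¹)`, unconditionally over `ℤ`): the `n`-th term has operator norm
`8(1 − 1/p) log p · ‖ξ_{x_p(n)}‖‖η_{x_p(n)}‖/|4πn + 3i log p|² → (1 − 1/p)/log p ≠ 0`, so the series does not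
converge in norm — consistent with Lemma 3.5 (`= ((1−p)/p) U_− V I V^* U_+^*`, `I = Σ|δ_n⟩⟨δ_{−n}|` a strong
sum) and Fact 3.6. Named fact.
[cite: ConnesConsani2021QuasiInner, §3 display «offdiag2» (arXiv chunk p0008:L74)] -/
def display_offdiag2 : Prop :=
  ∀ p : ℕ, p.Prime → ∀ f : Lp ℂ 2 (haarAddCircle (T := 1)),
    HasSum
      (fun n : ℤ => (((8 * (1 - (p : ℂ)⁻¹) * Real.log p) / (4 * π * n + 3 * I * Real.log p) ^ 2) •
        InnerProductSpace.rankOne ℂ (xiVec 1 (xPrime p n)) (etaVec 1 (xPrime p n))) f)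
      (hardyOffDiag 1 (toLpOrZero ∞ haarAddCircle (circleRestrict 1 (kappaPrime p))) f)

open Classical in
/-- RH-FREE. A sequence as a vector of `ℓ²`; junk value `0` off `ℓ²`. [folklore] -/
def toL2SeqOrZero {ι : Type*} (f : ι → ℂ) : lp (fun _ : ι => ℂ) 2 :=
  if h : Memℓp f 2 then ⟨f, h⟩ else 0

/-- RH-FREE. The coordinates of the vectors `ζ_n` of Lemma 3.2:
`ζ_n(k) = 2^{3/2}(log p)^{1/2}(4πn + 3i log p)^{−1} x_p(n)^k` (we write `2^{3/2}(log p)^{1/2} = √(8 log p)`).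
[cite: ConnesConsani2021QuasiInner, Lemma 3.2, display defining ζ_n (arXiv chunk p0008:L80)] -/
def zetaCoord (p : ℕ) (n : ℤ) (k : ℕ) : ℂ :=
  (Real.sqrt (8 * Real.log p) : ℂ) / (4 * π * n + 3 * I * Real.log p) * xPrime p n ^ k

/-- RH-FREE. The vectors `ζ_n ∈ ℓ²(ℕ)` of Lemma 3.2 (`ζ_n(k) = zetaCoord p n k`; in `ℓ²` because `|x_p(n)| < 1`).
[cite: ConnesConsani2021QuasiInner, Lemma 3.2, display defining ζ_n (arXiv chunk p0008:L80)] -/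
def zetaVec (p : ℕ) (n : ℤ) : lp (fun _ : ℕ => ℂ) 2 :=
  toL2SeqOrZero (zetaCoord p n)

/-- RH-FREE. `ζ_n ∈ ℓ²(ℕ)` for `p > 1` (geometric decay `|x_p(n)|^k`).
[cite: ConnesConsani2021QuasiInner, Lemma 3.2 (arXiv chunk p0008:L77–L80)] -/
theorem memℓp_zetaCoord {p : ℕ} (hp : 1 < p) (n : ℤ) : Memℓp (zetaCoord p n) 2 := by
  have hx := norm_xPrime_lt_one hp n
  have hx2 : ‖xPrime p n‖ ^ 2 < 1 := by nlinarith [norm_nonneg (xPrime p n)]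
  rw [memℓp_gen_iff (by norm_num)]
  have : (fun k => ‖zetaCoord p n k‖ ^ (2 : ℝ≥0∞).toReal) = fun k =>
      ‖(Real.sqrt (8 * Real.log p) : ℂ) / (4 * π * n + 3 * I * Real.log p)‖ ^ 2 *
        (‖xPrime p n‖ ^ 2) ^ k := by
    funext k
    rw [ENNReal.toReal_ofNat, Real.rpow_two, zetaCoord, norm_mul, norm_pow, mul_pow, ← pow_mul, mul_comm k 2,
      pow_mul]
  rw [this]
  exact (summable_geometric_of_lt_one (sq_nonneg _) hx2).mul_left _

/-- RH-FREE. Coordinates of `ζ_n`. [cite: ConnesConsani2021QuasiInner, Lemma 3.2, display defining ζ_n (arXiv chunk p0008:L80)] -/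
theorem zetaVec_apply {p : ℕ} (hp : 1 < p) (n : ℤ) (k : ℕ) : zetaVec p n k = zetaCoord p n k := by
  simp only [zetaVec, toL2SeqOrZero, memℓp_zetaCoord hp n, dif_pos]

/-- RH-FREE. **Lemma 3.2**: «For any `n, m ∈ ℤ`, `⟨ζ_m | ζ_n⟩ = (2iπm − 2iπn + log p)^{−1}`»
(inner product of `ℓ²(ℕ)`, antilinear in the first variable as in Mathlib). Named fact, DISCHARGED below
(`lemma_3_2_holds`). [cite: ConnesConsani2021QuasiInner, Lemma 3.2 (arXiv chunk p0008:L77–L87; proof L89–L95)] -/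
def lemma_3_2 : Prop :=
  ∀ p : ℕ, p.Prime → ∀ m n : ℤ,
    ⟪zetaVec p m, zetaVec p n⟫_ℂ = 1 / (2 * I * π * m - 2 * I * π * n + Real.log p)

/-- RH-FREE. The algebra of the printed proof of Lemma 3.2: with `D = (A − 3iL)(B + 3iL)`,
`N = (A + iL)(B − iL)` one has `D − N = 8L((i/2)(A − B) + L)`, whence
`s²/D · (1 − N/D)⁻¹ = 1/((i/2)(A − B) + L)` for `s² = 8L` («since the sum is given by the inverse of
`1 − x_p(n) x̄_p(m)`»). [cite: ConnesConsani2021QuasiInner, Lemma 3.2, proof (arXiv chunk p0008:L89–L95)] -/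
private theorem lemma_3_2_algebra (A B L s : ℝ) (hL : L ≠ 0) (hs : (s : ℂ) ^ 2 = 8 * L) :
    (s : ℂ) / (A - 3 * I * L) * ((s : ℂ) / (B + 3 * I * L)) *
        (1 - (A + I * L) / (A - 3 * I * L) * ((B - I * L) / (B + 3 * I * L)))⁻¹ =
      1 / (I / 2 * (A - B) + L) := by
  have hD1 : (A - 3 * I * L : ℂ) ≠ 0 := by
    intro h
    have := congrArg Complex.im h
    simp at this
    exact hL this
  have hD2 : (B + 3 * I * L : ℂ) ≠ 0 := by
    intro h
    have := congrArg Complex.im h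
    simp at this
    exact hL this
  have hE : (I / 2 * (A - B) + L : ℂ) ≠ 0 := by
    intro h
    have := congrArg Complex.re h
    simp at this
    exact hL this
  have hD := mul_ne_zero hD1 hD2
  have key : (1 - (A + I * L) / (A - 3 * I * L) * ((B - I * L) / (B + 3 * I * L)) : ℂ) =
      8 * L * (I / 2 * (A - B) + L) / ((A - 3 * I * L) * (B + 3 * I * L)) := by
    rw [eq_div_iff hD, div_mul_div_comm, sub_mul, one_mul, div_mul_cancel₀ _ hD]
    linear_combination (-8 * (L : ℂ) ^ 2) * I_sq
  have hL' : (L : ℂ) ≠ 0 := ofReal_ne_zero.2 hL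
  have h8 : (8 * (L : ℂ) * (I / 2 * (A - B) + L)) ≠ 0 := mul_ne_zero (mul_ne_zero (by norm_num) hL') hE
  rw [key, div_mul_div_comm, ← sq, hs, inv_div, div_mul_div_comm, div_eq_div_iff (mul_ne_zero hD h8) hE]
  ring

/-- RH-FREE. **Lemma 3.2 PROVED** (geometric series in `ℓ²(ℕ)`).
[cite: ConnesConsani2021QuasiInner, Lemma 3.2 (arXiv chunk p0008:L77–L95)] -/
theorem lemma_3_2_holds : lemma_3_2 := by
  intro p hp m n
  have hp1 : 1 < p := hp.one_lt
  have hlog : 0 < Real.log p := Real.log_pos (by exact_mod_cast hp1)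
  have hxm := norm_xPrime_lt_one hp1 m
  have hxn := norm_xPrime_lt_one hp1 n
  -- the geometric series `Σ_k (x̄_p(m) x_p(n))^k`
  have hq : ‖conj (xPrime p m) * xPrime p n‖ < 1 := by
    rw [norm_mul, RCLike.norm_conj]
    nlinarith [norm_nonneg (xPrime p m), norm_nonneg (xPrime p n)]
  have hfun : (fun k : ℕ => ⟪zetaVec p m k, zetaVec p n k⟫_ℂ) = fun k =>
      conj ((Real.sqrt (8 * Real.log p) : ℂ) / (4 * π * m + 3 * I * Real.log p)) *
        ((Real.sqrt (8 * Real.log p) : ℂ) / (4 * π * n + 3 * I * Real.log p)) *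
        (conj (xPrime p m) * xPrime p n) ^ k := by
    funext k
    rw [zetaVec_apply hp1, zetaVec_apply hp1, RCLike.inner_apply', zetaCoord, zetaCoord, map_mul,
      map_pow]
    ring
  rw [lp.inner_eq_tsum, hfun, ((hasSum_geometric_of_norm_lt_one hq).mul_left _).tsum_eq]
  -- push the conjugations through the explicit expressions
  have hc1 : conj ((Real.sqrt (8 * Real.log p) : ℂ) / (4 * π * m + 3 * I * Real.log p)) =
      (Real.sqrt (8 * Real.log p) : ℂ) / (4 * π * m - 3 * I * Real.log p) := by
    simp only [map_div₀, map_add, map_mul, conj_ofReal, conj_I, map_ofNat, map_intCast]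
    ring
  have hc2 : conj (xPrime p m) = (4 * π * m + I * Real.log p) / (4 * π * m - 3 * I * Real.log p) := by
    simp only [xPrime, map_div₀, map_sub, map_add, map_mul, conj_ofReal, conj_I, map_ofNat, map_intCast]
    ring
  rw [hc1, hc2, xPrime]
  generalize Real.log (p : ℝ) = L at hlog ⊢
  have hs : ((Real.sqrt (8 * L) : ℝ) : ℂ) ^ 2 = 8 * (L : ℂ) := by
    rw [← ofReal_pow, Real.sq_sqrt (by positivity)]
    push_cast
    ring
  have key := lemma_3_2_algebra (4 * π * m) (4 * π * n) L (Real.sqrt (8 * L)) hlog.ne' hs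
  push_cast at key
  rw [show (2 * I * π * m - 2 * I * π * n + L : ℂ) = I / 2 * (4 * π * m - 4 * π * n) + L by ring]
  exact key

/-- RH-FREE. The Gram data of Lemma 3.3: `B` is a positive operator on `ℓ²(ℤ)` with
`⟨Bδ_m | Bδ_n⟩ = (2iπm − 2iπn + log p)^{−1}` (`δ_n = lp.single 2 n 1`).
[cite: ConnesConsani2021QuasiInner, Lemma 3.3 (arXiv chunk p0008:L97–L101)] -/
def IsLemma33Operator (p : ℕ) (B : lp (fun _ : ℤ => ℂ) 2 →L[ℂ] lp (fun _ : ℤ => ℂ) 2) : Prop :=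
  B.IsPositive ∧ ∀ m n : ℤ,
    ⟪B (lp.single 2 m (1 : ℂ)), B (lp.single 2 n (1 : ℂ))⟫_ℂ = 1 / (2 * I * π * m - 2 * I * π * n + Real.log p)

/-- RH-FREE. **Lemma 3.3**: «There exists a unique positive operator `B : ℓ²(ℤ) → ℓ²(ℤ)` such that
`⟨B(δ_m) | B(δ_n)⟩ = (2iπm − 2iπn + log p)^{−1}` for all `n, m ∈ ℤ`.  The operator `B` is bounded, with
bounded inverse and absolutely continuous spectrum the interval `[1, √p]`.»  MISPRINT RECORDED (typed in
corrected form, cc-ref please check): with the printed Gram normalisation — the one consistent with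
Lemma 3.2 (PROVED here), 3.4 and 3.5 — `B²` is unitarily (Fourier) the multiplication on `L²([0,1])` by
`s(x)/(p − 1)`, `s(x) = p^{1−x}`, NOT by `s` as the proof's display «`∫₀¹ s(x)e^{−2iπnx}dx = (log p +
2iπn)^{−1}`» (p0008:L108) asserts: in fact `∫₀¹ p^{1−x}e^{−2iπnx}dx = (p − 1)/(log p + 2iπn)`.  Hence the
spectrum of `B` is `[(p − 1)^{−1/2}, (p/(p − 1))^{1/2}]`, which is the printed `[1, √p]` exactly for `p = 2`;
invertibility («bounded inverse», the only clause used later, for Fact 3.6) is unaffected.  Typed: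
existence and uniqueness, invertibility, `spectrum = [(p−1)^{−1/2}, (p/(p−1))^{1/2}]`; the ABSOLUTE
CONTINUITY of the spectral measure is not typed (no Mathlib notion) — TODO(general form). Named fact.
[cite: ConnesConsani2021QuasiInner, Lemma 3.3 (arXiv chunk p0008:L97–L103; proof L105–L117)] -/
def lemma_3_3 : Prop :=
  ∀ p : ℕ, p.Prime →
    (∃! B : lp (fun _ : ℤ => ℂ) 2 →L[ℂ] lp (fun _ : ℤ => ℂ) 2, IsLemma33Operator p B) ∧
    ∀ B, IsLemma33Operator p B →
      IsUnit B ∧ spectrum ℂ B = (fun x : ℝ => (x : ℂ)) ''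
        Set.Icc (Real.sqrt (1 / ((p : ℝ) - 1))) (Real.sqrt ((p : ℝ) / ((p : ℝ) - 1)))

/-- RH-FREE. **Lemma 3.4**: «Consider the linear map `V : ℓ²(ℤ) → ℓ²(ℕ)`, `V(δ_n) = ζ_n`. Then the map
`VB^{−1} = U` is an isometry of `ℓ²(ℤ)` with a closed infinite dimensional subspace of `ℓ²(ℕ)`» — typed:
for the operator `B` of Lemma 3.3 there are a bounded `V` with `Vδ_n = ζ_n` and an isometry `U` with
`U ∘ B = V`, whose range is closed and infinite-dimensional. Named fact.
[cite: ConnesConsani2021QuasiInner, Lemma 3.4 (arXiv chunk p0008:L119; proof L121–L127)] -/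
def lemma_3_4 : Prop :=
  ∀ p : ℕ, p.Prime → ∀ B, IsLemma33Operator p B →
    ∃ (V : lp (fun _ : ℤ => ℂ) 2 →L[ℂ] lp (fun _ : ℕ => ℂ) 2)
      (U : lp (fun _ : ℤ => ℂ) 2 →ₗᵢ[ℂ] lp (fun _ : ℕ => ℂ) 2),
      (∀ n : ℤ, V (lp.single 2 n (1 : ℂ)) = zetaVec p n) ∧
      U.toContinuousLinearMap ∘L B = V ∧
      IsClosed (Set.range U) ∧ ¬ FiniteDimensional ℂ (LinearMap.range U.toLinearMap)

section Circle

variable (T : ℝ) [hT : Fact (0 < T)]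

/-- RH-FREE. The non-negative modes `e_0, e_1, …` are orthonormal. [folklore] -/
private theorem orthonormal_fourierLp_natCast :
    Orthonormal ℂ fun n : ℕ => fourierLp (T := T) 2 (n : ℤ) :=
  (orthonormal_fourier (T := T)).comp _ Nat.cast_injective

/-- RH-FREE. The modes `e_{−1}, e_{−2}, …` are orthonormal. [folklore] -/
private theorem orthonormal_fourierLp_negSucc :
    Orthonormal ℂ fun n : ℕ => fourierLp (T := T) 2 (-(n + 1 : ℤ)) :=
  (orthonormal_fourier (T := T)).comp (fun n : ℕ => -(n + 1 : ℤ)) fun a b h => by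
    simpa using h

/-- RH-FREE. `U_+ : ℓ²(ℕ) → L²(S¹)`, `U_+(δ_n) = z^n`, the unitary onto the range of `𝒫`.
[cite: ConnesConsani2021QuasiInner, §3 (arXiv chunk p0008:L129)] -/
def hardyIsoPlus : lp (fun _ : ℕ => ℂ) 2 →ₗᵢ[ℂ] Lp ℂ 2 (haarAddCircle (T := T)) :=
  (orthonormal_fourierLp_natCast T).orthogonalFamily.linearIsometry

/-- RH-FREE. `U_− : ℓ²(ℕ) → L²(S¹)`, `U_−(δ_n) = z^{−n−1}`, the unitary onto the range of `1 − 𝒫`.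
[cite: ConnesConsani2021QuasiInner, §3 (arXiv chunk p0008:L129)] -/
def hardyIsoMinus : lp (fun _ : ℕ => ℂ) 2 →ₗᵢ[ℂ] Lp ℂ 2 (haarAddCircle (T := T)) :=
  (orthonormal_fourierLp_negSucc T).orthogonalFamily.linearIsometry

/-- RH-FREE. `U_+(δ_n) = e_n`. [cite: ConnesConsani2021QuasiInner, §3 (arXiv chunk p0008:L129)] -/
theorem hardyIsoPlus_single (n : ℕ) :
    hardyIsoPlus T (lp.single 2 n (1 : ℂ)) = fourierLp (T := T) 2 (n : ℤ) := by
  classical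
  rw [hardyIsoPlus, OrthogonalFamily.linearIsometry_apply_single]
  simp

/-- RH-FREE. `U_−(δ_n) = e_{−n−1}`. [cite: ConnesConsani2021QuasiInner, §3 (arXiv chunk p0008:L129)] -/
theorem hardyIsoMinus_single (n : ℕ) :
    hardyIsoMinus T (lp.single 2 n (1 : ℂ)) = fourierLp (T := T) 2 (-(n + 1 : ℤ)) := by
  classical
  rw [hardyIsoMinus, OrthogonalFamily.linearIsometry_apply_single]
  simp

end Circle

/-- RH-FREE. **Lemma 3.5**: «Consider the involution `I : ℓ²(ℤ) → ℓ²(ℤ)`, `I(δ_n) = δ_{−n}`. Then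
`(1 − 𝒫)κ_p𝒫 = ((1 − p)/p) U_− V I V^* U_+^* = ((1 − p)/p) U_− U B I B U^* U_+^*`» — typed with `V`
(resp. `I`) ANY bounded operator with `Vδ_n = ζ_n` (resp. `Iδ_n = δ_{−n}`; both are unique by continuity,
and `V` exists by Lemma 3.4); adjoints are Mathlib's `ContinuousLinearMap.adjoint`; first equality typed.
Named fact. [cite: ConnesConsani2021QuasiInner, Lemma 3.5, display «offdiag2bis» (arXiv chunk p0008:L131–L135; proof p0008:L137–p0009:L32)] -/
def lemma_3_5 : Prop :=
  ∀ p : ℕ, p.Prime →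
    ∀ (V : lp (fun _ : ℤ => ℂ) 2 →L[ℂ] lp (fun _ : ℕ => ℂ) 2)
      (Iop : lp (fun _ : ℤ => ℂ) 2 →L[ℂ] lp (fun _ : ℤ => ℂ) 2),
      (∀ n : ℤ, V (lp.single 2 n (1 : ℂ)) = zetaVec p n) →
      (∀ n : ℤ, Iop (lp.single 2 n (1 : ℂ)) = lp.single 2 (-n) (1 : ℂ)) →
      hardyOffDiag 1 (toLpOrZero ∞ haarAddCircle (circleRestrict 1 (kappaPrime p))) =
        (((1 - (p : ℝ)) / p : ℝ) : ℂ) •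
          ((hardyIsoMinus 1).toContinuousLinearMap ∘L V ∘L Iop ∘L (ContinuousLinearMap.adjoint V) ∘L
            ContinuousLinearMap.adjoint (hardyIsoPlus 1).toContinuousLinearMap)

/-- RH-FREE. **Fact 3.6** (labelled «Fact» in print): «The function `ρ_p` is not quasi-inner» — since
`ρ_p` IS unimodular on the critical line, typed as: its boundary function is in `L^∞` with modulus one
a.e. and the off-diagonal part `(1 − 𝒫)κ_p𝒫` is NOT compact («has the same strength as `BIB`»). Named fact.
[cite: ConnesConsani2021QuasiInner, Fact 3.6 «factnq» (arXiv chunk p0009:L34–L36)] -/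
def fact_3_6 : Prop :=
  ∀ p : ℕ, p.Prime →
    MemLp (circleRestrict 1 (kappaPrime p)) ∞ (haarAddCircle (T := 1)) ∧
    (∀ᵐ x ∂(haarAddCircle (T := 1)), ‖circleRestrict 1 (kappaPrime p) x‖ = 1) ∧
    ¬ IsCompactOperator (hardyOffDiag 1 (toLpOrZero ∞ haarAddCircle (circleRestrict 1 (kappaPrime p))))

/-- RH-FREE. A **Blaschke factor** `(α − v)/(1 − ᾱv) · |α|/α` (as printed; `α ≠ 0` in the disk).
[cite: ConnesConsani2021QuasiInner, §3 (arXiv chunk p0009:L38–L41)] -/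
def blaschkeFactor (α v : ℂ) : ℂ := (α - v) / (1 - conj α * v) * ((‖α‖ : ℂ) / α)

/-- RH-FREE. **The Blaschke product `B_p`** over the poles `x_p(n)`, `n ∈ ℤ` (unconditional product `∏'`; the
`x_p(n)` satisfy the Blaschke condition `Σ(1 − |x_p(n)|) < ∞`, p0009:L57–L61, and accumulate only at
`v = 1`, so the product converges on `ℂ ∖ ({1} ∪ {1/x̄_p(n)})`, in particular on `S¹ ∖ {1}`).
[cite: ConnesConsani2021QuasiInner, Prop 3.7 (arXiv chunk p0009:L46)] -/
def blaschkePrime (p : ℕ) (v : ℂ) : ℂ := ∏' n : ℤ, blaschkeFactor (xPrime p n) v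

/-- RH-FREE. **Proposition 3.7**: «Let `B_p(v)` be the Blaschke product associated to the sequence
`x_p(n) ∈ 𝒰`, `n ∈ ℤ`. (i) The product `ι(v) = κ_p(v)B_p(v)` is the inner function `−p^{(v+1)/(v−1)}`.
(ii) The kernel of `(1 − 𝒫)κ_p𝒫` is the shift invariant subspace of `H²(𝒰)` of multiples of `B_p`.
(iii) The cokernel of `(1 − 𝒫)κ_p𝒫` is the image of its kernel by the unitary involution `J`,
`Jf(z) := z^{−1}f(z^{−1})`.»  Typed: (i) the Blaschke product is multipliable on the open disk and the
identity holds there off the poles `x_p(n)` of `κ_p` (= zeros of `B_p`; at those points Lean's junk value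
`κ_p = 0` breaks the pointwise identity, which in print is one of holomorphic functions); (ii) `ker ∩ H² = B_p · H²` (multiplication by the boundary function of `B_p`);
(iii) for ANY bounded `J` with `J e_n = e_{−n−1}` (the printed involution, unique by continuity), the kernel
of the adjoint inside `(H²)^⊥` is `J(ker ∩ H²)`. Named fact.
[cite: ConnesConsani2021QuasiInner, Prop 3.7 «Blaschke» (arXiv chunk p0009:L46–L52; proof p0009:L54–p0010:L4)] -/
def prop_3_7 : Prop :=
  ∀ p : ℕ, p.Prime →
    let A := hardyOffDiag 1 (toLpOrZero ∞ haarAddCircle (circleRestrict 1 (kappaPrime p)))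
    let K : Submodule ℂ (Lp ℂ 2 (haarAddCircle (T := 1))) := LinearMap.ker A.toLinearMap ⊓ hardySpace 1
    (∀ v ∈ Metric.ball (0 : ℂ) 1, Multipliable fun n : ℤ => blaschkeFactor (xPrime p n) v) ∧
    (∀ v ∈ Metric.ball (0 : ℂ) 1, (∀ n : ℤ, v ≠ xPrime p n) →
      kappaPrime p v * blaschkePrime p v = -(p : ℂ) ^ ((v + 1) / (v - 1))) ∧
    K = Submodule.map
      (mulOp haarAddCircle (toLpOrZero ∞ haarAddCircle (circleRestrict 1 (blaschkePrime p)))).toLinearMap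
      (hardySpace 1) ∧
    ∀ J : Lp ℂ 2 (haarAddCircle (T := 1)) →L[ℂ] Lp ℂ 2 (haarAddCircle (T := 1)),
      (∀ n : ℤ, J (fourierLp (T := 1) 2 n) = fourierLp (T := 1) 2 (-n - 1)) →
      LinearMap.ker (ContinuousLinearMap.adjoint A).toLinearMap ⊓ (hardySpace 1)ᗮ =
        Submodule.map J.toLinearMap K

/-- RH-FREE. **The pole-part decomposition of `ρ_p`** (end of §3, PROVED where `p^z ≠ 1`):
`ρ_p(z) = ((p − 1)/2p) coth(z log p / 2) − p^{z−1} + (p − 1)/2p` («the first term is the sum of the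
simple pole parts while the last terms define a bounded holomorphic function belonging to `H^∞(ℂ₋)`»).
[cite: ConnesConsani2021QuasiInner, §3 last display (arXiv chunk p0010:L8–L12)] -/
theorem rhoPrime_eq_coth {p : ℕ} (hp : 1 < p) {z : ℂ} (hz : (p : ℂ) ^ z ≠ 1) :
    rhoPrime p z =
      ((p : ℂ) - 1) / (2 * p) * (Complex.cosh (z * Real.log p / 2) / Complex.sinh (z * Real.log p / 2)) -
        (p : ℂ) ^ (z - 1) + ((p : ℂ) - 1) / (2 * p) := by
  have hp0 : (p : ℂ) ≠ 0 := Nat.cast_ne_zero.2 (by omega)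
  have hlogR : 0 < Real.log p := Real.log_pos (by exact_mod_cast hp)
  -- write everything with `w = p^{z/2} = exp (z log p / 2)`
  set w : ℂ := Complex.exp (z * Real.log p / 2) with hw
  have hw0 : w ≠ 0 := Complex.exp_ne_zero _
  have hpz : (p : ℂ) ^ z = w ^ 2 := by
    rw [cpow_def_of_ne_zero hp0, ← ofReal_natCast, ← ofReal_log (by positivity), hw, ← Complex.exp_nat_mul]
    push_cast; ring_nf
  have hpz1 : (p : ℂ) ^ (z - 1) = w ^ 2 / p := by
    rw [cpow_sub _ _ hp0, cpow_one, hpz]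
  have hpnz : (p : ℂ) ^ (-z) = (w ^ 2)⁻¹ := by
    rw [cpow_neg, hpz]
  have hcosh : Complex.cosh (z * Real.log p / 2) = (w + w⁻¹) / 2 := by
    rw [Complex.cosh, hw, Complex.exp_neg]
  have hsinh : Complex.sinh (z * Real.log p / 2) = (w - w⁻¹) / 2 := by
    rw [Complex.sinh, hw, Complex.exp_neg]
  have hw1 : w ^ 2 ≠ 1 := by rwa [← hpz]
  have hwm : (w - w⁻¹) ≠ 0 := by
    intro h
    apply hw1
    have : w = w⁻¹ := sub_eq_zero.1 h
    calc w ^ 2 = w * w := sq w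
      _ = w * w⁻¹ := by rw [← this]
      _ = 1 := mul_inv_cancel₀ hw0
  have hw21 : (w ^ 2 - 1) ≠ 0 := sub_ne_zero.2 hw1
  have h1w : (1 - (w ^ 2)⁻¹) ≠ 0 := by
    rw [sub_ne_zero, ne_comm, Ne, inv_eq_one]; exact hw1
  rw [rhoPrime, hpz1, hpnz, hcosh, hsinh]
  field_simp
  ring


/-! ### G. Discharge of Lemma 2.2 (geometric Fourier series on the circle) -/

section LemmaTwoTwo

variable {T : ℝ} [hT : Fact (0 < T)]

omit hT in
/-- RH-FREE. `e_n(x) = z^n` with `z = e^{2πix/T}` the point of the unit circle. [folklore] -/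
private theorem fourier_apply_eq_zpow (n : ℤ) (x : AddCircle T) :
    fourier n x = ((toCircle x : Circle) : ℂ) ^ n := by
  rw [fourier_apply, toCircle_zsmul]
  simp

omit hT in
/-- RH-FREE. `e_a e_b = e_{a+b}`. [folklore] -/
private theorem fourier_mul_fourier (a b : ℤ) :
    (fourier (T := T) a) * (fourier (T := T) b) = fourier (T := T) (a + b) := by
  ext θ
  simp

/-- RH-FREE. The geometric Fourier series `Σ_k c^k z^k = (1 − cz)⁻¹` converges in `C(S¹)` for `|c| < 1`
(the expansion `η_x = Σ x̄^k z^k` behind Lemma 2.2). [cite: ConnesConsani2021QuasiInner, Lemma 2.2, proof (arXiv chunk p0006:L23–L47)] -/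
private theorem hasSum_geometric_fourier_nat (c : ℂ) (hc : ‖c‖ < 1) :
    HasSum (fun k : ℕ => c ^ k • fourier (T := T) (k : ℤ))
      (⟨fun x : AddCircle T => (1 - c * (toCircle x : ℂ))⁻¹, by
        refine Continuous.inv₀ (by fun_prop) fun x h => ?_
        have h1 : ‖c * (toCircle x : ℂ)‖ < 1 := by
          rw [norm_mul, Circle.norm_coe, mul_one]; exact hc
        rw [sub_eq_zero] at h
        rw [← h, norm_one] at h1
        exact lt_irrefl _ h1⟩ : C(AddCircle T, ℂ)) := by
  have hsum : Summable fun k : ℕ => c ^ k • fourier (T := T) (k : ℤ) := by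
    refine Summable.of_norm_bounded (g := fun k : ℕ => ‖c‖ ^ k) (summable_geometric_of_lt_one
      (norm_nonneg _) hc) fun k => ?_
    rw [norm_smul, fourier_norm, mul_one, norm_pow]
  convert hsum.hasSum using 1
  ext x
  have hx : ‖c * (toCircle x : ℂ)‖ < 1 := by
    rw [norm_mul, Circle.norm_coe, mul_one]; exact hc
  have h1 := (ContinuousMap.evalCLM ℂ x).hasSum hsum.hasSum
  simp only [ContinuousMap.evalCLM_apply, ContinuousMap.smul_apply, smul_eq_mul] at h1
  have h2 : HasSum (fun k : ℕ => (c * (toCircle x : ℂ)) ^ k) (1 - c * (toCircle x : ℂ))⁻¹ :=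
    hasSum_geometric_of_norm_lt_one hx
  have h3 : (fun k : ℕ => c ^ k * fourier (T := T) (k : ℤ) x) = fun k => (c * (toCircle x : ℂ)) ^ k := by
    funext k
    rw [fourier_apply_eq_zpow, zpow_natCast, mul_pow]
  rw [h3] at h1
  simp only [ContinuousMap.coe_mk]
  exact (h2.unique h1)

/-- RH-FREE. The geometric Fourier series in negative modes `Σ_k c^k z^{−k−1} = z⁻¹(1 − cz⁻¹)⁻¹` converges in
`C(S¹)` for `|c| < 1` (the expansion of `ξ_x = f_x` behind Lemma 2.2).
[cite: ConnesConsani2021QuasiInner, Lemma 2.2, proof (arXiv chunk p0006:L23–L47)] -/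
private theorem hasSum_geometric_fourier_negSucc (c : ℂ) (hc : ‖c‖ < 1) :
    HasSum (fun k : ℕ => c ^ k • fourier (T := T) (-(k + 1 : ℤ)))
      (⟨fun x : AddCircle T => ((toCircle x : ℂ))⁻¹ * (1 - c * ((toCircle x : ℂ))⁻¹)⁻¹, by
        have hinv : Continuous fun x : AddCircle T => ((toCircle x : ℂ))⁻¹ :=
          Continuous.inv₀ (by fun_prop) fun x => Circle.coe_ne_zero _
        refine hinv.mul ?_
        refine Continuous.inv₀ (continuous_const.sub (continuous_const.mul hinv)) fun x h => ?_
        have h1 : ‖c * ((toCircle x : ℂ))⁻¹‖ < 1 := by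
          rw [norm_mul, norm_inv, Circle.norm_coe, inv_one, mul_one]; exact hc
        rw [sub_eq_zero] at h
        rw [← h, norm_one] at h1
        exact lt_irrefl _ h1⟩ : C(AddCircle T, ℂ)) := by
  have hsum : Summable fun k : ℕ => c ^ k • fourier (T := T) (-(k + 1 : ℤ)) := by
    refine Summable.of_norm_bounded (g := fun k : ℕ => ‖c‖ ^ k) (summable_geometric_of_lt_one
      (norm_nonneg _) hc) fun k => ?_
    rw [norm_smul, fourier_norm, mul_one, norm_pow]
  convert hsum.hasSum using 1
  ext x
  have hx : ‖c * ((toCircle x : ℂ))⁻¹‖ < 1 := by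
    rw [norm_mul, norm_inv, Circle.norm_coe, inv_one, mul_one]; exact hc
  have h1 := (ContinuousMap.evalCLM ℂ x).hasSum hsum.hasSum
  simp only [ContinuousMap.evalCLM_apply, ContinuousMap.smul_apply, smul_eq_mul] at h1
  have h2 : HasSum (fun k : ℕ => ((toCircle x : ℂ))⁻¹ * (c * ((toCircle x : ℂ))⁻¹) ^ k)
      (((toCircle x : ℂ))⁻¹ * (1 - c * ((toCircle x : ℂ))⁻¹)⁻¹) :=
    (hasSum_geometric_of_norm_lt_one hx).mul_left _
  have h3 : (fun k : ℕ => c ^ k * fourier (T := T) (-(k + 1 : ℤ)) x) =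
      fun k => ((toCircle x : ℂ))⁻¹ * (c * ((toCircle x : ℂ))⁻¹) ^ k := by
    funext k
    rw [fourier_apply_eq_zpow, show (-(k + 1 : ℤ)) = -((k + 1 : ℕ) : ℤ) by push_cast; ring, zpow_neg,
      zpow_natCast, ← inv_pow]
    ring
  rw [h3] at h1
  simp only [ContinuousMap.coe_mk]
  exact h2.unique h1

omit hT in
/-- RH-FREE. Parseval for an orthonormal sequence: `f = Σ a_k v_k ⇒ ‖f‖² = Σ |a_k|²`. [folklore] -/
private theorem hasSum_norm_sq_of_hasSum_orthonormal {E : Type*} [NormedAddCommGroup E]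
    [InnerProductSpace ℂ E] {v : ℕ → E} (hv : Orthonormal ℂ v) {a : ℕ → ℂ} {f : E}
    (hf : HasSum (fun k => a k • v k) f) : HasSum (fun k => ‖a k‖ ^ 2) (‖f‖ ^ 2) := by
  classical
  have hcoef : ∀ k, ⟪v k, f⟫_ℂ = a k := by
    intro k
    have h1 := (innerSL ℂ (v k)).hasSum hf
    simp only [innerSL_apply_apply, inner_smul_right] at h1
    have h2 : (fun j => a j * ⟪v k, v j⟫_ℂ) = fun j => if j = k then a k else 0 := by
      funext j
      rw [orthonormal_iff_ite.1 hv k j]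
      by_cases hjk : j = k
      · subst hjk; simp
      · simp [hjk, Ne.symm hjk]
    rw [h2] at h1
    exact h1.unique (hasSum_ite_eq k (a k))
  have h3 := (innerSL ℂ f).hasSum hf
  simp only [innerSL_apply_apply, inner_smul_right] at h3
  have h4 : (fun k => a k * ⟪f, v k⟫_ℂ) = fun k => ((‖a k‖ ^ 2 : ℝ) : ℂ) := by
    funext k
    rw [← inner_conj_symm, hcoef, mul_conj, normSq_eq_norm_sq]
  rw [h4] at h3
  have h5 : ⟪f, f⟫_ℂ = ((‖f‖ ^ 2 : ℝ) : ℂ) := by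
    rw [← inner_self_ofReal_re, inner_self_eq_norm_sq]
    rfl
  rw [h5] at h3
  exact Complex.hasSum_ofReal.1 h3

/-- RH-FREE. A continuous function on the circle, sent to `L^p` by `toLpOrZero`, is its `ContinuousMap.toLp`.
[cite: ConnesConsani2021QuasiInner, Introduction, Definition (arXiv chunk p0003:L5)] -/
theorem toLpOrZero_eq_toLp_continuousMap (p : ℝ≥0∞) [Fact (1 ≤ p)] (F : C(AddCircle T, ℂ)) :
    toLpOrZero p haarAddCircle (⇑F) = ContinuousMap.toLp p haarAddCircle ℂ F := by
  have hF : MemLp (⇑F) p (haarAddCircle (T := T)) :=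
    ContinuousMap.memLp (p := p) (μ := haarAddCircle) ℂ F
  rw [toLpOrZero, dif_pos hF]
  exact Lp.ext (hF.coeFn_toLp.trans (ContinuousMap.coeFn_toLp (p := p) haarAddCircle F).symm)

/-- RH-FREE. **`η_x = Σ_k x̄^k e_k` in `L²(S¹)`** (`|x| < 1`).
[cite: ConnesConsani2021QuasiInner, Lemma 2.2 «uinftyqi1» (arXiv chunk p0006:L11–L21)] -/
theorem hasSum_etaVec (x : ℂ) (hx : ‖x‖ < 1) :
    HasSum (fun k : ℕ => (conj x) ^ k • fourierLp (T := T) 2 (k : ℤ)) (etaVec T x) := by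
  have hc : ‖conj x‖ < 1 := by rwa [RCLike.norm_conj]
  have h := (ContinuousMap.toLp 2 haarAddCircle ℂ).hasSum (hasSum_geometric_fourier_nat (T := T) _ hc)
  simp only [map_smul] at h
  convert h using 1
  rw [etaVec, ← toLpOrZero_eq_toLp_continuousMap]
  rfl

/-- RH-FREE. **`ξ_x = Σ_k x^k e_{−k−1}` in `L²(S¹)`** (`|x| < 1`).
[cite: ConnesConsani2021QuasiInner, Lemma 2.2 «uinftyqi1» (arXiv chunk p0006:L11–L21)] -/
theorem hasSum_xiVec (x : ℂ) (hx : ‖x‖ < 1) :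
    HasSum (fun k : ℕ => x ^ k • fourierLp (T := T) 2 (-(k + 1 : ℤ))) (xiVec T x) := by
  have h := (ContinuousMap.toLp 2 haarAddCircle ℂ).hasSum (hasSum_geometric_fourier_negSucc (T := T) _ hx)
  simp only [map_smul] at h
  convert h using 1
  rw [xiVec, ← toLpOrZero_eq_toLp_continuousMap]
  rfl

/-- RH-FREE. **`‖η_x‖² = (1 − |x|²)⁻¹`** (Lemma 2.2, PROVED by Parseval).
[cite: ConnesConsani2021QuasiInner, Lemma 2.2 (arXiv chunk p0006:L17–L21)] -/
theorem norm_etaVec_sq (x : ℂ) (hx : ‖x‖ < 1) : ‖etaVec T x‖ ^ 2 = (1 - ‖x‖ ^ 2)⁻¹ := by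
  have h1 := hasSum_norm_sq_of_hasSum_orthonormal (orthonormal_fourierLp_natCast T)
    (hasSum_etaVec x hx)
  have h2 : HasSum (fun k : ℕ => (‖x‖ ^ 2) ^ k) (1 - ‖x‖ ^ 2)⁻¹ :=
    hasSum_geometric_of_lt_one (sq_nonneg _) (by nlinarith [norm_nonneg x])
  have h3 : (fun k : ℕ => ‖(conj x) ^ k‖ ^ 2) = fun k => (‖x‖ ^ 2) ^ k := by
    funext k; rw [norm_pow, RCLike.norm_conj, ← pow_mul, mul_comm, pow_mul]
  rw [h3] at h1
  exact h1.unique h2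

/-- RH-FREE. **`‖ξ_x‖² = (1 − |x|²)⁻¹`** (Lemma 2.2, PROVED by Parseval).
[cite: ConnesConsani2021QuasiInner, Lemma 2.2 (arXiv chunk p0006:L17–L21)] -/
theorem norm_xiVec_sq (x : ℂ) (hx : ‖x‖ < 1) : ‖xiVec T x‖ ^ 2 = (1 - ‖x‖ ^ 2)⁻¹ := by
  have h1 := hasSum_norm_sq_of_hasSum_orthonormal (orthonormal_fourierLp_negSucc T)
    (hasSum_xiVec x hx)
  have h2 : HasSum (fun k : ℕ => (‖x‖ ^ 2) ^ k) (1 - ‖x‖ ^ 2)⁻¹ :=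
    hasSum_geometric_of_lt_one (sq_nonneg _) (by nlinarith [norm_nonneg x])
  have h3 : (fun k : ℕ => ‖x ^ k‖ ^ 2) = fun k => (‖x‖ ^ 2) ^ k := by
    funext k; rw [norm_pow, ← pow_mul, mul_comm, pow_mul]
  rw [h3] at h1
  exact h1.unique h2

/-- RH-FREE. **`‖ξ_x‖‖η_x‖ = (1 − |x|²)⁻¹`** (Lemma 2.2, PROVED).
[cite: ConnesConsani2021QuasiInner, Lemma 2.2 (arXiv chunk p0006:L17–L21)] -/
theorem norm_xiVec_mul_norm_etaVec (x : ℂ) (hx : ‖x‖ < 1) :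
    ‖xiVec T x‖ * ‖etaVec T x‖ = (1 - ‖x‖ ^ 2)⁻¹ := by
  have h1 := norm_xiVec_sq (T := T) x hx
  have h2 := norm_etaVec_sq (T := T) x hx
  have h3 : ‖xiVec T x‖ = ‖etaVec T x‖ := by
    have := h1.trans h2.symm
    exact (sq_eq_sq₀ (norm_nonneg _) (norm_nonneg _)).1 this
  rw [h3, ← sq, h2]

/-- RH-FREE. Nonnegative modes lie in `H²`. [cite: ConnesConsani2021QuasiInner, Introduction, Definition (arXiv chunk p0003:L5)] -/
private theorem fourierLp_mem_hardySpace (m : ℕ) : fourierLp (T := T) 2 (m : ℤ) ∈ hardySpace T := by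
  rw [mem_hardySpace_iff]
  intro n
  rw [orthonormal_iff_ite.1 (orthonormal_fourier (T := T))]
  simp
  omega

/-- RH-FREE. Negative modes lie in the span of negative modes. [folklore] -/
private theorem fourierLp_neg_mem_hardyNegModes (n : ℕ) :
    fourierLp (T := T) 2 (-(n + 1 : ℤ)) ∈ hardyNegModes T :=
  Submodule.subset_span ⟨n, rfl⟩

/-- RH-FREE. `𝒫 e_m = e_m` for `m ≥ 0`. [cite: ConnesConsani2021QuasiInner, Introduction, Definition (arXiv chunk p0003:L5)] -/
theorem hardyProjection_fourierLp_natCast (m : ℕ) :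
    hardyProjection T (fourierLp (T := T) 2 (m : ℤ)) = fourierLp (T := T) 2 (m : ℤ) := by
  rw [hardyProjection]
  exact Submodule.starProjection_eq_self_iff.2 (fourierLp_mem_hardySpace m)

/-- RH-FREE. `𝒫 e_{−n−1} = 0`. [cite: ConnesConsani2021QuasiInner, Introduction, Definition (arXiv chunk p0003:L5)] -/
theorem hardyProjection_fourierLp_negSucc (n : ℕ) :
    hardyProjection T (fourierLp (T := T) 2 (-(n + 1 : ℤ))) = 0 := by
  rw [hardyProjection]
  exact Submodule.starProjection_orthogonal_apply_eq_zero (fourierLp_neg_mem_hardyNegModes n)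

/-- RH-FREE. Multiplication of continuous functions inside `L²(S¹)`: `M_F (G) = F·G`.
[cite: ConnesConsani2021QuasiInner, Introduction, Definition (arXiv chunk p0003:L5)] -/
theorem mulOp_toLp_toLp (F G : C(AddCircle T, ℂ)) :
    mulOp haarAddCircle (ContinuousMap.toLp ∞ haarAddCircle ℂ F) (ContinuousMap.toLp 2 haarAddCircle ℂ G) =
      ContinuousMap.toLp 2 haarAddCircle ℂ (F * G) := by
  apply Lp.ext
  have h1 := coeFn_mulOp haarAddCircle (ContinuousMap.toLp ∞ haarAddCircle ℂ F)
    (ContinuousMap.toLp 2 haarAddCircle ℂ G)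
  have h2 := ContinuousMap.coeFn_toLp (p := ∞) (𝕜 := ℂ) haarAddCircle F
  have h3 := ContinuousMap.coeFn_toLp (p := 2) (𝕜 := ℂ) haarAddCircle G
  have h4 := ContinuousMap.coeFn_toLp (p := 2) (𝕜 := ℂ) haarAddCircle (F * G)
  filter_upwards [h1, h2, h3, h4] with y hy1 hy2 hy3 hy4
  rw [hy1, hy2, hy3, hy4]
  rfl

/-- RH-FREE. Fourier coefficients of an `L²` sum `Σ_j a_j e_{σ j}`. [folklore] -/
private theorem hasSum_inner_fourierLp_of_hasSum {a : ℕ → ℂ} {σ : ℕ → ℤ}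
    {f : Lp ℂ 2 (haarAddCircle (T := T))}
    (h : HasSum (fun j => a j • fourierLp (T := T) 2 (σ j)) f) (i : ℤ) :
    HasSum (fun j => if i = σ j then a j else 0) ⟪fourierLp (T := T) 2 i, f⟫_ℂ := by
  classical
  have h1 := (innerSL ℂ (fourierLp (T := T) 2 i)).hasSum h
  simp only [innerSL_apply_apply, inner_smul_right] at h1
  have h2 : (fun j => a j * ⟪fourierLp (T := T) 2 i, fourierLp (T := T) 2 (σ j)⟫_ℂ) =
      fun j => if i = σ j then a j else 0 := by
    funext j
    rw [orthonormal_iff_ite.1 (orthonormal_fourier (T := T)) i (σ j)]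
    split_ifs <;> simp
  rw [h2] at h1
  exact h1

/-- RH-FREE. `⟨e_k | η_x⟩ = x̄^k` for `k ≥ 0`. [cite: ConnesConsani2021QuasiInner, Lemma 2.2, proof (arXiv chunk p0006:L41)] -/
theorem inner_fourierLp_natCast_etaVec (x : ℂ) (hx : ‖x‖ < 1) (k : ℕ) :
    ⟪fourierLp (T := T) 2 (k : ℤ), etaVec T x⟫_ℂ = conj x ^ k := by
  classical
  have h := hasSum_inner_fourierLp_of_hasSum (hasSum_etaVec (T := T) x hx) (k : ℤ)
  have h2 : (fun j : ℕ => if (k : ℤ) = (j : ℤ) then conj x ^ j else 0) =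
      fun j => if j = k then conj x ^ k else 0 := by
    funext j
    by_cases hjk : j = k
    · subst hjk; simp
    · have : (k : ℤ) ≠ (j : ℤ) := fun h' => hjk (by exact_mod_cast h'.symm)
      simp [hjk, this]
  rw [h2] at h
  exact h.unique (hasSum_ite_eq k (conj x ^ k))

/-- RH-FREE. `⟨e_{−k−1} | η_x⟩ = 0`. [cite: ConnesConsani2021QuasiInner, Lemma 2.2, proof (arXiv chunk p0006:L41)] -/
theorem inner_fourierLp_negSucc_etaVec (x : ℂ) (hx : ‖x‖ < 1) (k : ℕ) :
    ⟪fourierLp (T := T) 2 (-(k + 1 : ℤ)), etaVec T x⟫_ℂ = 0 := by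
  classical
  have h := hasSum_inner_fourierLp_of_hasSum (hasSum_etaVec (T := T) x hx) (-(k + 1 : ℤ))
  have h2 : (fun j : ℕ => if (-(k + 1 : ℤ)) = (j : ℤ) then conj x ^ j else 0) = fun _ => 0 := by
    funext j
    have : (-(k + 1 : ℤ)) ≠ (j : ℤ) := by omega
    rw [if_neg this]
  rw [h2] at h
  exact h.unique hasSum_zero

/-- RH-FREE. **Lemma 2.2, the operator identity `(1 − 𝒫) f_x 𝒫 = |ξ_x⟩⟨η_x|`** (PROVED: both sides are
bounded and agree on every Fourier mode — on `e_k`, `k ≥ 0`, `f_x e_k = Σ_j x^j e_{k−j−1}` whose projection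
onto `(H²)^⊥` is `x^k ξ_x = ⟨η_x|e_k⟩ ξ_x`; on negative modes both vanish).
[cite: ConnesConsani2021QuasiInner, Lemma 2.2 «uinftyqi1» (arXiv chunk p0006:L11–L47)] -/
theorem hardyOffDiag_szegoNeg (x : ℂ) (hx : ‖x‖ < 1) :
    hardyOffDiag T (toLpOrZero ∞ haarAddCircle (circleRestrict T (szegoNeg x))) =
      InnerProductSpace.rankOne ℂ (xiVec T x) (etaVec T x) := by
  classical
  obtain ⟨Fx, hFx, hF⟩ : ∃ Fx : C(AddCircle T, ℂ), (⇑Fx = circleRestrict T (szegoNeg x)) ∧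
      HasSum (fun k : ℕ => x ^ k • fourier (T := T) (-(k + 1 : ℤ))) Fx :=
    ⟨_, rfl, hasSum_geometric_fourier_negSucc (T := T) x hx⟩
  have hu : toLpOrZero ∞ haarAddCircle (circleRestrict T (szegoNeg x)) =
      ContinuousMap.toLp ∞ haarAddCircle ℂ Fx := by
    rw [← hFx]; exact toLpOrZero_eq_toLp_continuousMap ∞ Fx
  rw [hu]
  have hdense : Dense (Submodule.span ℂ (Set.range (fourierLp (T := T) 2)) :
      Set (Lp ℂ 2 (haarAddCircle (T := T)))) :=
    Submodule.dense_iff_topologicalClosure_eq_top.2 (span_fourierLp_closure_eq_top (by norm_num))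
  refine ContinuousLinearMap.ext_on hdense ?_
  rintro _ ⟨m, rfl⟩
  have hR : ∀ m : ℤ, InnerProductSpace.rankOne ℂ (xiVec T x) (etaVec T x) (fourierLp (T := T) 2 m) =
      conj ⟪fourierLp (T := T) 2 m, etaVec T x⟫_ℂ • xiVec T x := fun m => by
    rw [InnerProductSpace.rankOne_apply, inner_conj_symm]
  rcases m with k | k
  · -- nonnegative mode `e_k`
    rw [Int.ofNat_eq_natCast, hR, inner_fourierLp_natCast_etaVec x hx k, map_pow, conj_conj]
    simp only [hardyOffDiag, offDiag, mul_apply_eq_comp]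
    rw [hardyProjection_fourierLp_natCast k]
    have hMe : mulOp haarAddCircle (ContinuousMap.toLp ∞ haarAddCircle ℂ Fx) (fourierLp (T := T) 2 (k : ℤ)) =
        ContinuousMap.toLp 2 haarAddCircle ℂ (Fx * fourier (T := T) k) :=
      mulOp_toLp_toLp Fx (fourier k)
    rw [hMe]
    have hC : HasSum (fun j : ℕ => x ^ j • fourier (T := T) (-(j + 1 : ℤ) + k))
        (Fx * fourier (T := T) k) := by
      have h1 := hF.mul_right (fourier (T := T) k)
      have h2 : (fun j : ℕ => (x ^ j • fourier (T := T) (-(j + 1 : ℤ))) * fourier (T := T) k) =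
          fun j : ℕ => x ^ j • fourier (T := T) (-(j + 1 : ℤ) + k) := by
        funext j; rw [smul_mul_assoc, fourier_mul_fourier]
      rw [h2] at h1; exact h1
    have hL := (ContinuousMap.toLp (E := ℂ) 2 haarAddCircle ℂ).hasSum hC
    have hQ := (1 - hardyProjection T).hasSum hL
    simp only [map_smul] at hQ
    have hξ := (hasSum_xiVec (T := T) x hx).const_smul (x ^ k)
    set g : ℕ → Lp ℂ 2 (haarAddCircle (T := T)) := fun j => x ^ j •
      (1 - hardyProjection T) (ContinuousMap.toLp (E := ℂ) 2 haarAddCircle ℂ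
        (fourier (T := T) (-(j + 1 : ℤ) + k))) with hg
    have hshift : (fun n : ℕ => g (n + k)) =
        fun n : ℕ => x ^ k • (x ^ n • fourierLp (T := T) 2 (-(n + 1 : ℤ))) := by
      funext n
      simp only [hg]
      have hidx : (-((n + k : ℕ) + 1 : ℤ) + k) = -(n + 1 : ℤ) := by push_cast; ring
      rw [hidx, show ContinuousMap.toLp (E := ℂ) 2 haarAddCircle ℂ (fourier (T := T) (-(n + 1 : ℤ))) =
        fourierLp (T := T) 2 (-(n + 1 : ℤ)) from rfl, sub_apply, one_apply_eq_self,
        hardyProjection_fourierLp_negSucc, sub_zero, pow_add, mul_comm, mul_smul]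
    rw [← hshift] at hξ
    have h3 := (hasSum_nat_add_iff k).1 hξ
    have hfin : ∑ i ∈ Finset.range k, g i = 0 := by
      refine Finset.sum_eq_zero fun i hi => ?_
      rw [Finset.mem_range] at hi
      obtain ⟨d, hd⟩ : ∃ d : ℕ, (-(i + 1 : ℤ) + k) = (d : ℤ) := ⟨k - 1 - i, by omega⟩
      simp only [hg]
      rw [hd, show ContinuousMap.toLp (E := ℂ) 2 haarAddCircle ℂ (fourier (T := T) (d : ℤ)) =
        fourierLp (T := T) 2 (d : ℤ) from rfl, sub_apply, one_apply_eq_self,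
        hardyProjection_fourierLp_natCast, sub_self, smul_zero]
    rw [hfin, add_zero] at h3
    exact hQ.unique h3
  · -- negative mode `e_{−k−1}`
    rw [Int.negSucc_eq, hR, inner_fourierLp_negSucc_etaVec x hx k, map_zero, zero_smul]
    simp only [hardyOffDiag, offDiag, mul_apply_eq_comp]
    rw [hardyProjection_fourierLp_negSucc k, map_zero, map_zero]

/-- RH-FREE. **Lemma 2.2 PROVED** (`lemma_2_2_holds : lemma_2_2`): the rank-one identity
`hardyOffDiag_szegoNeg` and the norms `norm_xiVec_sq`, `norm_etaVec_sq`, `norm_xiVec_mul_norm_etaVec`.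
[cite: ConnesConsani2021QuasiInner, Lemma 2.2 «uinftyqi1» (arXiv chunk p0006:L11–L47)] -/
theorem lemma_2_2_holds : lemma_2_2 := by
  intro T hT x hx
  exact ⟨hardyOffDiag_szegoNeg x hx, norm_xiVec_sq x hx, norm_etaVec_sq x hx,
    norm_xiVec_mul_norm_etaVec x hx⟩

end LemmaTwoTwo

section LemmaThreeFour

/-! ### Discharge of Lemma 3.4 (and the «bounded inverse» clause of Lemma 3.3)

RH-FREE throughout.  Appended 2026-08-26 (t17): the module docstring's bookkeeping «Lemma 3.4 — named
fact» is superseded — `lemma_3_4_holds : lemma_3_4` below.  Route (the printed proof, p0008:L105–L127,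
made quantitative and basis-free): the Gram entries have the integral representation
`(2iπm − 2iπn + log p)⁻¹ = (p/(p−1)) ∫₀¹ p^{−t} e^{2iπ(n−m)t} dt`, so for a finitely supported `x = Σ c_n δ_n`
one gets `‖Bx‖² = (p/(p−1)) ∫₀¹ p^{−t} |Σ c_n e^{2iπnt}|² dt ≥ (p−1)⁻¹ Σ|c_n|²` (finite Parseval on
`[0,1]`); by density `B` is bounded below, and being positive (self-adjoint) it is invertible.  The
operator `V x := Σ x_n ζ_n` converges in `ℓ²(ℕ)` and satisfies `‖Vx‖ = ‖Bx‖` because the two Gram matrices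
agree (Lemma 3.2, proved above); `U := V B⁻¹` is then an isometry, its range is closed (complete) and
infinite-dimensional (it contains the orthonormal family `Uδ_n`, `n ∈ ℤ`).  All helpers are private. -/

open Finset intervalIntegral

/-- RH-FREE. The exponential mode `t ↦ e^{2πint}` is continuous. [folklore] -/
private theorem l34_continuous_eMode (n : ℤ) : Continuous fun t : ℝ => cexp (2 * π * I * n * t) := by
  fun_prop

/-- RH-FREE. Complex conjugate of a mode: `conj e_n = e_{−n}`. [folklore] -/
private theorem l34_conj_eMode (n : ℤ) (t : ℝ) : conj (cexp (2 * π * I * n * t)) = cexp (2 * π * I * ((-n : ℤ) : ℂ) * t) := by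
  rw [← Complex.exp_conj]
  congr 1
  simp only [map_mul, map_ofNat, Complex.conj_ofReal, Complex.conj_I, map_intCast, Int.cast_neg]
  ring

/-- RH-FREE. Product of modes: `e_m e_n = e_{m+n}`. [folklore] -/
private theorem l34_eMode_mul (m n : ℤ) (t : ℝ) : cexp (2 * π * I * m * t) * cexp (2 * π * I * n * t) = cexp (2 * π * I * ((m + n : ℤ) : ℂ) * t) := by
  rw [← Complex.exp_add]
  congr 1
  push_cast
  ring

/-- RH-FREE. `conj(e_m) e_n = e_{n−m}`. [folklore] -/
private theorem l34_conj_eMode_mul (m n : ℤ) (t : ℝ) : conj (cexp (2 * π * I * m * t)) * cexp (2 * π * I * n * t) = cexp (2 * π * I * ((n - m : ℤ) : ℂ) * t) := by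
  rw [l34_conj_eMode, l34_eMode_mul]; congr 1; ring

/-- RH-FREE. Orthogonality of the modes on `[0,1]`: `∫₀¹ e_k = [k = 0]`. [folklore] -/
private theorem l34_integral_eMode (k : ℤ) : ∫ t in (0:ℝ)..1, cexp (2 * π * I * k * t) = if k = 0 then 1 else 0 := by
  split_ifs with hk
  · subst hk
    simp
  · have hc : (2 * π * I * k : ℂ) ≠ 0 := by
      have : (k : ℂ) ≠ 0 := Int.cast_ne_zero.mpr hk
      have hπ : (π : ℂ) ≠ 0 := ofReal_ne_zero.mpr Real.pi_ne_zero
      simp [this, hπ, I_ne_zero]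
    rw [integral_exp_mul_complex hc]
    have h1 : cexp (2 * π * I * k) = 1 := by
      rw [show (2 * π * I * k : ℂ) = k * (2 * π * I) by ring]
      exact Complex.exp_int_mul_two_pi_mul_I k
    simp [h1]

/-- RH-FREE. The integral representation of the Gram entries of Lemma 3.3: `∫₀¹ e^{−t log p}
e_{n−m}(t) dt = ((p−1)/p)/(2iπm − 2iπn + log p)` (the corrected form of the display «∫₀¹
s(x)e^{−2iπnx}dx», cf. the docstring of `lemma_3_3`). [cite: ConnesConsani2021QuasiInner, Lemma 3.3,
proof (arXiv chunk p0008:L105–L110)] -/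
private theorem l34_integral_weight_eMode {p : ℕ} (hp : 1 < p) (m n : ℤ) :
    ∫ t in (0:ℝ)..1, (Real.exp (-(Real.log p * t)) : ℂ) * cexp (2 * π * I * ((n - m : ℤ) : ℂ) * t) =
      (((p : ℂ) - 1) / p) / (2 * I * π * m - 2 * I * π * n + Real.log p) := by
  have hp0 : (0:ℝ) < p := by positivity
  have hpC : (p : ℂ) ≠ 0 := Nat.cast_ne_zero.mpr (by omega)
  have hL0 : 0 < Real.log p := Real.log_pos (by exact_mod_cast hp)
  generalize hL : Real.log p = L at hL0 ⊢
  set c : ℂ := -(L : ℂ) + 2 * π * I * ((n : ℂ) - m) with hc_def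
  have hc : c ≠ 0 := by
    intro h
    have := congrArg Complex.re h
    simp [hc_def] at this
    linarith
  have hint : ∀ t : ℝ, (Real.exp (-(L * t)) : ℂ) * cexp (2 * π * I * ((n - m : ℤ) : ℂ) * t) = cexp (c * t) := by
    intro t
    rw [Complex.ofReal_exp, ← Complex.exp_add]
    congr 1
    push_cast
    ring
  simp_rw [hint]
  rw [integral_exp_mul_complex hc]
  have hexp : cexp (c * (1 : ℝ)) = (p : ℂ)⁻¹ := by
    rw [ofReal_one, mul_one, hc_def, Complex.exp_add,
      show (2 * π * I * ((n : ℂ) - m)) = ((n - m : ℤ) : ℂ) * (2 * π * I) by push_cast; ring,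
      Complex.exp_int_mul_two_pi_mul_I, mul_one, ← Complex.ofReal_neg, ← Complex.ofReal_exp,
      Real.exp_neg, ← hL, Real.exp_log hp0]
    push_cast
    rfl
  rw [hexp, show (2 * I * π * m - 2 * I * π * n + L : ℂ) = -c by rw [hc_def]; ring]
  simp only [ofReal_zero, mul_zero, Complex.exp_zero]
  field_simp
  ring

/-- RH-FREE. A trigonometric polynomial `Σ c_n e_n` is continuous. [folklore] -/
private theorem l34_continuous_trigPoly (s : Finset ℤ) (c : ℤ → ℂ) : Continuous fun t : ℝ => ∑ n ∈ s, c n * cexp (2 * π * I * n * t) :=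
  continuous_finsetSum _ fun n _ => continuous_const.mul (l34_continuous_eMode n)

/-- RH-FREE. Expansion `w·|Σ c_n e_n|² = Σ_m Σ_n conj(c_m) c_n · w e_{n−m}`. [folklore] -/
private theorem l34_weight_mul_conj_trigPoly_mul (s : Finset ℤ) (c : ℤ → ℂ) (t : ℝ) (w : ℂ) :
    w * (conj ((∑ n ∈ s, c n * cexp (2 * π * I * n * t))) * (∑ n ∈ s, c n * cexp (2 * π * I * n * t))) =
      ∑ m ∈ s, ∑ n ∈ s, conj (c m) * c n * (w * cexp (2 * π * I * ((n - m : ℤ) : ℂ) * t)) := by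
  rw [map_sum, Finset.sum_mul_sum, Finset.mul_sum]
  refine Finset.sum_congr rfl fun m _ => ?_
  rw [Finset.mul_sum]
  refine Finset.sum_congr rfl fun n _ => ?_
  rw [map_mul, ← l34_conj_eMode_mul]
  ring

/-- RH-FREE. Termwise integration of `w·|Σ c_n e_n|²` over `[0,1]`. [folklore] -/
private theorem l34_integral_weight_trigPoly (s : Finset ℤ) (c : ℤ → ℂ) {w : ℝ → ℂ} (hw : Continuous w) :
    ∫ t in (0:ℝ)..1, w t * (conj ((∑ n ∈ s, c n * cexp (2 * π * I * n * t))) * (∑ n ∈ s, c n * cexp (2 * π * I * n * t))) =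
      ∑ m ∈ s, ∑ n ∈ s, conj (c m) * c n * ∫ t in (0:ℝ)..1, w t * cexp (2 * π * I * ((n - m : ℤ) : ℂ) * t) := by
  simp_rw [l34_weight_mul_conj_trigPoly_mul]
  rw [intervalIntegral.integral_finsetSum]
  · refine Finset.sum_congr rfl fun m _ => ?_
    rw [intervalIntegral.integral_finsetSum]
    · refine Finset.sum_congr rfl fun n _ => ?_
      exact intervalIntegral.integral_const_mul _ _
    · intro n _
      exact (continuous_const.mul (hw.mul (l34_continuous_eMode _))).intervalIntegrable _ _
  · intro m _
    exact (continuous_finsetSum _ fun n _ =>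
      continuous_const.mul (hw.mul (l34_continuous_eMode _))).intervalIntegrable _ _

/-- RH-FREE. `conj(g) g = |g|²` for a trigonometric polynomial `g`. [folklore] -/
private theorem l34_conj_trigPoly_mul_self (s : Finset ℤ) (c : ℤ → ℂ) (t : ℝ) :
    conj ((∑ n ∈ s, c n * cexp (2 * π * I * n * t))) * (∑ n ∈ s, c n * cexp (2 * π * I * n * t)) = ((‖(∑ n ∈ s, c n * cexp (2 * π * I * n * t))‖ ^ 2 : ℝ) : ℂ) := by
  rw [Complex.conj_mul']; push_cast; rfl

/-- RH-FREE. Finite Parseval on `[0,1]`: `∫₀¹ |Σ c_n e_n|² = Σ |c_n|²`. [folklore] -/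
private theorem l34_integral_norm_sq_trigPoly (s : Finset ℤ) (c : ℤ → ℂ) :
    ∫ t in (0:ℝ)..1, ‖(∑ n ∈ s, c n * cexp (2 * π * I * n * t))‖ ^ 2 = ∑ n ∈ s, ‖c n‖ ^ 2 := by
  have h := l34_integral_weight_trigPoly s c (w := fun _ => (1 : ℂ)) continuous_const
  simp only [one_mul] at h
  simp_rw [l34_conj_trigPoly_mul_self, intervalIntegral.integral_ofReal, l34_integral_eMode] at h
  have h2 : (∑ m ∈ s, ∑ n ∈ s, conj (c m) * c n * (if n - m = 0 then (1 : ℂ) else 0)) =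
      ∑ n ∈ s, ((‖c n‖ ^ 2 : ℝ) : ℂ) := by
    refine Finset.sum_congr rfl fun m hm => ?_
    rw [Finset.sum_eq_single m]
    · simp [Complex.conj_mul']
    · intro n _ hnm
      simp [sub_eq_zero, hnm]
    · intro h; exact absurd hm h
  rw [h2, ← Complex.ofReal_sum] at h
  exact_mod_cast h

/-- RH-FREE. The Gram denominators `2iπm − 2iπn + L` (`L ≠ 0` real) do not vanish. [folklore] -/
private theorem l34_gramDen_ne_zero {L : ℝ} (hL : L ≠ 0) (m n : ℤ) :
    (2 * I * π * m - 2 * I * π * n + L : ℂ) ≠ 0 := by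
  intro h0
  have := congrArg Complex.re h0
  simp at this
  exact hL this

/-- RH-FREE. The Gram quadratic form of Lemma 3.3 as a weighted integral: `Σ_m Σ_n conj(c_m)c_n
(2iπm − 2iπn + log p)⁻¹ = (p/(p−1)) ∫₀¹ e^{−t log p}|Σ c_n e_n(t)|² dt` (the multiplication-operator
model of `B²` in the printed proof, restricted to trigonometric polynomials). [cite:
ConnesConsani2021QuasiInner, Lemma 3.3, proof (arXiv chunk p0008:L105–L117)] -/
private theorem l34_gram_sum_eq_integral {p : ℕ} (hp : 1 < p) (s : Finset ℤ) (c : ℤ → ℂ) :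
    ∑ m ∈ s, ∑ n ∈ s, conj (c m) * c n * (1 / (2 * I * π * m - 2 * I * π * n + Real.log p)) =
      (((p : ℝ) / ((p : ℝ) - 1) *
        ∫ t in (0:ℝ)..1, Real.exp (-(Real.log p * t)) * ‖(∑ n ∈ s, c n * cexp (2 * π * I * n * t))‖ ^ 2 : ℝ) : ℂ) := by
  have hp1 : (1 : ℝ) < p := by exact_mod_cast hp
  have hpm1 : ((p : ℂ) - 1) ≠ 0 := by
    rw [sub_ne_zero]; exact_mod_cast (show p ≠ 1 by omega)
  have hpC : (p : ℂ) ≠ 0 := Nat.cast_ne_zero.mpr (by omega)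
  have hw : Continuous fun t : ℝ => ((Real.exp (-(Real.log p * t)) : ℝ) : ℂ) := by fun_prop
  have h := l34_integral_weight_trigPoly s c hw
  simp_rw [l34_integral_weight_eMode hp] at h
  have hint : (∫ t in (0:ℝ)..1, ((Real.exp (-(Real.log p * t)) : ℝ) : ℂ) *
      (conj ((∑ n ∈ s, c n * cexp (2 * π * I * n * t))) * (∑ n ∈ s, c n * cexp (2 * π * I * n * t)))) =
      ((∫ t in (0:ℝ)..1, Real.exp (-(Real.log p * t)) * ‖(∑ n ∈ s, c n * cexp (2 * π * I * n * t))‖ ^ 2 : ℝ) : ℂ) := by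
    simp_rw [l34_conj_trigPoly_mul_self, ← Complex.ofReal_mul, intervalIntegral.integral_ofReal]
  rw [hint] at h
  -- h : ↑(∫ …) = ∑∑ conj(c m) c n * ((p-1)/p / D)
  have key : ∀ m n : ℤ, conj (c m) * c n * (1 / (2 * I * π * m - 2 * I * π * n + Real.log p)) =
      ((p : ℂ) / ((p : ℂ) - 1)) *
        (conj (c m) * c n * ((((p : ℂ) - 1) / p) / (2 * I * π * m - 2 * I * π * n + Real.log p))) := by
    intro m n
    have hD : (2 * I * π * m - 2 * I * π * n + Real.log p : ℂ) ≠ 0 :=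
      l34_gramDen_ne_zero (Real.log_pos hp1).ne' m n
    field_simp
  simp_rw [key, ← Finset.mul_sum, ← h]
  push_cast
  ring

/-- RH-FREE. Lower bound of the Gram quadratic form: `≥ (p−1)⁻¹ Σ|c_n|²` (the weight `e^{−t log p} ≥
p⁻¹` on `[0,1]` and finite Parseval). [cite: ConnesConsani2021QuasiInner, Lemma 3.3, proof (arXiv
chunk p0008:L105–L117)] -/
private theorem l34_gram_sum_lower_bound {p : ℕ} (hp : 1 < p) (s : Finset ℤ) (c : ℤ → ℂ) :
    (1 / ((p : ℝ) - 1)) * ∑ n ∈ s, ‖c n‖ ^ 2 ≤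
      (∑ m ∈ s, ∑ n ∈ s, conj (c m) * c n * (1 / (2 * I * π * m - 2 * I * π * n + Real.log p))).re := by
  have hp1 : (1 : ℝ) < p := by exact_mod_cast hp
  have hp0 : (0 : ℝ) < p := by positivity
  rw [l34_gram_sum_eq_integral hp, Complex.ofReal_re, ← l34_integral_norm_sq_trigPoly]
  have hmono : (∫ t in (0:ℝ)..1, (p : ℝ)⁻¹ * ‖(∑ n ∈ s, c n * cexp (2 * π * I * n * t))‖ ^ 2) ≤
      ∫ t in (0:ℝ)..1, Real.exp (-(Real.log p * t)) * ‖(∑ n ∈ s, c n * cexp (2 * π * I * n * t))‖ ^ 2 := by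
    refine intervalIntegral.integral_mono_on zero_le_one ?_ ?_ fun t ht => ?_
    · exact (continuous_const.mul ((l34_continuous_trigPoly s c).norm.pow 2)).intervalIntegrable _ _
    · exact ((by fun_prop : Continuous fun t : ℝ => Real.exp (-(Real.log p * t))).mul
        ((l34_continuous_trigPoly s c).norm.pow 2)).intervalIntegrable _ _
    · refine mul_le_mul_of_nonneg_right ?_ (by positivity)
      rw [← Real.exp_log hp0, ← Real.exp_neg, Real.exp_log hp0]
      refine Real.exp_le_exp.mpr ?_
      have : Real.log p * t ≤ Real.log p * 1 :=
        mul_le_mul_of_nonneg_left ht.2 (Real.log_pos hp1).le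
      linarith
  rw [intervalIntegral.integral_const_mul] at hmono
  have hp1' : 0 < (p : ℝ) - 1 := by linarith
  calc 1 / ((p : ℝ) - 1) * ∫ t in (0:ℝ)..1, ‖(∑ n ∈ s, c n * cexp (2 * π * I * n * t))‖ ^ 2
      = (p : ℝ) / ((p : ℝ) - 1) * ((p : ℝ)⁻¹ * ∫ t in (0:ℝ)..1, ‖(∑ n ∈ s, c n * cexp (2 * π * I * n * t))‖ ^ 2) := by
        field_simp
    _ ≤ (p : ℝ) / ((p : ℝ) - 1) *
        ∫ t in (0:ℝ)..1, Real.exp (-(Real.log p * t)) * ‖(∑ n ∈ s, c n * cexp (2 * π * I * n * t))‖ ^ 2 :=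
        mul_le_mul_of_nonneg_left hmono (by positivity)

/-! #### Hilbert-space generalities (Lemma 3.4 discharge) -/

section Gram

variable {E F : Type*} [NormedAddCommGroup E] [InnerProductSpace ℂ E]
  [NormedAddCommGroup F] [InnerProductSpace ℂ F]

/-- RH-FREE. Sesquilinear expansion of `⟪Σ c_m v_m, Σ c_n v_n⟫`. [folklore] -/
private theorem l34_inner_sum_smul_sum_smul {ι : Type*} (s : Finset ι) (c : ι → ℂ) (v : ι → E) :
    ⟪∑ m ∈ s, c m • v m, ∑ n ∈ s, c n • v n⟫_ℂ =
      ∑ m ∈ s, ∑ n ∈ s, conj (c m) * c n * ⟪v m, v n⟫_ℂ := by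
  rw [sum_inner]
  refine Finset.sum_congr rfl fun m _ => ?_
  rw [inner_sum]
  refine Finset.sum_congr rfl fun n _ => ?_
  rw [inner_smul_left, inner_smul_right]
  ring

/-- RH-FREE. Two families with the same Gram matrix give linear combinations of the same norm.
[folklore] -/
private theorem l34_norm_sum_smul_eq_of_gram_eq {ι : Type*} (s : Finset ι) (c : ι → ℂ) (v : ι → E)
    (w : ι → F) (h : ∀ m n, ⟪v m, v n⟫_ℂ = ⟪w m, w n⟫_ℂ) :
    ‖∑ n ∈ s, c n • v n‖ = ‖∑ n ∈ s, c n • w n‖ := by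
  have h1 : ‖∑ n ∈ s, c n • v n‖ ^ 2 = ‖∑ n ∈ s, c n • w n‖ ^ 2 := by
    rw [@norm_sq_eq_re_inner ℂ, @norm_sq_eq_re_inner ℂ, l34_inner_sum_smul_sum_smul,
      l34_inner_sum_smul_sum_smul]
    simp_rw [h]
  exact (sq_eq_sq₀ (norm_nonneg _) (norm_nonneg _)).mp h1

end Gram

/-- RH-FREE. The unit vectors `δ_n ∈ ℓ²(ℤ)` are orthonormal (inner products). [folklore] -/
private theorem l34_inner_single_single (m n : ℤ) :
    ⟪(lp.single 2 m (1 : ℂ) : (lp (fun _ : ℤ => ℂ) 2)), lp.single 2 n (1 : ℂ)⟫_ℂ = if m = n then 1 else 0 := by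
  rw [lp.inner_single_left, lp.single_apply]
  by_cases h : m = n
  · subst h; simp
  · simp [h]

/-- RH-FREE. The unit vectors `δ_n ∈ ℓ²(ℤ)` form an orthonormal family. [folklore] -/
private theorem l34_orthonormal_single : Orthonormal ℂ (fun n : ℤ => (lp.single 2 n (1 : ℂ) : (lp (fun _ : ℤ => ℂ) 2))) := by
  rw [orthonormal_iff_ite]
  intro m n
  exact l34_inner_single_single m n

/-- RH-FREE. `‖Σ_{n∈s} c_n δ_n‖² = Σ_{n∈s} |c_n|²`. [folklore] -/
private theorem l34_norm_sq_sum_single_smul (s : Finset ℤ) (c : ℤ → ℂ) :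
    ‖∑ n ∈ s, c n • (lp.single 2 n (1 : ℂ) : (lp (fun _ : ℤ => ℂ) 2))‖ ^ 2 = ∑ n ∈ s, ‖c n‖ ^ 2 := by
  rw [@norm_sq_eq_re_inner ℂ, l34_orthonormal_single.inner_sum]
  simp only [RCLike.re_to_complex, Complex.re_sum]
  refine Finset.sum_congr rfl fun n _ => ?_
  rw [Complex.conj_mul']
  norm_cast

variable {p : ℕ}

/-- RH-FREE. For an operator with the Gram data of Lemma 3.3: `‖B(Σ c_n δ_n)‖² ≥ (p−1)⁻¹ Σ|c_n|²`.
[cite: ConnesConsani2021QuasiInner, Lemma 3.3, proof (arXiv chunk p0008:L105–L117)] -/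
private theorem l34_norm_sq_apply_sum_ge (hp : 1 < p) {B : (lp (fun _ : ℤ => ℂ) 2) →L[ℂ] (lp (fun _ : ℤ => ℂ) 2)}
    (hB : ∀ m n : ℤ, ⟪B (lp.single 2 m (1 : ℂ)), B (lp.single 2 n (1 : ℂ))⟫_ℂ = 1 / (2 * I * π * m - 2 * I * π * n + Real.log p))
    (s : Finset ℤ) (c : ℤ → ℂ) :
    (1 / ((p : ℝ) - 1)) * ‖∑ n ∈ s, c n • (lp.single 2 n (1 : ℂ) : (lp (fun _ : ℤ => ℂ) 2))‖ ^ 2 ≤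
      ‖B (∑ n ∈ s, c n • (lp.single 2 n (1 : ℂ) : (lp (fun _ : ℤ => ℂ) 2)))‖ ^ 2 := by
  rw [l34_norm_sq_sum_single_smul, map_sum]
  simp_rw [map_smul]
  rw [@norm_sq_eq_re_inner ℂ, l34_inner_sum_smul_sum_smul]
  simp_rw [hB]
  exact l34_gram_sum_lower_bound hp s c

/-- RH-FREE. Every `x ∈ ℓ²(ℤ)` is the (unconditional) sum `Σ x_n δ_n`. [folklore] -/
private theorem l34_hasSum_single_smul (x : (lp (fun _ : ℤ => ℂ) 2)) :
    HasSum (fun n : ℤ => (x n) • (lp.single 2 n (1 : ℂ) : (lp (fun _ : ℤ => ℂ) 2))) x := by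
  have h : HasSum (fun n : ℤ => (lp.single 2 n (x n) : (lp (fun _ : ℤ => ℂ) 2))) x :=
    lp.hasSum_single ENNReal.ofNat_ne_top x
  have he : (fun n : ℤ => (x n) • (lp.single 2 n (1 : ℂ) : (lp (fun _ : ℤ => ℂ) 2))) =
      fun n => (lp.single 2 n (x n) : (lp (fun _ : ℤ => ℂ) 2)) := by
    funext n
    rw [← lp.single_smul, smul_eq_mul, mul_one]
  rw [he]
  exact h

/-- RH-FREE. For an operator with the Gram data of Lemma 3.3: `‖Bx‖² ≥ (p−1)⁻¹‖x‖²` for all `x`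
(density). [cite: ConnesConsani2021QuasiInner, Lemma 3.3 (arXiv chunk p0008:L97–L117)] -/
private theorem l34_norm_sq_apply_ge (hp : 1 < p) {B : (lp (fun _ : ℤ => ℂ) 2) →L[ℂ] (lp (fun _ : ℤ => ℂ) 2)}
    (hB : ∀ m n : ℤ, ⟪B (lp.single 2 m (1 : ℂ)), B (lp.single 2 n (1 : ℂ))⟫_ℂ = 1 / (2 * I * π * m - 2 * I * π * n + Real.log p))
    (x : (lp (fun _ : ℤ => ℂ) 2)) : (1 / ((p : ℝ) - 1)) * ‖x‖ ^ 2 ≤ ‖B x‖ ^ 2 := by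
  have hx := l34_hasSum_single_smul x
  have h1 : Filter.Tendsto
      (fun s : Finset ℤ => (1 / ((p : ℝ) - 1)) * ‖∑ n ∈ s, (x n) • (lp.single 2 n (1 : ℂ) : (lp (fun _ : ℤ => ℂ) 2))‖ ^ 2)
      (SummationFilter.unconditional ℤ).filter (nhds ((1 / ((p : ℝ) - 1)) * ‖x‖ ^ 2)) :=
    ((continuous_const.mul (continuous_norm.pow 2)).tendsto x).comp hx
  have h2 : Filter.Tendsto
      (fun s : Finset ℤ => ‖B (∑ n ∈ s, (x n) • (lp.single 2 n (1 : ℂ) : (lp (fun _ : ℤ => ℂ) 2)))‖ ^ 2)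
      (SummationFilter.unconditional ℤ).filter (nhds (‖B x‖ ^ 2)) :=
    ((B.continuous.norm.pow 2).tendsto x).comp hx
  exact le_of_tendsto_of_tendsto' h1 h2 fun s => l34_norm_sq_apply_sum_ge hp hB s (fun n => x n)

/-- RH-FREE. A positive operator with the Gram data of Lemma 3.3 is invertible («bounded inverse»).
[cite: ConnesConsani2021QuasiInner, Lemma 3.3 (arXiv chunk p0008:L97–L103)] -/
private theorem l34_isUnit_of_gram (hp : 1 < p) {B : (lp (fun _ : ℤ => ℂ) 2) →L[ℂ] (lp (fun _ : ℤ => ℂ) 2)} (hpos : B.IsPositive)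
    (hB : ∀ m n : ℤ, ⟪B (lp.single 2 m (1 : ℂ)), B (lp.single 2 n (1 : ℂ))⟫_ℂ = 1 / (2 * I * π * m - 2 * I * π * n + Real.log p)) :
    IsUnit B := by
  have hp1 : (1 : ℝ) < p := by exact_mod_cast hp
  have hκ : 0 < 1 / ((p : ℝ) - 1) := by
    have : 0 < (p : ℝ) - 1 := by linarith
    positivity
  set κ : ℝ := 1 / ((p : ℝ) - 1) with hκ_def
  have hbb : ∀ x, κ * ‖x‖ ^ 2 ≤ ‖B x‖ ^ 2 := l34_norm_sq_apply_ge hp hB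
  have hK : ∀ x, ‖x‖ ≤ (Real.sqrt κ)⁻¹ * ‖B x‖ := by
    intro x
    have hs : Real.sqrt κ * ‖x‖ ≤ ‖B x‖ := by
      rw [← Real.sqrt_sq (norm_nonneg (B x)), ← Real.sqrt_sq (norm_nonneg x),
        ← Real.sqrt_mul hκ.le]
      exact Real.sqrt_le_sqrt (hbb x)
    have hsq : 0 < Real.sqrt κ := Real.sqrt_pos.mpr hκ
    calc ‖x‖ = (Real.sqrt κ)⁻¹ * (Real.sqrt κ * ‖x‖) := by field_simp
      _ ≤ (Real.sqrt κ)⁻¹ * ‖B x‖ := mul_le_mul_of_nonneg_left hs (by positivity)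
  have hanti : AntilipschitzWith ⟨(Real.sqrt κ)⁻¹, by positivity⟩ B :=
    B.antilipschitz_of_bound hK
  have hinj : Function.Injective B := hanti.injective
  have hclosed : IsClosed (Set.range B) := hanti.isClosed_range B.uniformContinuous
  have hsa : IsSelfAdjoint B := hpos.isSelfAdjoint
  have hker : B.ker = ⊥ := LinearMap.ker_eq_bot.mpr hinj
  have horth : B.rangeᗮ = ⊥ := by
    rw [ContinuousLinearMap.orthogonal_range, hsa.adjoint_eq]; exact hker
  have hrange : B.range = ⊤ := by
    have h1 : B.range.topologicalClosure = ⊤ :=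
      Submodule.topologicalClosure_eq_top_iff.mpr horth
    rwa [IsClosed.submodule_topologicalClosure_eq hclosed] at h1
  have hsurj : Function.Surjective B := LinearMap.range_eq_top.mp hrange
  exact ContinuousLinearMap.isUnit_iff_bijective.mpr ⟨hinj, hsurj⟩

/-! ### The operators `V` and `U` -/

section VU

variable {B : (lp (fun _ : ℤ => ℂ) 2) →L[ℂ] (lp (fun _ : ℤ => ℂ) 2)} {ζ : ℤ → (lp (fun _ : ℕ => ℂ) 2)}

/-- RH-FREE. `Σ c_n B δ_n = B(Σ c_n δ_n)`. [folklore] -/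
private theorem l34_sum_smul_apply_single_eq (B : (lp (fun _ : ℤ => ℂ) 2) →L[ℂ] (lp (fun _ : ℤ => ℂ) 2)) (s : Finset ℤ) (c : ℤ → ℂ) :
    ∑ n ∈ s, c n • B (lp.single 2 n (1 : ℂ)) =
      B (∑ n ∈ s, c n • (lp.single 2 n (1 : ℂ) : (lp (fun _ : ℤ => ℂ) 2))) := by
  rw [map_sum]; simp_rw [map_smul]

/-- RH-FREE. If `(ζ_n)` has the Gram matrix of `(Bδ_n)`, then `Σ x_n ζ_n` converges for every `x ∈
ℓ²(ℤ)` (Cauchy criterion). [folklore] -/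
private theorem l34_summable_smul_of_gram
    (hG : ∀ m n : ℤ, ⟪ζ m, ζ n⟫_ℂ = ⟪B (lp.single 2 m (1 : ℂ)), B (lp.single 2 n (1 : ℂ))⟫_ℂ)
    (x : (lp (fun _ : ℤ => ℂ) 2)) : Summable fun n : ℤ => (x n) • ζ n := by
  rw [summable_iff_vanishing_norm]
  intro ε hε
  obtain ⟨s, hs⟩ := summable_iff_vanishing_norm.mp (l34_hasSum_single_smul x).summable
    (ε / (‖B‖ + 1)) (by positivity)
  refine ⟨s, fun t ht => ?_⟩
  rw [l34_norm_sum_smul_eq_of_gram_eq t (fun n => x n) ζ (fun n => B (lp.single 2 n (1 : ℂ))) hG,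
    l34_sum_smul_apply_single_eq]
  calc ‖B (∑ n ∈ t, x n • (lp.single 2 n (1 : ℂ) : (lp (fun _ : ℤ => ℂ) 2)))‖
      ≤ ‖B‖ * ‖∑ n ∈ t, x n • (lp.single 2 n (1 : ℂ) : (lp (fun _ : ℤ => ℂ) 2))‖ := B.le_opNorm _
    _ ≤ (‖B‖ + 1) * ‖∑ n ∈ t, x n • (lp.single 2 n (1 : ℂ) : (lp (fun _ : ℤ => ℂ) 2))‖ := by
        gcongr; linarith
    _ < (‖B‖ + 1) * (ε / (‖B‖ + 1)) := by
        gcongr; exact hs t ht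
    _ = ε := by field_simp

/-- RH-FREE. With the same Gram matrices, `‖Σ x_n ζ_n‖ = ‖Bx‖`. [folklore] -/
private theorem l34_norm_tsum_smul_eq
    (hG : ∀ m n : ℤ, ⟪ζ m, ζ n⟫_ℂ = ⟪B (lp.single 2 m (1 : ℂ)), B (lp.single 2 n (1 : ℂ))⟫_ℂ)
    (x : (lp (fun _ : ℤ => ℂ) 2)) : ‖∑' n, (x n) • ζ n‖ = ‖B x‖ := by
  have hV := (l34_summable_smul_of_gram hG x).hasSum
  have hx := l34_hasSum_single_smul x
  have h1 : Filter.Tendsto (fun s : Finset ℤ => ‖∑ n ∈ s, x n • ζ n‖)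
      (SummationFilter.unconditional ℤ).filter (nhds ‖∑' n, (x n) • ζ n‖) :=
    (continuous_norm.tendsto _).comp hV
  have h2 : Filter.Tendsto
      (fun s : Finset ℤ => ‖B (∑ n ∈ s, x n • (lp.single 2 n (1 : ℂ) : (lp (fun _ : ℤ => ℂ) 2)))‖)
      (SummationFilter.unconditional ℤ).filter (nhds ‖B x‖) :=
    (B.continuous.norm.tendsto x).comp hx
  have heq : (fun s : Finset ℤ => ‖∑ n ∈ s, x n • ζ n‖) =
      fun s => ‖B (∑ n ∈ s, x n • (lp.single 2 n (1 : ℂ) : (lp (fun _ : ℤ => ℂ) 2)))‖ := by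
    funext s
    rw [l34_norm_sum_smul_eq_of_gram_eq s (fun n => x n) ζ (fun n => B (lp.single 2 n (1 : ℂ))) hG,
      l34_sum_smul_apply_single_eq]
  rw [heq] at h1
  exact tendsto_nhds_unique h1 h2

/-- RH-FREE. The bounded operator `V`, `Vδ_n = ζ_n`, `‖Vx‖ = ‖Bx‖` (Lemma 3.4, first step:
«⟨V(δ_m)|V(δ_n)⟩ = ⟨ζ_m|ζ_n⟩ = ⟨B(δ_m)|B(δ_n)⟩»). [cite: ConnesConsani2021QuasiInner, Lemma 3.4,
proof (arXiv chunk p0008:L121–L127)] -/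
private theorem l34_exists_V
    (hG : ∀ m n : ℤ, ⟪ζ m, ζ n⟫_ℂ = ⟪B (lp.single 2 m (1 : ℂ)), B (lp.single 2 n (1 : ℂ))⟫_ℂ) :
    ∃ V : (lp (fun _ : ℤ => ℂ) 2) →L[ℂ] (lp (fun _ : ℕ => ℂ) 2), (∀ n : ℤ, V (lp.single 2 n (1 : ℂ)) = ζ n) ∧ ∀ x, ‖V x‖ = ‖B x‖ := by
  let Vl : (lp (fun _ : ℤ => ℂ) 2) →ₗ[ℂ] (lp (fun _ : ℕ => ℂ) 2) :=
    { toFun := fun x => ∑' n, (x n) • ζ n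
      map_add' := fun x y => by
        simp only [lp.coeFn_add, Pi.add_apply, add_smul]
        exact (l34_summable_smul_of_gram hG x).tsum_add (l34_summable_smul_of_gram hG y)
      map_smul' := fun a x => by
        simp only [lp.coeFn_smul, Pi.smul_apply, smul_eq_mul, mul_smul, RingHom.id_apply]
        exact (l34_summable_smul_of_gram hG x).tsum_const_smul a }
  have hVl : ∀ x, Vl x = ∑' n, (x n) • ζ n := fun x => rfl
  refine ⟨Vl.mkContinuous ‖B‖ fun x => ?_, fun n => ?_, fun x => ?_⟩
  · rw [hVl, l34_norm_tsum_smul_eq hG]; exact B.le_opNorm x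
  · rw [LinearMap.mkContinuous_apply, hVl, tsum_eq_single n]
    · rw [lp.single_apply, Pi.single_eq_same, one_smul]
    · intro m hm
      rw [lp.single_apply, Pi.single_eq_of_ne hm, zero_smul]
  · rw [LinearMap.mkContinuous_apply, hVl, l34_norm_tsum_smul_eq hG]

/-- RH-FREE. Lemma 3.4 for an abstract family `ζ` with the Gram data: `V` and the isometry `U =
VB⁻¹` with closed infinite-dimensional range. [cite: ConnesConsani2021QuasiInner, Lemma 3.4 (arXiv
chunk p0008:L119–L127)] -/
private theorem l34_exists_V_U {p : ℕ} (hp : 1 < p) (hpos : B.IsPositive)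
    (hB : ∀ m n : ℤ, ⟪B (lp.single 2 m (1 : ℂ)), B (lp.single 2 n (1 : ℂ))⟫_ℂ = 1 / (2 * I * π * m - 2 * I * π * n + Real.log p))
    (hζ : ∀ m n : ℤ, ⟪ζ m, ζ n⟫_ℂ = 1 / (2 * I * π * m - 2 * I * π * n + Real.log p)) :
    ∃ (V : (lp (fun _ : ℤ => ℂ) 2) →L[ℂ] (lp (fun _ : ℕ => ℂ) 2)) (U : (lp (fun _ : ℤ => ℂ) 2) →ₗᵢ[ℂ] (lp (fun _ : ℕ => ℂ) 2)),
      (∀ n : ℤ, V (lp.single 2 n (1 : ℂ)) = ζ n) ∧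
      U.toContinuousLinearMap ∘L B = V ∧
      IsClosed (Set.range U) ∧ ¬ FiniteDimensional ℂ (LinearMap.range U.toLinearMap) := by
  have hG : ∀ m n : ℤ, ⟪ζ m, ζ n⟫_ℂ = ⟪B (lp.single 2 m (1 : ℂ)), B (lp.single 2 n (1 : ℂ))⟫_ℂ :=
    fun m n => by rw [hζ, hB]
  obtain ⟨V, hVζ, hVn⟩ := l34_exists_V hG
  obtain ⟨u, hu⟩ := l34_isUnit_of_gram hp hpos hB
  have hinv : ∀ y, B ((↑u⁻¹ : (lp (fun _ : ℤ => ℂ) 2) →L[ℂ] (lp (fun _ : ℤ => ℂ) 2)) y) = y := fun y => by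
    have := congrArg (fun T : (lp (fun _ : ℤ => ℂ) 2) →L[ℂ] (lp (fun _ : ℤ => ℂ) 2) => T y) u.mul_inv
    simpa [hu] using this
  have hinv' : ∀ y, (↑u⁻¹ : (lp (fun _ : ℤ => ℂ) 2) →L[ℂ] (lp (fun _ : ℤ => ℂ) 2)) (B y) = y := fun y => by
    have := congrArg (fun T : (lp (fun _ : ℤ => ℂ) 2) →L[ℂ] (lp (fun _ : ℤ => ℂ) 2) => T y) u.inv_mul
    simpa [hu] using this
  let U0 : (lp (fun _ : ℤ => ℂ) 2) →L[ℂ] (lp (fun _ : ℕ => ℂ) 2) := V ∘L (↑u⁻¹ : (lp (fun _ : ℤ => ℂ) 2) →L[ℂ] (lp (fun _ : ℤ => ℂ) 2))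
  have hU0apply : ∀ y, U0 y = V ((↑u⁻¹ : (lp (fun _ : ℤ => ℂ) 2) →L[ℂ] (lp (fun _ : ℤ => ℂ) 2)) y) := fun y => rfl
  have hU0 : ∀ y, ‖U0 y‖ = ‖y‖ := fun y => by
    rw [hU0apply, hVn, hinv]
  let U : (lp (fun _ : ℤ => ℂ) 2) →ₗᵢ[ℂ] (lp (fun _ : ℕ => ℂ) 2) := ⟨U0.toLinearMap, hU0⟩
  have hUapply : ∀ y, U y = V ((↑u⁻¹ : (lp (fun _ : ℤ => ℂ) 2) →L[ℂ] (lp (fun _ : ℤ => ℂ) 2)) y) := fun y => rfl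
  refine ⟨V, U, hVζ, ?_, ?_, ?_⟩
  · ext1 y
    rw [ContinuousLinearMap.coe_comp, Function.comp_apply,
      LinearIsometry.coe_toContinuousLinearMap, hUapply, hinv']
  · exact U.isometry.isClosedEmbedding.isClosed_range
  · intro hfin
    have hon : Orthonormal ℂ (fun n : ℤ =>
        (⟨U.toLinearMap (lp.single 2 n (1 : ℂ)), LinearMap.mem_range_self _ _⟩ :
          LinearMap.range U.toLinearMap)) := by
      rw [orthonormal_iff_ite]
      intro m n
      rw [Submodule.coe_inner]
      change ⟪U (lp.single 2 m (1 : ℂ)), U (lp.single 2 n (1 : ℂ))⟫_ℂ = _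
      rw [U.inner_map_map]
      exact l34_inner_single_single m n
    haveI := hfin
    exact (not_finite_iff_infinite.mpr (inferInstance : Infinite ℤ)) hon.linearIndependent.finite

end VU


/-- RH-FREE. **Lemma 3.3, clause «bounded inverse», quantitative form PROVED for every operator with the
Gram data of Lemma 3.3**: `‖Bx‖² ≥ (p − 1)⁻¹‖x‖²` (printed proof: `B²` is unitarily the multiplication by
`p^{1−x}/(p − 1) ≥ (p − 1)⁻¹` on `L²([0,1])`; here through the integral representation of the Gram entries
and finite Parseval, see the section docstring).
[cite: ConnesConsani2021QuasiInner, Lemma 3.3 (arXiv chunk p0008:L97–L117)] -/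
theorem IsLemma33Operator.norm_sq_le {p : ℕ} (hp : p.Prime)
    {B : lp (fun _ : ℤ => ℂ) 2 →L[ℂ] lp (fun _ : ℤ => ℂ) 2} (hB : IsLemma33Operator p B)
    (x : lp (fun _ : ℤ => ℂ) 2) : (1 / ((p : ℝ) - 1)) * ‖x‖ ^ 2 ≤ ‖B x‖ ^ 2 :=
  l34_norm_sq_apply_ge hp.one_lt hB.2 x

/-- RH-FREE. **Lemma 3.3, clause «B is bounded, with bounded inverse» PROVED for every operator with the
Gram data of Lemma 3.3**: such a (positive, hence self-adjoint) `B` is bounded below, so it is invertible.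
[cite: ConnesConsani2021QuasiInner, Lemma 3.3 (arXiv chunk p0008:L97–L103)] -/
theorem IsLemma33Operator.isUnit {p : ℕ} (hp : p.Prime)
    {B : lp (fun _ : ℤ => ℂ) 2 →L[ℂ] lp (fun _ : ℤ => ℂ) 2} (hB : IsLemma33Operator p B) :
    IsUnit B :=
  l34_isUnit_of_gram hp.one_lt hB.1 hB.2

/-- RH-FREE. **Lemma 3.4 PROVED** (`lemma_3_4_holds : lemma_3_4`): `V := Σ x_n ζ_n` is bounded with
`‖Vx‖ = ‖Bx‖` (equal Gram matrices, Lemma 3.2), `B` is invertible (`IsLemma33Operator.isUnit`), and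
`U := VB⁻¹` is an isometry of `ℓ²(ℤ)` onto a closed infinite-dimensional subspace of `ℓ²(ℕ)`.
[cite: ConnesConsani2021QuasiInner, Lemma 3.4 (arXiv chunk p0008:L119; proof L121–L127)] -/
theorem lemma_3_4_holds : lemma_3_4 := by
  intro p hp B hB
  exact l34_exists_V_U hp.one_lt hB.1 hB.2 (lemma_3_2_holds p hp)

end LemmaThreeFour


section LemmaThreeThree

/-! ### Discharge of Lemma 3.3 (corrected statement, cf. the docstring of `lemma_3_3`)

RH-FREE throughout.  Appended 2026-08-26 (t17): the module docstring's bookkeeping «Lemma 3.3 — named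
fact» is superseded — `lemma_3_3_holds : lemma_3_3` below.  We FOLLOW THE PRINTED PROOF
(p0008:L105–L117): the Gram matrix `(2iπm − 2iπn + log p)⁻¹` is the matrix, in the Fourier basis
`e_n(x) = e^{2iπnx}` of `L²([0,1]) = L²(ℝ/ℤ)`, of the multiplication operator `S` by
`s(x) = p^{1−x}/(p − 1)` (normalisation corrected: `∫₀¹ p^{1−x}e^{−2iπkx}dx = (p−1)/(log p + 2iπk)`);
`B := F S^{1/2} F⁻¹` with `F : L²(ℝ/ℤ) ≃ ℓ²(ℤ)` Mathlib's `fourierBasis.repr` is positive with the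
required Gram data (existence); two positive operators with these Gram data have equal squares, hence are
equal (`CFC.sqrt`, uniqueness); the spectrum of the multiplication operator by the function `s^{1/2}`
(continuous on the fundamental domain `[0,1)`, values filling `((1/(p−1))^{1/2}, (p/(p−1))^{1/2}]`) is
its essential range, the closed interval — inverse `(c − s^{1/2})⁻¹ ∈ L^∞` off the interval, indicator
functions of small arcs as approximate eigenvectors on it — and conjugation by `F` preserves the
spectrum; `0 ∉` spectrum gives the bounded inverse.  Deviation from print: none in substance (Mathlib's
circle `AddCircle 1` replaces `[0,1]`; the spectral statement is set equality, absolute continuity of the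
spectral measure is not typed, as recorded in `lemma_3_3`). -/

/-! #### Uniqueness (equal Gram data ⇒ equal squares ⇒ equal positive square roots) -/

section Uniq

variable {E : Type*} [NormedAddCommGroup E] [InnerProductSpace ℂ E] [CompleteSpace E]

/-- RH-FREE. Two positive operators with the same square coincide (uniqueness of the positive square
root, via `CFC.sqrt`). [folklore] -/
private theorem l33_eq_of_isPositive_of_mul_self_eq {B₁ B₂ : E →L[ℂ] E} (h₁ : B₁.IsPositive) (h₂ : B₂.IsPositive)
    (h : B₁ * B₁ = B₂ * B₂) : B₁ = B₂ := by
  have h₁' : (0 : E →L[ℂ] E) ≤ B₁ := (ContinuousLinearMap.nonneg_iff_isPositive B₁).mpr h₁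
  have h₂' : (0 : E →L[ℂ] E) ≤ B₂ := (ContinuousLinearMap.nonneg_iff_isPositive B₂).mpr h₂
  have e₁ : CFC.sqrt (B₁ * B₁) = B₁ := CFC.sqrt_unique rfl h₁'
  have e₂ : CFC.sqrt (B₂ * B₂) = B₂ := CFC.sqrt_unique rfl h₂'
  rw [← e₁, ← e₂, h]

end Uniq

/-- RH-FREE. A bounded operator on `ℓ²(ℤ)` is determined by its matrix coefficients `⟪δ_m, Tδ_n⟫`.
[folklore] -/
private theorem l33_clm_eq_of_inner_single_eq {T₁ T₂ : lp (fun _ : ℤ => ℂ) 2 →L[ℂ] lp (fun _ : ℤ => ℂ) 2}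
    (h : ∀ m n : ℤ, ⟪(lp.single 2 m (1 : ℂ) : lp (fun _ : ℤ => ℂ) 2), T₁ (lp.single 2 n (1 : ℂ))⟫_ℂ =
      ⟪(lp.single 2 m (1 : ℂ) : lp (fun _ : ℤ => ℂ) 2), T₂ (lp.single 2 n (1 : ℂ))⟫_ℂ) :
    T₁ = T₂ := by
  have hsingle : ∀ n : ℤ, T₁ (lp.single 2 n (1 : ℂ)) = T₂ (lp.single 2 n (1 : ℂ)) := by
    intro n
    refine lp.ext (funext fun m => ?_)
    have := h m n
    simpa [lp.inner_single_left] using this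
  ext1 x
  have hx : HasSum (fun n : ℤ => (lp.single 2 n (x n) : lp (fun _ : ℤ => ℂ) 2)) x :=
    lp.hasSum_single ENNReal.ofNat_ne_top x
  have h1 := hx.mapL T₁
  have h2 := hx.mapL T₂
  have heq : (fun n : ℤ => T₁ (lp.single 2 n (x n) : lp (fun _ : ℤ => ℂ) 2)) =
      fun n : ℤ => T₂ (lp.single 2 n (x n) : lp (fun _ : ℤ => ℂ) 2) := by
    funext n
    rw [← mul_one (x n), ← smul_eq_mul, lp.single_smul, map_smul, map_smul, hsingle]
  rw [heq] at h1
  exact h1.unique h2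

/-- RH-FREE. **Lemma 3.3, uniqueness clause PROVED**: «there exists a unique positive operator `B` …
such that `⟨B(δ_m)|B(δ_n)⟩ = …`» — two positive operators with the Gram data of Lemma 3.3 have the
same square (same matrix coefficients), hence coincide. [cite: ConnesConsani2021QuasiInner, Lemma
3.3 (arXiv chunk p0008:L97–L103)] -/
theorem IsLemma33Operator.unique {p : ℕ} {B₁ B₂ : lp (fun _ : ℤ => ℂ) 2 →L[ℂ] lp (fun _ : ℤ => ℂ) 2}
    (h₁ : IsLemma33Operator p B₁) (h₂ : IsLemma33Operator p B₂) : B₁ = B₂ := by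
  refine l33_eq_of_isPositive_of_mul_self_eq h₁.1 h₂.1 (l33_clm_eq_of_inner_single_eq fun m n => ?_)
  rw [mul_apply_eq_comp, mul_apply_eq_comp,
    ← h₁.1.inner_left_eq_inner_right, ← h₂.1.inner_left_eq_inner_right, h₁.2, h₂.2]

/-! #### Spectrum and conjugation -/

section Conj

variable {E F : Type*} [NormedAddCommGroup E] [NormedSpace ℂ E] [NormedAddCommGroup F] [NormedSpace ℂ F]

/-- RH-FREE. The spectrum is invariant under conjugation by a continuous linear equivalence (an
algebra isomorphism `T ↦ eTe⁻¹`). [folklore] -/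
private theorem l33_spectrum_conj_eq (e : E ≃L[ℂ] F) (T : E →L[ℂ] E) :
    spectrum ℂ ((e : E →L[ℂ] F) ∘L T ∘L (e.symm : F →L[ℂ] E)) = spectrum ℂ T := by
  let Φ : (E →L[ℂ] E) ≃ₐ[ℂ] (F →L[ℂ] F) :=
    AlgEquiv.ofAlgHom
      { toFun := fun S => (e : E →L[ℂ] F) ∘L S ∘L (e.symm : F →L[ℂ] E)
        map_one' := by ext x; simp
        map_mul' := fun S S' => by ext x; simp
        map_zero' := by ext x; simp
        map_add' := fun S S' => by ext x; simp
        commutes' := fun c => by ext x; simp [Algebra.algebraMap_eq_smul_one] }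
      { toFun := fun S => (e.symm : F →L[ℂ] E) ∘L S ∘L (e : E →L[ℂ] F)
        map_one' := by ext x; simp
        map_mul' := fun S S' => by ext x; simp
        map_zero' := by ext x; simp
        map_add' := fun S S' => by ext x; simp
        commutes' := fun c => by ext x; simp [Algebra.algebraMap_eq_smul_one] }
      (by ext S x; simp) (by ext S x; simp)
  exact AlgEquiv.spectrum_eq Φ T

end Conj

/-! #### The model: `B = F S^{1/2} F⁻¹` (existence) -/

section Model

variable {p : ℕ}

/-- RH-FREE. **The weight of Lemma 3.3** on `[0,1)`: `g_p(x) = (p^{1−x}/(p − 1))^{1/2} = ((p/(p−1))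
e^{−x log p})^{1/2}` — the printed «`s(x)^{1/2} := p^{(1−x)/2}`» with the normalisation corrected as
recorded in the docstring of `lemma_3_3` (RH-FREE). [cite: ConnesConsani2021QuasiInner, Lemma 3.3,
proof (arXiv chunk p0008:L105–L117)] -/
def lemma33Weight (p : ℕ) (x : ℝ) : ℝ := Real.sqrt ((p : ℝ) / ((p : ℝ) - 1) * Real.exp (-(Real.log p * x)))

/-- RH-FREE. The weight `g_p` is continuous on `ℝ`. [folklore] -/
private theorem l33_continuous_wfun (p : ℕ) : Continuous (lemma33Weight p) := by
  unfold lemma33Weight; fun_prop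

/-- RH-FREE. The weight `g_p` is non-negative. [folklore] -/
private theorem l33_wfun_nonneg (p : ℕ) (x : ℝ) : 0 ≤ lemma33Weight p x := Real.sqrt_nonneg _

/-- RH-FREE. `g_p(x)² = (p/(p−1)) e^{−x log p}`. [cite: ConnesConsani2021QuasiInner, Lemma 3.3,
proof (arXiv chunk p0008:L105–L117)] -/
private theorem l33_wfun_sq (hp : 1 < p) (x : ℝ) :
    lemma33Weight p x ^ 2 = (p : ℝ) / ((p : ℝ) - 1) * Real.exp (-(Real.log p * x)) := by
  have hp1 : (1 : ℝ) < p := by exact_mod_cast hp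
  have : 0 < (p : ℝ) - 1 := by linarith
  unfold lemma33Weight
  rw [Real.sq_sqrt (by positivity)]

/-- RH-FREE. `g_p(x) ≤ (p/(p−1))^{1/2}` for `x ≥ 0`. [cite: ConnesConsani2021QuasiInner, Lemma 3.3,
proof (arXiv chunk p0008:L105–L117)] -/
private theorem l33_wfun_le (hp : 1 < p) {x : ℝ} (hx : 0 ≤ x) :
    lemma33Weight p x ≤ Real.sqrt ((p : ℝ) / ((p : ℝ) - 1)) := by
  have hp1 : (1 : ℝ) < p := by exact_mod_cast hp
  have hp' : 0 < (p : ℝ) - 1 := by linarith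
  unfold lemma33Weight
  apply Real.sqrt_le_sqrt
  have h1 : Real.exp (-(Real.log p * x)) ≤ 1 := by
    rw [Real.exp_le_one_iff]
    have := mul_nonneg (Real.log_pos hp1).le hx
    linarith
  calc (p : ℝ) / ((p : ℝ) - 1) * Real.exp (-(Real.log p * x))
      ≤ (p : ℝ) / ((p : ℝ) - 1) * 1 := mul_le_mul_of_nonneg_left h1 (by positivity)
    _ = _ := mul_one _

/-- RH-FREE. `g_p(0) = (p/(p−1))^{1/2}` (the top of the spectrum). [cite:
ConnesConsani2021QuasiInner, Lemma 3.3, proof (arXiv chunk p0008:L105–L117)] -/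
private theorem l33_wfun_zero (p : ℕ) : lemma33Weight p 0 = Real.sqrt ((p : ℝ) / ((p : ℝ) - 1)) := by
  simp [lemma33Weight]

/-- RH-FREE. `g_p(1) = (1/(p−1))^{1/2}` (the bottom of the spectrum). [cite:
ConnesConsani2021QuasiInner, Lemma 3.3, proof (arXiv chunk p0008:L105–L117)] -/
private theorem l33_wfun_one (hp : 1 < p) : lemma33Weight p 1 = Real.sqrt (1 / ((p : ℝ) - 1)) := by
  have hp0 : (0 : ℝ) < p := by positivity
  unfold lemma33Weight
  rw [mul_one, Real.exp_neg, Real.exp_log hp0]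
  congr 1
  field_simp

/-- RH-FREE. **The weight of Lemma 3.3 on the circle `ℝ/ℤ`** (the printed `L²([0,1])` with the basis
`e_n(x) = e^{2iπnx}` is Mathlib's `L²(AddCircle 1)`): `g_p` lifted from the fundamental domain
`[0,1)`, complex-valued (RH-FREE). [cite: ConnesConsani2021QuasiInner, Lemma 3.3, proof (arXiv chunk
p0008:L105–L117)] -/
def lemma33WeightCircle (p : ℕ) : AddCircle (1 : ℝ) → ℂ := AddCircle.liftIco 1 0 fun x => ((lemma33Weight p x : ℝ) : ℂ)

/-- RH-FREE. Value of the circle weight through the fundamental-domain coordinate `equivIco`.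
[folklore] -/
private theorem l33_W_apply (p : ℕ) (y : AddCircle (1 : ℝ)) :
    lemma33WeightCircle p y = ((lemma33Weight p ((AddCircle.equivIco 1 0 y : ℝ)) : ℝ) : ℂ) := rfl

/-- RH-FREE. On `[0,1)` the circle weight is `g_p`. [folklore] -/
private theorem l33_W_coe (p : ℕ) {x : ℝ} (hx : x ∈ Ico (0 : ℝ) 1) : lemma33WeightCircle p (x : AddCircle (1 : ℝ)) = ((lemma33Weight p x : ℝ) : ℂ) := by
  unfold lemma33WeightCircle
  rw [AddCircle.liftIco_coe_apply]
  rwa [zero_add]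

/-- RH-FREE. The circle weight is real. [folklore] -/
private theorem l33_conj_W (p : ℕ) (y : AddCircle (1 : ℝ)) : conj (lemma33WeightCircle p y) = lemma33WeightCircle p y := by
  rw [l33_W_apply, Complex.conj_ofReal]

/-- RH-FREE. The circle weight is measurable. [folklore] -/
private theorem l33_measurable_W (p : ℕ) : Measurable (lemma33WeightCircle p) :=
  ((Complex.continuous_ofReal.comp (l33_continuous_wfun p)).measurable.comp measurable_subtype_coe).comp
    (AddCircle.measurableEquivIco 1 0).measurable

/-- RH-FREE. The circle weight is bounded by `(p/(p−1))^{1/2}`. [cite: ConnesConsani2021QuasiInner,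
Lemma 3.3, proof (arXiv chunk p0008:L105–L117)] -/
private theorem l33_norm_W_le (hp : 1 < p) (y : AddCircle (1 : ℝ)) :
    ‖lemma33WeightCircle p y‖ ≤ Real.sqrt ((p : ℝ) / ((p : ℝ) - 1)) := by
  rw [l33_W_apply, Complex.norm_real, Real.norm_of_nonneg (l33_wfun_nonneg _ _)]
  refine l33_wfun_le hp ?_
  have := (AddCircle.equivIco 1 0 y).2.1
  simpa using this

/-- RH-FREE. The circle weight is in `L^∞`. [folklore] -/
private theorem l33_memLp_W (hp : 1 < p) : MemLp (lemma33WeightCircle p) ∞ (haarAddCircle (T := 1)) :=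
  memLp_top_of_bound (l33_measurable_W p).aestronglyMeasurable _ (ae_of_all _ (l33_norm_W_le hp))

/-- RH-FREE. **The weight of Lemma 3.3 as a vector of `L^∞(ℝ/ℤ)`** (RH-FREE). [cite:
ConnesConsani2021QuasiInner, Lemma 3.3, proof (arXiv chunk p0008:L105–L117)] -/
def lemma33WeightLinfty (p : ℕ) (hp : 1 < p) : Lp ℂ ∞ (haarAddCircle (T := 1)) := (l33_memLp_W hp).toLp (lemma33WeightCircle p)

/-- RH-FREE. **The multiplication operator `S^{1/2}` of the printed proof** («the positive square
root of `S` given by the multiplication by the function `s(x)^{1/2}`», normalisation corrected):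
multiplication by `g_p` on `L²(ℝ/ℤ)` (RH-FREE). [cite: ConnesConsani2021QuasiInner, Lemma 3.3, proof
(arXiv chunk p0008:L105–L117)] -/
def lemma33MulOp (p : ℕ) (hp : 1 < p) : Lp ℂ 2 (haarAddCircle (T := 1)) →L[ℂ] Lp ℂ 2 (haarAddCircle (T := 1)) :=
  mulOp haarAddCircle (lemma33WeightLinfty p hp)

/-- RH-FREE. `S^{1/2} f = g_p · f` almost everywhere. [cite: ConnesConsani2021QuasiInner, Lemma 3.3,
proof (arXiv chunk p0008:L105–L117)] -/
private theorem l33_coeFn_Mop (hp : 1 < p) (f : Lp ℂ 2 (haarAddCircle (T := 1))) :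
    (lemma33MulOp p hp f : AddCircle (1 : ℝ) → ℂ) =ᵐ[haarAddCircle] fun y => lemma33WeightCircle p y * f y := by
  filter_upwards [coeFn_mulOp haarAddCircle (lemma33WeightLinfty p hp) f, (l33_memLp_W hp).coeFn_toLp] with y h1 h2
  rw [lemma33MulOp, h1]
  show (lemma33WeightLinfty p hp : AddCircle (1 : ℝ) → ℂ) y * f y = lemma33WeightCircle p y * f y
  rw [lemma33WeightLinfty, h2]

/-- RH-FREE. **The multiplication operator `S^{1/2}` is positive** (real non-negative symbol;
RH-FREE). [cite: ConnesConsani2021QuasiInner, Lemma 3.3, proof (arXiv chunk p0008:L105–L117)] -/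
theorem lemma33MulOp_isPositive (hp : 1 < p) : (lemma33MulOp p hp).IsPositive := by
  refine ⟨fun f g => ?_, fun f => ?_⟩
  · show ⟪lemma33MulOp p hp f, g⟫_ℂ = ⟪f, lemma33MulOp p hp g⟫_ℂ
    rw [MeasureTheory.L2.inner_def, MeasureTheory.L2.inner_def]
    refine integral_congr_ae ?_
    filter_upwards [l33_coeFn_Mop hp f, l33_coeFn_Mop hp g] with y h1 h2
    rw [h1, h2, RCLike.inner_apply', RCLike.inner_apply', map_mul (starRingEnd ℂ) (lemma33WeightCircle p y) (f y),
      l33_conj_W]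
    ring
  · rw [ContinuousLinearMap.reApplyInnerSelf_apply, MeasureTheory.L2.inner_def,
      ← integral_re (MeasureTheory.L2.integrable_inner _ _)]
    refine integral_nonneg_of_ae ?_
    filter_upwards [l33_coeFn_Mop hp f] with y h1
    rw [Pi.zero_apply, h1, RCLike.inner_apply', map_mul (starRingEnd ℂ) (lemma33WeightCircle p y) (f y), l33_conj_W, l33_W_apply]
    have hre : ((lemma33Weight p ((AddCircle.equivIco 1 0 y : ℝ)) : ℝ) : ℂ) * conj ((f : AddCircle (1:ℝ) → ℂ) y) *
        (f : AddCircle (1:ℝ) → ℂ) y =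
        ((lemma33Weight p ((AddCircle.equivIco 1 0 y : ℝ)) * ‖(f : AddCircle (1:ℝ) → ℂ) y‖ ^ 2 : ℝ) : ℂ) := by
      rw [mul_assoc, Complex.conj_mul']
      push_cast
      ring
    rw [hre, RCLike.re_to_complex, Complex.ofReal_re]
    exact mul_nonneg (l33_wfun_nonneg _ _) (sq_nonneg _)

/-- RH-FREE. **The isomorphism `ℓ²(ℤ) → L²([0,1])`** of the printed proof, as Mathlib's Fourier
Hilbert-basis representation `L²(ℝ/ℤ) ≃ₗᵢ ℓ²(ℤ)`, `e_n ↦ δ_n` (RH-FREE). [cite: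
ConnesConsani2021QuasiInner, Lemma 3.3, proof (arXiv chunk p0008:L105–L117)] -/
def circleFourierIso : Lp ℂ 2 (haarAddCircle (T := 1)) ≃ₗᵢ[ℂ] lp (fun _ : ℤ => ℂ) 2 := (fourierBasis (T := 1)).repr

/-- RH-FREE. **The operator `B` of Lemma 3.3** («one then lets `B` be the conjugate under the
isomorphism `ℓ²(ℤ) → L²([0,1])` of the positive square root of `S`»): `B = F S^{1/2} F⁻¹` on `ℓ²(ℤ)`
(RH-FREE). [cite: ConnesConsani2021QuasiInner, Lemma 3.3, proof (arXiv chunk p0008:L105–L117)] -/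
def lemma33Model (p : ℕ) (hp : 1 < p) : lp (fun _ : ℤ => ℂ) 2 →L[ℂ] lp (fun _ : ℤ => ℂ) 2 :=
  (circleFourierIso : Lp ℂ 2 (haarAddCircle (T := 1)) →L[ℂ] lp (fun _ : ℤ => ℂ) 2) ∘L lemma33MulOp p hp ∘L
    (circleFourierIso.symm : lp (fun _ : ℤ => ℂ) 2 →L[ℂ] Lp ℂ 2 (haarAddCircle (T := 1)))

/-- RH-FREE. **`B` is positive** (conjugate of a positive operator by a unitary; RH-FREE). [cite:
ConnesConsani2021QuasiInner, Lemma 3.3, proof (arXiv chunk p0008:L105–L117)] -/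
theorem lemma33Model_isPositive (hp : 1 < p) : (lemma33Model p hp).IsPositive := by
  have h := (lemma33MulOp_isPositive hp).conj_adjoint
    (circleFourierIso : Lp ℂ 2 (haarAddCircle (T := 1)) →L[ℂ] lp (fun _ : ℤ => ℂ) 2)
  rw [LinearIsometryEquiv.adjoint_eq_symm] at h
  exact h

/-- RH-FREE. The Fourier isomorphism sends `δ_n` to the mode `e_n`. [folklore] -/
private theorem l33_Fiso_symm_single (n : ℤ) :
    circleFourierIso.symm (lp.single 2 n (1 : ℂ)) = fourierLp (T := 1) 2 n := by
  rw [circleFourierIso, HilbertBasis.repr_symm_single, coe_fourierBasis]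

/-- RH-FREE. `Bδ_n = F(S^{1/2} e_n)`. [cite: ConnesConsani2021QuasiInner, Lemma 3.3, proof (arXiv
chunk p0008:L105–L117)] -/
private theorem l33_Bmodel_single (hp : 1 < p) (n : ℤ) :
    lemma33Model p hp (lp.single 2 n (1 : ℂ)) = circleFourierIso (lemma33MulOp p hp (fourierLp (T := 1) 2 n)) := by
  simp only [lemma33Model, ContinuousLinearMap.coe_comp, Function.comp_apply, LinearIsometryEquiv.coe_coe'']
  rw [l33_Fiso_symm_single]

/-- RH-FREE. The Gram integral «`⟨e_m | S(e_n)⟩ = (2iπm − 2iπn + log p)⁻¹`» (with the corrected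
normalisation `s(x) = p^{1−x}/(p−1)`), computed on the fundamental domain `[0,1]`. [cite:
ConnesConsani2021QuasiInner, Lemma 3.3, proof (arXiv chunk p0008:L105–L117)] -/
private theorem l33_integral_W_sq_fourier (hp : 1 < p) (m n : ℤ) :
    ∫ y, lemma33WeightCircle p y * lemma33WeightCircle p y * (conj (fourier (T := 1) m y) * fourier (T := 1) n y) ∂haarAddCircle =
      1 / (2 * I * π * m - 2 * I * π * n + Real.log p) := by
  have hp1 : (1 : ℝ) < p := by exact_mod_cast hp
  have hp' : (p : ℂ) - 1 ≠ 0 := by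
    rw [sub_ne_zero]; exact_mod_cast (show p ≠ 1 by omega)
  have hpC : (p : ℂ) ≠ 0 := Nat.cast_ne_zero.mpr (by omega)
  have hD := l34_gramDen_ne_zero (Real.log_pos hp1).ne' m n
  rw [AddCircle.integral_haarAddCircle, inv_one, one_smul, ← AddCircle.integral_preimage 1 0,
    zero_add, ← intervalIntegral.integral_of_le zero_le_one]
  have hcongr : ∫ x in (0:ℝ)..1, lemma33WeightCircle p (x : AddCircle (1:ℝ)) * lemma33WeightCircle p (x : AddCircle (1:ℝ)) *
      (conj (fourier (T := 1) m (x : AddCircle (1:ℝ))) * fourier (T := 1) n (x : AddCircle (1:ℝ))) =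
      ∫ x in (0:ℝ)..1, (((p : ℝ) / ((p : ℝ) - 1) : ℝ) : ℂ) *
        ((Real.exp (-(Real.log p * x)) : ℂ) * cexp (2 * π * I * ((n - m : ℤ) : ℂ) * x)) := by
    refine intervalIntegral.integral_congr_Ioo_of_le zero_le_one fun x hx => ?_
    have hx' : x ∈ Ico (0:ℝ) 1 := Ioo_subset_Ico_self hx
    rw [l33_W_coe p hx', fourier_coe_apply, fourier_coe_apply, Complex.ofReal_one, div_one, div_one,
      l34_conj_eMode_mul, ← Complex.ofReal_mul, ← pow_two, l33_wfun_sq hp]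
    push_cast
    ring
  rw [hcongr, intervalIntegral.integral_const_mul, l34_integral_weight_eMode hp]
  push_cast
  field_simp

/-- RH-FREE. `⟨S^{1/2}e_m | S^{1/2}e_n⟩ = (2iπm − 2iπn + log p)⁻¹`. [cite:
ConnesConsani2021QuasiInner, Lemma 3.3, proof (arXiv chunk p0008:L105–L117)] -/
private theorem l33_inner_Mop_fourierLp (hp : 1 < p) (m n : ℤ) :
    ⟪lemma33MulOp p hp (fourierLp (T := 1) 2 m), lemma33MulOp p hp (fourierLp (T := 1) 2 n)⟫_ℂ =
      1 / (2 * I * π * m - 2 * I * π * n + Real.log p) := by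
  rw [MeasureTheory.L2.inner_def, ← l33_integral_W_sq_fourier hp m n]
  refine integral_congr_ae ?_
  filter_upwards [l33_coeFn_Mop hp (fourierLp (T := 1) 2 m), l33_coeFn_Mop hp (fourierLp (T := 1) 2 n),
    coeFn_fourierLp (T := 1) 2 m, coeFn_fourierLp (T := 1) 2 n] with y h1 h2 h3 h4
  rw [h1, h2, h3, h4, RCLike.inner_apply', map_mul, l33_conj_W]
  ring

/-- RH-FREE. **Lemma 3.3, existence clause PROVED**: the operator `B = F S^{1/2} F⁻¹` is positive
and has the Gram data `⟨B(δ_m)|B(δ_n)⟩ = (2iπm − 2iπn + log p)⁻¹` (RH-FREE). [cite: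
ConnesConsani2021QuasiInner, Lemma 3.3 (arXiv chunk p0008:L97–L103)] -/
theorem isLemma33Operator_lemma33Model (hp : p.Prime) : IsLemma33Operator p (lemma33Model p hp.one_lt) := by
  refine ⟨lemma33Model_isPositive hp.one_lt, fun m n => ?_⟩
  rw [l33_Bmodel_single, l33_Bmodel_single, LinearIsometryEquiv.inner_map_map, l33_inner_Mop_fourierLp]

end Model

/-! #### The spectrum of `S^{1/2}` (essential range) -/

section Spec

variable {p : ℕ}


/-- RH-FREE. On `[0,1]` the weight takes values in `[(1/(p−1))^{1/2}, (p/(p−1))^{1/2}]`. [cite: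
ConnesConsani2021QuasiInner, Lemma 3.3, proof (arXiv chunk p0008:L105–L117)] -/
private theorem l33_wfun_mem_Icc (hp : 1 < p) {t : ℝ} (ht : t ∈ Icc (0:ℝ) 1) :
    lemma33Weight p t ∈ Icc (Real.sqrt (1 / ((p : ℝ) - 1))) (Real.sqrt ((p : ℝ) / ((p : ℝ) - 1))) := by
  have hp1 : (1 : ℝ) < p := by exact_mod_cast hp
  have hp0 : (0 : ℝ) < p := by positivity
  have hp' : 0 < (p : ℝ) - 1 := by linarith
  have hL := Real.log_pos hp1
  refine ⟨?_, l33_wfun_le hp ht.1⟩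
  unfold lemma33Weight
  apply Real.sqrt_le_sqrt
  have h1 : (p : ℝ)⁻¹ ≤ Real.exp (-(Real.log p * t)) := by
    have he : Real.exp (-Real.log p) = (p : ℝ)⁻¹ := by rw [Real.exp_neg, Real.exp_log hp0]
    rw [← he]
    apply Real.exp_le_exp.mpr
    nlinarith [ht.2]
  calc 1 / ((p : ℝ) - 1) = (p : ℝ) / ((p : ℝ) - 1) * (p : ℝ)⁻¹ := by field_simp
    _ ≤ (p : ℝ) / ((p : ℝ) - 1) * Real.exp (-(Real.log p * t)) :=
        mul_le_mul_of_nonneg_left h1 (by positivity)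

/-- RH-FREE. The circle weight takes values in (the complexification of) `[(1/(p−1))^{1/2},
(p/(p−1))^{1/2}]`. [cite: ConnesConsani2021QuasiInner, Lemma 3.3, proof (arXiv chunk
p0008:L105–L117)] -/
private theorem l33_W_mem (hp : 1 < p) (y : AddCircle (1 : ℝ)) :
    lemma33WeightCircle p y ∈ (fun x : ℝ => (x : ℂ)) ''
      Icc (Real.sqrt (1 / ((p : ℝ) - 1))) (Real.sqrt ((p : ℝ) / ((p : ℝ) - 1))) := by
  refine ⟨lemma33Weight p ((AddCircle.equivIco 1 0 y : ℝ)), l33_wfun_mem_Icc hp ?_, (l33_W_apply p y).symm⟩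
  have h := (AddCircle.equivIco 1 0 y).2
  simp only [zero_add] at h
  exact ⟨h.1, h.2.le⟩

/-- RH-FREE. `(c − S^{1/2}) f = (c − g_p) · f` almost everywhere. [folklore] -/
private theorem l33_coeFn_smul_one_sub_Mop (hp : 1 < p) (c : ℂ) (f : (Lp ℂ 2 (haarAddCircle (T := (1:ℝ))))) :
    (((c • (1 : (Lp ℂ 2 (haarAddCircle (T := (1:ℝ)))) →L[ℂ] (Lp ℂ 2 (haarAddCircle (T := (1:ℝ))))) - lemma33MulOp p hp) f : (Lp ℂ 2 (haarAddCircle (T := (1:ℝ))))) : AddCircle (1:ℝ) → ℂ) =ᵐ[haarAddCircle]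
      fun y => (c - lemma33WeightCircle p y) * f y := by
  have h0 : (c • (1 : (Lp ℂ 2 (haarAddCircle (T := (1:ℝ)))) →L[ℂ] (Lp ℂ 2 (haarAddCircle (T := (1:ℝ))))) - lemma33MulOp p hp) f = c • f - lemma33MulOp p hp f := rfl
  rw [h0]
  filter_upwards [Lp.coeFn_sub (c • f) (lemma33MulOp p hp f), Lp.coeFn_smul c f, l33_coeFn_Mop hp f]
    with y h1 h2 h3
  rw [h1, Pi.sub_apply, h2, Pi.smul_apply, h3, smul_eq_mul]
  ring

/-- RH-FREE. Off the closed interval the operator `c − S^{1/2}` is invertible (inverse =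
multiplication by `(c − g_p)⁻¹ ∈ L^∞`). [folklore] -/
private theorem l33_isUnit_smul_one_sub_Mop (hp : 1 < p) {c : ℂ} {δ : ℝ} (hδ : 0 < δ)
    (hfar : ∀ y, δ ≤ ‖c - lemma33WeightCircle p y‖) : IsUnit (c • (1 : (Lp ℂ 2 (haarAddCircle (T := (1:ℝ)))) →L[ℂ] (Lp ℂ 2 (haarAddCircle (T := (1:ℝ))))) - lemma33MulOp p hp) := by
  have hne : ∀ y, c - lemma33WeightCircle p y ≠ 0 := fun y h => by
    have := hfar y; rw [h, norm_zero] at this; linarith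
  have hVm : Measurable fun y => (c - lemma33WeightCircle p y)⁻¹ := (measurable_const.sub (l33_measurable_W p)).inv
  have hVb : ∀ y, ‖(c - lemma33WeightCircle p y)⁻¹‖ ≤ δ⁻¹ := fun y => by
    rw [norm_inv]; exact inv_anti₀ hδ (hfar y)
  have hV : MemLp (fun y => (c - lemma33WeightCircle p y)⁻¹) ∞ (haarAddCircle (T := 1)) :=
    memLp_top_of_bound hVm.aestronglyMeasurable _ (ae_of_all _ hVb)
  set N : (Lp ℂ 2 (haarAddCircle (T := (1:ℝ)))) →L[ℂ] (Lp ℂ 2 (haarAddCircle (T := (1:ℝ)))) := mulOp haarAddCircle (hV.toLp _) with hN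
  have hNf : ∀ f : (Lp ℂ 2 (haarAddCircle (T := (1:ℝ)))), ((N f : (Lp ℂ 2 (haarAddCircle (T := (1:ℝ))))) : AddCircle (1:ℝ) → ℂ) =ᵐ[haarAddCircle]
      fun y => (c - lemma33WeightCircle p y)⁻¹ * f y := by
    intro f
    filter_upwards [coeFn_mulOp haarAddCircle (hV.toLp _) f, hV.coeFn_toLp] with y h1 h2
    rw [hN, h1, h2]
  set A : (Lp ℂ 2 (haarAddCircle (T := (1:ℝ)))) →L[ℂ] (Lp ℂ 2 (haarAddCircle (T := (1:ℝ)))) := c • (1 : (Lp ℂ 2 (haarAddCircle (T := (1:ℝ)))) →L[ℂ] (Lp ℂ 2 (haarAddCircle (T := (1:ℝ))))) - lemma33MulOp p hp with hA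
  have h1 : A * N = 1 := by
    ext1 f
    refine Lp.ext ?_
    filter_upwards [l33_coeFn_smul_one_sub_Mop hp c (N f), hNf f] with y e1 e2
    rw [mul_apply_eq_comp, hA, e1, e2, one_apply_eq_self, ← mul_assoc, mul_inv_cancel₀ (hne y),
      one_mul]
  have h2 : N * A = 1 := by
    ext1 f
    refine Lp.ext ?_
    filter_upwards [hNf (A f), l33_coeFn_smul_one_sub_Mop hp c f] with y e1 e2
    rw [mul_apply_eq_comp, e1, hA, e2, one_apply_eq_self, ← mul_assoc, inv_mul_cancel₀ (hne y),
      one_mul]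
  exact ⟨⟨A, N, h1, h2⟩, rfl⟩

/-- RH-FREE. On the interval `[(1/(p−1))^{1/2}, (p/(p−1))^{1/2}]` the operator `r − S^{1/2}` is not
invertible (indicator functions of small arcs are approximate eigenvectors; the endpoint
`(1/(p−1))^{1/2} = g_p(1⁻)` is in the essential range though not attained). [folklore] -/
private theorem l33_not_isUnit_smul_one_sub_Mop (hp : 1 < p) {r : ℝ}
    (hr : r ∈ Icc (Real.sqrt (1 / ((p : ℝ) - 1))) (Real.sqrt ((p : ℝ) / ((p : ℝ) - 1)))) :
    ¬ IsUnit ((r : ℂ) • (1 : (Lp ℂ 2 (haarAddCircle (T := (1:ℝ)))) →L[ℂ] (Lp ℂ 2 (haarAddCircle (T := (1:ℝ))))) - lemma33MulOp p hp) := by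
  rintro ⟨u, hu⟩
  -- the inverse gives a lower bound
  set C : ℝ := ‖(↑u⁻¹ : (Lp ℂ 2 (haarAddCircle (T := (1:ℝ)))) →L[ℂ] (Lp ℂ 2 (haarAddCircle (T := (1:ℝ)))))‖ with hC
  have hlow : ∀ f : (Lp ℂ 2 (haarAddCircle (T := (1:ℝ)))), ‖f‖ ≤ C * ‖((r : ℂ) • (1 : (Lp ℂ 2 (haarAddCircle (T := (1:ℝ)))) →L[ℂ] (Lp ℂ 2 (haarAddCircle (T := (1:ℝ))))) - lemma33MulOp p hp) f‖ := by
    intro f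
    have h := congrArg (fun T : (Lp ℂ 2 (haarAddCircle (T := (1:ℝ)))) →L[ℂ] (Lp ℂ 2 (haarAddCircle (T := (1:ℝ)))) => T f) u.inv_mul
    simp only [mul_apply_eq_comp, one_apply_eq_self] at h
    calc ‖f‖ = ‖(↑u⁻¹ : (Lp ℂ 2 (haarAddCircle (T := (1:ℝ)))) →L[ℂ] (Lp ℂ 2 (haarAddCircle (T := (1:ℝ))))) ((↑u : (Lp ℂ 2 (haarAddCircle (T := (1:ℝ)))) →L[ℂ] (Lp ℂ 2 (haarAddCircle (T := (1:ℝ))))) f)‖ := by rw [h]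
      _ ≤ C * ‖(↑u : (Lp ℂ 2 (haarAddCircle (T := (1:ℝ)))) →L[ℂ] (Lp ℂ 2 (haarAddCircle (T := (1:ℝ))))) f‖ := ContinuousLinearMap.le_opNorm _ _
      _ = C * ‖((r : ℂ) • (1 : (Lp ℂ 2 (haarAddCircle (T := (1:ℝ)))) →L[ℂ] (Lp ℂ 2 (haarAddCircle (T := (1:ℝ))))) - lemma33MulOp p hp) f‖ := by rw [hu]
  have hC0 : 0 ≤ C := norm_nonneg _
  set ε : ℝ := 1 / (2 * (C + 1)) with hε
  have hε0 : 0 < ε := by positivity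
  -- a point where the weight equals `r`
  obtain ⟨x₁, hx₁, hwx₁⟩ : ∃ x₁ ∈ Icc (0:ℝ) 1, lemma33Weight p x₁ = r := by
    have hsub := intermediate_value_Icc' (zero_le_one (α := ℝ)) (l33_continuous_wfun p).continuousOn
    rw [l33_wfun_zero, l33_wfun_one hp] at hsub
    exact hsub hr
  -- continuity gives a small interval inside `(0,1)` where `|lemma33Weight - r| < ε`
  obtain ⟨δ, hδ0, hδ⟩ := Metric.continuousAt_iff.mp ((l33_continuous_wfun p).continuousAt (x := x₁)) ε hε0
  set O : Set ℝ := Ioo (x₁ - δ) (x₁ + δ) ∩ Ioo 0 1 with hO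
  have hOopen : IsOpen O := isOpen_Ioo.inter isOpen_Ioo
  have hOne : O.Nonempty := by
    have hcl : x₁ ∈ closure (Ioo (0:ℝ) 1) := by
      rw [closure_Ioo zero_ne_one]; exact hx₁
    rw [mem_closure_iff_nhds] at hcl
    exact hcl _ (Ioo_mem_nhds (by linarith) (by linarith))
  have hOsub : O ⊆ Ioo 0 1 := inter_subset_right
  have hOclose : ∀ x ∈ O, ‖(r : ℂ) - (lemma33Weight p x : ℂ)‖ < ε := by
    intro x hx
    have h := hδ (x := x) (by
      rw [Real.dist_eq, abs_lt]; constructor <;> linarith [hx.1.1, hx.1.2])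
    rw [Real.dist_eq] at h
    rw [← Complex.ofReal_sub, Complex.norm_real, Real.norm_eq_abs, abs_sub_comm]
    rwa [hwx₁] at h
  -- the open set on the circle and its indicator
  set sO : Set (AddCircle (1:ℝ)) := ((↑) : ℝ → AddCircle (1:ℝ)) '' O with hsO
  have hsOopen : IsOpen sO := QuotientAddGroup.isOpenMap_coe O hOopen
  have hsOmeas : MeasurableSet sO := hsOopen.measurableSet
  have hsOne : sO.Nonempty := hOne.image _
  have hpos : 0 < haarAddCircle (T := 1) sO := hsOopen.measure_pos _ hsOne
  have htop : haarAddCircle (T := 1) sO ≠ ⊤ := measure_ne_top _ _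
  set f : (Lp ℂ 2 (haarAddCircle (T := (1:ℝ)))) := indicatorConstLp 2 hsOmeas htop (1 : ℂ) with hf
  have hfpos : 0 < ‖f‖ := by
    rw [hf, norm_indicatorConstLp two_ne_zero ENNReal.ofNat_ne_top, norm_one, one_mul]
    refine Real.rpow_pos_of_pos ?_ _
    rw [measureReal_def]
    exact ENNReal.toReal_pos hpos.ne' htop
  -- `‖(r - M) f‖ ≤ ε ‖f‖`
  have hsmall : ‖((r : ℂ) • (1 : (Lp ℂ 2 (haarAddCircle (T := (1:ℝ)))) →L[ℂ] (Lp ℂ 2 (haarAddCircle (T := (1:ℝ))))) - lemma33MulOp p hp) f‖ ≤ ε * ‖f‖ := by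
    refine Lp.norm_le_mul_norm_of_ae_le_mul ?_
    filter_upwards [l33_coeFn_smul_one_sub_Mop hp (r : ℂ) f,
      (indicatorConstLp_coeFn : ⇑f =ᵐ[haarAddCircle] sO.indicator fun _ => (1 : ℂ))] with y e1 e2
    rw [e1, norm_mul]
    by_cases hy : y ∈ sO
    · refine mul_le_mul_of_nonneg_right ?_ (norm_nonneg _)
      obtain ⟨x, hxO, rfl⟩ := hy
      rw [l33_W_coe p (Ioo_subset_Ico_self (hOsub hxO))]
      exact (hOclose x hxO).le
    · rw [e2, Set.indicator_of_notMem hy, norm_zero, mul_zero, mul_zero]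
  have := hlow f
  have h3 : ‖f‖ ≤ C * (ε * ‖f‖) := this.trans (mul_le_mul_of_nonneg_left hsmall hC0)
  have h4 : C * ε ≤ 1 / 2 := by
    rw [hε]
    rw [show C * (1 / (2 * (C + 1))) = (C / (C + 1)) * (1 / 2) by field_simp]
    have : C / (C + 1) ≤ 1 := by
      rw [div_le_one (by positivity)]; linarith
    linarith
  nlinarith

/-- RH-FREE. **The spectrum of `S^{1/2}` is the interval `[(1/(p−1))^{1/2}, (p/(p−1))^{1/2}]`**
(essential range of the weight; printed «absolutely continuous spectrum the interval `[1, √p]`»,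
interval corrected as recorded in the docstring of `lemma_3_3`; the absolute continuity of the
spectral measure is not typed; RH-FREE). [cite: ConnesConsani2021QuasiInner, Lemma 3.3 (arXiv chunk
p0008:L97–L103)] -/
theorem spectrum_lemma33MulOp (hp : 1 < p) :
    spectrum ℂ (lemma33MulOp p hp) = (fun x : ℝ => (x : ℂ)) ''
      Icc (Real.sqrt (1 / ((p : ℝ) - 1))) (Real.sqrt ((p : ℝ) / ((p : ℝ) - 1))) := by
  set S := (fun x : ℝ => (x : ℂ)) ''
      Icc (Real.sqrt (1 / ((p : ℝ) - 1))) (Real.sqrt ((p : ℝ) / ((p : ℝ) - 1))) with hS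
  have hp1 : (1 : ℝ) < p := by exact_mod_cast hp
  have hab : Real.sqrt (1 / ((p : ℝ) - 1)) ≤ Real.sqrt ((p : ℝ) / ((p : ℝ) - 1)) := by
    apply Real.sqrt_le_sqrt
    have : 0 < (p : ℝ) - 1 := by linarith
    exact div_le_div_of_nonneg_right hp1.le this.le
  have hSclosed : IsClosed S := (isCompact_Icc.image Complex.continuous_ofReal).isClosed
  have hSne : S.Nonempty := ⟨_, ⟨_, left_mem_Icc.mpr hab, rfl⟩⟩
  ext c
  rw [spectrum.mem_iff, Algebra.algebraMap_eq_smul_one]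
  constructor
  · intro hc
    by_contra hcS
    apply hc
    have hδ : 0 < Metric.infDist c S := by
      rw [← Metric.infDist_pos_iff_notMem_closure hSne, hSclosed.closure_eq]; exact hcS
    refine l33_isUnit_smul_one_sub_Mop hp hδ fun y => ?_
    have := Metric.infDist_le_dist_of_mem (x := c) (l33_W_mem hp y)
    rwa [dist_eq_norm] at this
  · rintro ⟨r, hr, rfl⟩
    exact l33_not_isUnit_smul_one_sub_Mop hp hr

end Spec

/-! #### Assembly -/

section Assembly


/-- RH-FREE. **The spectrum of `B` is the interval `[(1/(p−1))^{1/2}, (p/(p−1))^{1/2}]`** (unitary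
conjugate of `S^{1/2}`; RH-FREE). [cite: ConnesConsani2021QuasiInner, Lemma 3.3 (arXiv chunk
p0008:L97–L103)] -/
theorem spectrum_lemma33Model {p : ℕ} (hp : 1 < p) :
    spectrum ℂ (lemma33Model p hp) = (fun x : ℝ => (x : ℂ)) ''
      Icc (Real.sqrt (1 / ((p : ℝ) - 1))) (Real.sqrt ((p : ℝ) / ((p : ℝ) - 1))) := by
  have h : lemma33Model p hp =
      ((circleFourierIso.toContinuousLinearEquiv : (Lp ℂ 2 (haarAddCircle (T := (1:ℝ)))) ≃L[ℂ] lp (fun _ : ℤ => ℂ) 2) : (Lp ℂ 2 (haarAddCircle (T := (1:ℝ)))) →L[ℂ] lp (fun _ : ℤ => ℂ) 2) ∘L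
        lemma33MulOp p hp ∘L ((circleFourierIso.toContinuousLinearEquiv : (Lp ℂ 2 (haarAddCircle (T := (1:ℝ)))) ≃L[ℂ] lp (fun _ : ℤ => ℂ) 2).symm :
          lp (fun _ : ℤ => ℂ) 2 →L[ℂ] (Lp ℂ 2 (haarAddCircle (T := (1:ℝ))))) := rfl
  rw [h, l33_spectrum_conj_eq, spectrum_lemma33MulOp]

/-- RH-FREE. **Lemma 3.3 PROVED** (`lemma_3_3_holds : lemma_3_3`, the statement as corrected in
p422591): existence (`isLemma33Operator_lemma33Model`), uniqueness (`IsLemma33Operator.unique`),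
bounded inverse (`0 ∉` spectrum; also `IsLemma33Operator.isUnit`) and spectrum `= [(1/(p−1))^{1/2},
(p/(p−1))^{1/2}]` (`spectrum_lemma33Model`). RH-FREE. [cite: ConnesConsani2021QuasiInner, Lemma 3.3
(arXiv chunk p0008:L97–L103)] -/
theorem lemma_3_3_holds : lemma_3_3 := by
  intro p hp
  have hp1 := hp.one_lt
  have hp1' : (1 : ℝ) < p := by exact_mod_cast hp1
  have hspec : ∀ B, IsLemma33Operator p B → spectrum ℂ B = (fun x : ℝ => (x : ℂ)) ''
      Icc (Real.sqrt (1 / ((p : ℝ) - 1))) (Real.sqrt ((p : ℝ) / ((p : ℝ) - 1))) := by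
    intro B hB
    rw [IsLemma33Operator.unique hB (isLemma33Operator_lemma33Model hp), spectrum_lemma33Model]
  refine ⟨⟨lemma33Model p hp1, isLemma33Operator_lemma33Model hp,
    fun B hB => IsLemma33Operator.unique hB (isLemma33Operator_lemma33Model hp)⟩, fun B hB => ⟨?_, hspec B hB⟩⟩
  by_contra hunit
  have h0 : (0 : ℂ) ∈ spectrum ℂ B := (spectrum.zero_mem_iff ℂ).mpr hunit
  rw [hspec B hB] at h0
  obtain ⟨x, hx, hx0⟩ := h0
  have ha : 0 < Real.sqrt (1 / ((p : ℝ) - 1)) := Real.sqrt_pos.mpr (by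
    have : 0 < (p : ℝ) - 1 := by linarith
    positivity)
  have hx0' : (x : ℂ) = 0 := hx0
  have : x = 0 := by exact_mod_cast hx0'
  linarith [hx.1]

end Assembly

end LemmaThreeThree

section ResiduesAndBoundary

/-! ### Residues of `ρ_p` (printed displays of §3) and the boundary function of `κ_p`

RH-FREE.  The expansion «`ρ_p(z) = ((1 − 1/p)/log p)(1/z) + …`» (p0008:L17) as the residue
`lim_{z→0} zρ_p(z) = (1 − 1/p)/log p`, its transport to every pole `2πin/log p` by periodicity, the printed
residue display (p0008:L55–L57) behind «offdiag2», and the boundary function of `κ_p` in `L^∞(S¹)`,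
unimodular (first two clauses of the typed `fact_3_6`). -/

/-- RH-FREE. **The residue of `ρ_p` at `z = 0`**: «`ρ_p(z) = ((1 − 1/p)/log p)·(1/z) + (p−3)/(2p) + …`»,
typed as `z ρ_p(z) → (1 − p⁻¹)/log p` for `z → 0`, `z ≠ 0` (PROVED: the denominator `1 − p^{−z}` has a
simple zero at `0` with derivative `log p`, the numerator tends to `1 − p⁻¹`).
[cite: ConnesConsani2021QuasiInner, Lemma 3.1, proof, display (arXiv chunk p0008:L15–L17)] -/
theorem tendsto_mul_rhoPrime_zero {p : ℕ} (hp : 1 < p) :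
    Tendsto (fun z : ℂ => z * rhoPrime p z) (𝓝[≠] 0) (𝓝 ((1 - (p : ℂ)⁻¹) / Real.log p)) := by
  have hp0 : (p : ℂ) ≠ 0 := Nat.cast_ne_zero.2 (by omega)
  have hlogR : 0 < Real.log p := Real.log_pos (by exact_mod_cast hp)
  have hlogp : Complex.log (p : ℂ) = (Real.log p : ℂ) := by
    rw [← ofReal_natCast, ← ofReal_log (by positivity)]
  have hD : HasDerivAt (denF p) ((p : ℂ) ^ (-(0 : ℂ)) * Complex.log p) 0 := by
    have := ((differentiable_denF hp).differentiableAt (x := (0 : ℂ))).hasDerivAt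
    rwa [deriv_denF hp] at this
  rw [neg_zero, cpow_zero, one_mul, hlogp] at hD
  have hD0 : denF p 0 = 0 := by simp [denF]
  have hslope : Tendsto (fun z : ℂ => z⁻¹ * denF p z) (𝓝[≠] 0) (𝓝 (Real.log p : ℂ)) := by
    have := hD.tendsto_slope_zero
    simpa [hD0] using this
  have hN : Tendsto (numF p) (𝓝[≠] 0) (𝓝 (1 - (p : ℂ)⁻¹)) := by
    have hc : ContinuousAt (numF p) 0 := (differentiable_numF hp).continuous.continuousAt
    have h0 : numF p 0 = 1 - (p : ℂ)⁻¹ := by simp [numF, cpow_neg_one]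
    rw [← h0]
    exact hc.tendsto.mono_left nhdsWithin_le_nhds
  have hlogC : (Real.log p : ℂ) ≠ 0 := ofReal_ne_zero.2 hlogR.ne'
  refine (hN.div hslope hlogC).congr' ?_
  filter_upwards [self_mem_nhdsWithin] with z hz
  have h : rhoPrime p z = numF p z / denF p z := by rw [rhoPrime_eq_div]; rfl
  show numF p z / (z⁻¹ * denF p z) = z * rhoPrime p z
  rw [h, ← div_div, div_inv_eq_mul]
  ring

/-- RH-FREE. **The residue of `ρ_p` at the pole `2πin/log p`** is the same number `(1 − p⁻¹)/log p`
(«To obtain the residue one multiplies by `(1 − 1/p)/log p` as shown from periodicity and the expansion at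
`z = 0` above»): `(z − 2πin/log p) ρ_p(z) → (1 − p⁻¹)/log p`.
[cite: ConnesConsani2021QuasiInner, §3 (arXiv chunk p0008:L53)] -/
theorem tendsto_sub_mul_rhoPrime_pole {p : ℕ} (hp : 1 < p) (n : ℤ) :
    Tendsto (fun z : ℂ => (z - 2 * π * I * n / Real.log p) * rhoPrime p z)
      (𝓝[≠] (2 * π * I * n / Real.log p)) (𝓝 ((1 - (p : ℂ)⁻¹) / Real.log p)) := by
  set zn : ℂ := 2 * π * I * n / Real.log p with hzn
  have hper : ∀ z, rhoPrime p z = rhoPrime p (z - zn) := by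
    intro z
    have h := (rhoPrime_periodic hp).int_mul n (z - zn)
    rw [show z - zn + (n : ℂ) * (2 * π * I / Real.log p) = z by rw [hzn]; ring] at h
    exact h
  have hshift : Tendsto (fun z : ℂ => z - zn) (𝓝[≠] zn) (𝓝[≠] 0) := by
    apply tendsto_nhdsWithin_of_tendsto_nhds_of_eventually_within
    · have h : Tendsto (fun z : ℂ => z - zn) (𝓝 zn) (𝓝 (zn - zn)) := tendsto_id.sub tendsto_const_nhds
      rw [sub_self] at h
      exact h.mono_left nhdsWithin_le_nhds
    · filter_upwards [self_mem_nhdsWithin] with z hz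
      simpa [sub_eq_zero] using hz
  refine ((tendsto_mul_rhoPrime_zero hp).comp hshift).congr' (Eventually.of_forall fun z => ?_)
  simp only [Function.comp_apply]
  rw [← hper z]

/-- RH-FREE. **The residue display behind «offdiag2»**: «`Res_{z=2πin/log p}(ρ_p(z)((2z+1)/(2z−3))^k
(−8)/(2z−3)²) = 8(1 − 1/p) log p/(4πn + 3i log p)² · x_p(n)^k`» (here as the limit of
`(z − 2πin/log p)·(…)`; uses `(2z+1)/(2z−3) = x_p(n)` and `−8/(2z−3)² = 8log²p/(4πn + 3i log p)²` at the
pole, p0008:L49). PROVED.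
[cite: ConnesConsani2021QuasiInner, §3, display (arXiv chunk p0008:L55–L57)] -/
theorem tendsto_residue_offdiag2 {p : ℕ} (hp : 1 < p) (n : ℤ) (k : ℕ) :
    Tendsto (fun z : ℂ => (z - 2 * π * I * n / Real.log p) *
        (rhoPrime p z * ((2 * z + 1) / (2 * z - 3)) ^ k * ((-8) / (2 * z - 3) ^ 2)))
      (𝓝[≠] (2 * π * I * n / Real.log p))
      (𝓝 (8 * (1 - (p : ℂ)⁻¹) * Real.log p / (4 * π * n + 3 * I * Real.log p) ^ 2 * xPrime p n ^ k)) := by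
  have hlogR : 0 < Real.log p := Real.log_pos (by exact_mod_cast hp)
  set L : ℝ := Real.log p with hL
  have hL0 : (L : ℂ) ≠ 0 := ofReal_ne_zero.2 hlogR.ne'
  set zn : ℂ := 2 * π * I * n / L with hzn
  have h23 : 2 * zn - 3 = I * (4 * π * n + 3 * I * L) / L := by
    rw [hzn]; field_simp; ring_nf; rw [I_sq]; ring
  have hD : (4 * π * n + 3 * I * L : ℂ) ≠ 0 := by
    intro h
    have := congrArg Complex.im h
    simp at this
    exact hlogR.ne' this
  have h23ne : (2 * zn - 3 : ℂ) ≠ 0 := by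
    rw [h23]; exact div_ne_zero (mul_ne_zero I_ne_zero hD) hL0
  have hc : ContinuousAt (fun z : ℂ => ((2 * z + 1) / (2 * z - 3)) ^ k * ((-8) / (2 * z - 3) ^ 2)) zn := by
    have h1 : ContinuousAt (fun z : ℂ => 2 * z - 3) zn := by fun_prop
    have h2 : ContinuousAt (fun z : ℂ => 2 * z + 1) zn := by fun_prop
    exact ((h2.div h1 h23ne).pow k).mul (continuousAt_const.div (h1.pow 2) (pow_ne_zero 2 h23ne))
  have hlim := (tendsto_sub_mul_rhoPrime_pole hp n).mul (hc.tendsto.mono_left nhdsWithin_le_nhds)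
  have hx : (2 * zn + 1) / (2 * zn - 3) = xPrime p n := by
    rw [xPrime_eq_cayleyInv hp n, cayleyInv]
  have hval : (1 - (p : ℂ)⁻¹) / L * (((2 * zn + 1) / (2 * zn - 3)) ^ k * ((-8) / (2 * zn - 3) ^ 2)) =
      8 * (1 - (p : ℂ)⁻¹) * L / (4 * π * n + 3 * I * L) ^ 2 * xPrime p n ^ k := by
    rw [hx, h23]
    field_simp
    ring_nf
    rw [I_sq]
    ring
  rw [hval] at hlim
  refine hlim.congr' (Eventually.of_forall fun z => ?_)
  ring

/-- RH-FREE. `ρ_p` is a measurable function on `ℂ` (quotient of entire functions). [folklore] -/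
private theorem measurable_rhoPrime {p : ℕ} (hp : 1 < p) : Measurable (rhoPrime p) := by
  rw [rhoPrime_eq_div]
  exact (differentiable_numF hp).continuous.measurable.div (differentiable_denF hp).continuous.measurable

/-- RH-FREE. The conformal map `ψ` is measurable on `ℂ` (junk value at `v = 1`). [folklore] -/
private theorem measurable_cayley : Measurable cayley := by
  unfold cayley
  exact measurable_const.add ((measurable_id.add_const 1).div (measurable_id.sub_const 1))

/-- RH-FREE. **The boundary function of `κ_p` belongs to `L^∞(S¹)` and is unimodular** (it is
measurable and `|κ_p| = 1` on `S¹`, `ρ_p` being unimodular on the critical line) — the first two clauses of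
the typed `fact_3_6`, PROVED; the vector `toLpOrZero ∞ (κ_p|S¹)` of the typed statements is this function.
[cite: ConnesConsani2021QuasiInner, §3, Fact 3.6 context «the restriction of ρ_p to the critical line is of modulus one» (arXiv chunk p0009:L34–L44)] -/
theorem memLp_circleRestrict_kappaPrime {p : ℕ} (hp : 1 < p) :
    MemLp (circleRestrict 1 (kappaPrime p)) ∞ (haarAddCircle (T := 1)) ∧
    (∀ᵐ x ∂(haarAddCircle (T := 1)), ‖circleRestrict 1 (kappaPrime p) x‖ = 1) ∧
    toLpOrZero ∞ haarAddCircle (circleRestrict 1 (kappaPrime p)) =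
      (memLp_top_of_bound (((measurable_rhoPrime hp).comp (measurable_cayley.comp
        (continuous_subtype_val.comp AddCircle.continuous_toCircle).measurable)).aestronglyMeasurable) 1
        (ae_of_all _ fun x => (norm_circleRestrict_kappaPrime (T := 1) hp x).le)).toLp _ := by
  have hmeas : Measurable (circleRestrict 1 (kappaPrime p)) :=
    (measurable_rhoPrime hp).comp (measurable_cayley.comp
      (continuous_subtype_val.comp AddCircle.continuous_toCircle).measurable)
  have hmem : MemLp (circleRestrict 1 (kappaPrime p)) ∞ (haarAddCircle (T := 1)) :=
    memLp_top_of_bound hmeas.aestronglyMeasurable 1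
      (ae_of_all _ fun x => (norm_circleRestrict_kappaPrime (T := 1) hp x).le)
  exact ⟨hmem, ae_of_all _ fun x => norm_circleRestrict_kappaPrime (T := 1) hp x, toLpOrZero_eq_toLp hmem⟩

end ResiduesAndBoundary

section ThmTwoThreeToTwoOne

/-! ### Theorem 2.3 ⇒ the compactness sentence of Theorem 2.1; the boundary function of `κ`

RH-FREE.  «Next theorem shows that the characteristic values of the off diagonal part `(1 − 𝒫)ρ_∞𝒫`
decay extremely fast» (p0006:L49): the norm-convergent rank-one expansion of Theorem 2.3 exhibits
`(1 − 𝒫)κ𝒫` as a norm limit of finite-rank operators, hence a compact operator, i.e. the first sentence of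
Theorem 2.1 («`ρ_∞` is quasi-inner relative to `ℂ₋`») follows from Theorem 2.3 — PROVED here as the
reduction `isQuasiInnerLeftHalfPlane_rhoArch_of_thm_2_3 : thm_2_3 → IsQuasiInnerLeftHalfPlane rhoArch`,
together with the facts about the boundary function `κ|S¹ ∈ L^∞(S¹)` (measurable: continuous off the
point `v = 1`; unimodular) that the typed statements use through `toLpOrZero`. -/

/-- RH-FREE. `ρ_∞` is continuous (indeed holomorphic) at every point where `Γ_ℝ` does not vanish
(`ρ_∞ = ((Γ_ℝ)⁻¹)⁻¹ · (Γ_ℝ(1 − ·))⁻¹` with `Γ_ℝ⁻¹` entire). [folklore] -/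
private theorem continuousAt_rhoArch {z : ℂ} (hz : Gammaℝ z ≠ 0) : ContinuousAt rhoArch z := by
  have h1 : DifferentiableAt ℂ (fun w : ℂ => ((Gammaℝ w)⁻¹)⁻¹) z :=
    differentiable_Gammaℝ_inv.differentiableAt.inv (inv_ne_zero hz)
  have h2 : Differentiable ℂ (fun w : ℂ => (Gammaℝ (1 - w))⁻¹) :=
    differentiable_Gammaℝ_inv.comp ((differentiable_const (1 : ℂ)).sub differentiable_id)
  have heq : rhoArch = fun w : ℂ => ((Gammaℝ w)⁻¹)⁻¹ * (Gammaℝ (1 - w))⁻¹ := by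
    funext w
    rw [rhoArch_def, inv_inv, div_eq_mul_inv]
  rw [heq]
  exact (h1.mul h2.differentiableAt).continuousAt

/-- RH-FREE. The conformal map `ψ` is continuous off `v = 1`. [folklore] -/
private theorem continuousAt_cayley {v : ℂ} (hv : v ≠ 1) : ContinuousAt cayley v := by
  unfold cayley
  exact continuousAt_const.add ((continuousAt_id.add continuousAt_const).div
    (continuousAt_id.sub continuousAt_const) (sub_ne_zero.mpr hv))

/-- RH-FREE. The boundary function `κ|S¹` is continuous off the point `v = 1` (the class of `0` in
`AddCircle T`), where `ψ(v)` runs over the critical line on which `Γ_ℝ` has neither zeros nor poles.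
[cite: ConnesConsani2021QuasiInner, §2 (arXiv chunk p0006:L87) «the restriction of ρ_∞ to the critical line is a smooth function of modulus 1»] -/
theorem continuousOn_circleRestrict_kappaArch (T : ℝ) [hT : Fact (0 < T)] :
    ContinuousOn (circleRestrict T kappaArch) {0}ᶜ := by
  intro x hx
  refine ContinuousAt.continuousWithinAt ?_
  have hv1 : ((toCircle x : Circle) : ℂ) ≠ 1 := by
    intro h
    apply hx
    have h' : toCircle x = toCircle (0 : AddCircle T) := by
      rw [toCircle_zero]; exact Circle.ext h
    exact injective_toCircle hT.out.ne' h'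
  have hvn : ‖((toCircle x : Circle) : ℂ)‖ = 1 := Circle.norm_coe _
  have hG : Gammaℝ (cayley (toCircle x : ℂ)) ≠ 0 :=
    Gammaℝ_ne_zero_of_re_pos (by rw [cayley_re_of_norm_eq_one hvn]; norm_num)
  have hc : ContinuousAt (fun y : AddCircle T => ((toCircle y : Circle) : ℂ)) x :=
    (continuous_subtype_val.comp continuous_toCircle).continuousAt
  have hfun : circleRestrict T kappaArch =
      (rhoArch ∘ cayley) ∘ fun y : AddCircle T => ((toCircle y : Circle) : ℂ) := rfl
  rw [hfun]
  exact ContinuousAt.comp ((continuousAt_rhoArch hG).comp (continuousAt_cayley hv1)) hc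

/-- RH-FREE. **The boundary function of `κ = ρ_∞ ∘ ψ` belongs to `L^∞(S¹)` and is unimodular** (it is
measurable — continuous off one point — and `|κ| = 1` on `S¹`); the vector `toLpOrZero ∞ (κ|S¹)` of the
typed statements is this function.
[cite: ConnesConsani2021QuasiInner, §2 (arXiv chunk p0006:L87) with Introduction, Definition (p0003:L5)] -/
theorem memLp_circleRestrict_kappaArch :
    MemLp (circleRestrict 1 kappaArch) ∞ (haarAddCircle (T := 1)) ∧
    (∀ᵐ x ∂(haarAddCircle (T := 1)), ‖circleRestrict 1 kappaArch x‖ = 1) ∧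
    toLpOrZero ∞ haarAddCircle (circleRestrict 1 kappaArch) =
      (memLp_top_of_bound (measurable_of_continuousOn_compl_singleton 0
        (continuousOn_circleRestrict_kappaArch 1)).aestronglyMeasurable 1
        (ae_of_all _ fun x => (norm_circleRestrict_kappaArch 1 x).le)).toLp _ := by
  have hmem : MemLp (circleRestrict 1 kappaArch) ∞ (haarAddCircle (T := 1)) :=
    memLp_top_of_bound (measurable_of_continuousOn_compl_singleton 0
      (continuousOn_circleRestrict_kappaArch 1)).aestronglyMeasurable 1
      (ae_of_all _ fun x => (norm_circleRestrict_kappaArch 1 x).le)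
  exact ⟨hmem, ae_of_all _ fun x => norm_circleRestrict_kappaArch 1 x, toLpOrZero_eq_toLp hmem⟩

/-- RH-FREE. A rank-one operator `|x⟩⟨y|` is compact (its image of the unit ball lies in the compact
set `{c • x : |c| ≤ ‖y‖}`). [folklore] -/
private theorem isCompactOperator_rankOne {E : Type*} [NormedAddCommGroup E] [InnerProductSpace ℂ E]
    (x y : E) : IsCompactOperator (InnerProductSpace.rankOne ℂ x y) := by
  refine ⟨(fun c : ℂ => c • x) '' Metric.closedBall 0 ‖y‖,
    (isCompact_closedBall (0 : ℂ) ‖y‖).image (continuous_id.smul continuous_const),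
    Filter.mem_of_superset (Metric.closedBall_mem_nhds 0 one_pos) fun z hz => ?_⟩
  refine ⟨⟪y, z⟫_ℂ, ?_, (InnerProductSpace.rankOne_apply x y z).symm⟩
  rw [Metric.mem_closedBall, dist_zero_right] at hz ⊢
  calc ‖⟪y, z⟫_ℂ‖ ≤ ‖y‖ * ‖z‖ := norm_inner_le_norm y z
    _ ≤ ‖y‖ * 1 := mul_le_mul_of_nonneg_left hz (norm_nonneg _)
    _ = ‖y‖ := mul_one _

/-- RH-FREE. **Theorem 2.3 ⇒ `(1 − 𝒫)κ𝒫` is compact**: a norm-convergent series of rank-one operators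
is a norm limit of finite-rank (compact) operators, and the compact operators are norm closed.
[cite: ConnesConsani2021QuasiInner, Thm 2.3 «thmkappa» (arXiv chunk p0006:L49–L57)] -/
theorem isCompactOperator_hardyOffDiag_kappaArch_of_thm_2_3 (h : thm_2_3) :
    IsCompactOperator (hardyOffDiag 1 (toLpOrZero ∞ haarAddCircle (circleRestrict 1 kappaArch))) := by
  have hmem : ∀ s : Finset ℕ, IsCompactOperator
      (⇑(∑ n ∈ s, (thm23Coeff n : ℂ) •
        InnerProductSpace.rankOne ℂ ((‖xiVec 1 (xArch n)‖⁻¹ : ℂ) • xiVec 1 (xArch n))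
          ((‖etaVec 1 (xArch n)‖⁻¹ : ℂ) • etaVec 1 (xArch n)))) := by
    intro s
    induction s using Finset.induction_on with
    | empty =>
      rw [Finset.sum_empty]
      exact isCompactOperator_zero
    | insert a s ha ih =>
      rw [Finset.sum_insert ha, FunLike.coe_add, FunLike.coe_smul]
      exact ((isCompactOperator_rankOne _ _).smul _).add ih
  exact isClosed_setOf_isCompactOperator.mem_of_tendsto h (Eventually.of_forall hmem)

/-- RH-FREE. **Theorem 2.3 ⇒ the first sentence of Theorem 2.1** («`ρ_∞` is quasi-inner relative to
`ℂ₋`», boundary-value form `IsQuasiInnerLeftHalfPlane`): `κ|S¹ ∈ L^∞` is unimodular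
(`memLp_circleRestrict_kappaArch`) and `(1 − 𝒫)κ𝒫` is compact by Theorem 2.3. A PROVED reduction between
two typed statements (neither is discharged here).
[cite: ConnesConsani2021QuasiInner, Thm 2.1 «thmquasiinner0» (p0005:L124) with Thm 2.3 «thmkappa» (p0006:L49–L57)] -/
theorem isQuasiInnerLeftHalfPlane_rhoArch_of_thm_2_3 (h : thm_2_3) : IsQuasiInnerLeftHalfPlane rhoArch := by
  have hk : circleRestrict 1 (rhoArch ∘ cayley) = circleRestrict 1 kappaArch := rfl
  obtain ⟨hmem, -, heq⟩ := memLp_circleRestrict_kappaArch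
  refine ⟨hk ▸ hmem, ?_, ?_⟩
  · rw [hk, heq]
    filter_upwards [MemLp.coeFn_toLp (memLp_top_of_bound (measurable_of_continuousOn_compl_singleton 0
        (continuousOn_circleRestrict_kappaArch 1)).aestronglyMeasurable 1
        (ae_of_all _ fun x => (norm_circleRestrict_kappaArch 1 x).le))] with x hx
    rw [hx]
    exact norm_circleRestrict_kappaArch 1 x
  · rw [hk]
    exact isCompactOperator_hardyOffDiag_kappaArch_of_thm_2_3 h

end ThmTwoThreeToTwoOne

section ThmTwoOneOfTwoThree

/-! ### Theorem 2.3 ⇒ Theorem 2.1 in full (infinite order)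

RH-FREE.  The printed proof of Theorem 2.1 («imposing `m` linear conditions … reduces the sum to
`Σ_{k≥m} a_{−k}(1 − 𝒫)e^{−ikθ}𝒫` whose norm is less than `Σ_m^∞ |a_{−k}|` which is `O(m^{−N})` for any
`N`», p0005:L128–L136) run on the rank-one expansion of Theorem 2.3 instead of the Hankel expansion (a
shorter road to the same estimate): the `m`-th partial sum has rank `≤ m`, the remainder has norm
`≤ Σ_{n≥m}|c_n| ≤ 4√π e^{π²}·π^{2m}/m!`, which is `O(m^{−k})` for every `k`; the tree's criterion
`IsInfiniteOrder.of_approx` (`ApproxNumberCalculus.lean`) concludes.  Hence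
`thm_2_1_of_thm_2_3 : thm_2_3 → thm_2_1` (a PROVED reduction; neither fact is discharged here). -/

open scoped Nat

/-- RH-FREE. `1 ≤ √π`. [folklore] -/
private theorem l21_one_le_sqrt_pi : 1 ≤ Real.sqrt π := by
  rw [show (1:ℝ) = Real.sqrt 1 by simp]
  exact Real.sqrt_le_sqrt (by linarith [Real.two_le_pi])


/-- RH-FREE. `Γ(n + ½) ≥ ½` for every `n ∈ ℕ` (`Γ(½) = √π`, `Γ(3/2) = √π/2`, `Γ` increasing on `[2, ∞)`). [folklore] -/
private theorem l21_half_le_Gamma_nat_add_half (n : ℕ) : (1 / 2 : ℝ) ≤ Real.Gamma ((n : ℝ) + 1 / 2) := by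
  rcases Nat.lt_or_ge n 2 with hn | hn
  · interval_cases n
    · simp only [CharP.cast_eq_zero, zero_add, Real.Gamma_one_half_eq]
      linarith [l21_one_le_sqrt_pi]
    · rw [show ((1 : ℕ) : ℝ) + 1 / 2 = 1 / 2 + 1 by norm_num, Real.Gamma_add_one (by norm_num),
        Real.Gamma_one_half_eq]
      linarith [l21_one_le_sqrt_pi]
  · have h2 : (2 : ℝ) ≤ (n : ℝ) + 1 / 2 := by
      have : (2 : ℝ) ≤ n := by exact_mod_cast hn
      linarith
    have hmono := Real.Gamma_strictMonoOn_Ici.monotoneOn (Set.self_mem_Ici) (Set.mem_Ici.mpr h2) h2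
    rw [Real.Gamma_two] at hmono
    linarith

/-- RH-FREE. **The coefficients of Theorem 2.3 decay factorially**: `|(−1)^{n+1}2π^{2n+½}/((4n+1)Γ(n+1)Γ(n+½))| ≤ 4√π·π^{2n}/n!` («the characteristic values of the off diagonal part decay extremely fast», p0006:L49). [cite: ConnesConsani2021QuasiInner, Thm 2.3 «thmkappa» (arXiv chunk p0006:L49–L57)] -/
theorem abs_thm23Coeff_le (n : ℕ) : |thm23Coeff n| ≤ 4 * Real.sqrt π * (π ^ 2) ^ n / n ! := by
  have hG1 : Real.Gamma ((n : ℝ) + 1) = n ! := Real.Gamma_nat_eq_factorial n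
  have hG2 := l21_half_le_Gamma_nat_add_half n
  have hG2pos : 0 < Real.Gamma ((n : ℝ) + 1 / 2) := by linarith
  have hfac : (0 : ℝ) < n ! := by positivity
  have h4 : (1 : ℝ) ≤ 4 * n + 1 := by
    have : (0:ℝ) ≤ n := n.cast_nonneg
    linarith
  unfold thm23Coeff
  rw [hG1, abs_div, abs_mul, abs_mul, abs_pow, abs_neg, abs_one, one_pow, one_mul,
    abs_of_pos (by positivity : (0:ℝ) < 2),
    abs_of_nonneg (by positivity : (0:ℝ) ≤ Real.sqrt π * π ^ (2 * n)),
    abs_of_pos (by positivity : (0:ℝ) < (4 * (n : ℝ) + 1) * n ! * Real.Gamma ((n : ℝ) + 1 / 2)),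
    pow_mul]
  rw [div_le_div_iff₀ (by positivity) hfac]
  -- 2 * (√π * q^n) * n! ≤ 4 √π q^n * ((4n+1) n! Γ)
  have hq : (0 : ℝ) ≤ Real.sqrt π * (π ^ 2) ^ n := by positivity
  nlinarith [mul_le_mul h4 hG2 (by norm_num) (by positivity), hq, hfac,
    mul_nonneg (mul_nonneg hq hfac.le) (by positivity : (0:ℝ) ≤ (4 * (n:ℝ) + 1) * Real.Gamma ((n : ℝ) + 1 / 2))]


/-- RH-FREE. The majorant `4√π(π²)^n/n!` is summable. [folklore] -/
private theorem l21_summable_majorant : Summable fun n : ℕ => 4 * Real.sqrt π * (π ^ 2) ^ n / n ! := by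
  have := (Real.summable_pow_div_factorial (π ^ 2)).mul_left (4 * Real.sqrt π)
  refine this.congr fun n => ?_
  ring


/-- RH-FREE. `q^{m+j}/(m+j)! ≤ (q^m/m!)(q^j/j!)` (`m!j! ∣ (m+j)!`). [folklore] -/
private theorem l21_pow_div_factorial_add_le {q : ℝ} (hq : 0 ≤ q) (m j : ℕ) :
    q ^ (j + m) / (j + m)! ≤ q ^ m / m ! * (q ^ j / j !) := by
  rw [div_mul_div_comm, ← pow_add, add_comm j m]
  refine div_le_div_of_nonneg_left (by positivity) (by positivity) ?_
  exact_mod_cast Nat.le_of_dvd (Nat.factorial_pos _) (Nat.factorial_mul_factorial_dvd_factorial_add m j)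


/-- RH-FREE. `(m+1)^k q^m/m! ≤ Σ_i (2^k q)^i/i!` (rapid decay of `q^m/m!` beats every polynomial: `m + 1 ≤ 2^m`). [folklore] -/
private theorem l21_pow_mul_pow_div_factorial_le {q : ℝ} (hq : 0 ≤ q) (k m : ℕ) :
    ((m : ℝ) + 1) ^ k * (q ^ m / m !) ≤ ∑' i : ℕ, (2 ^ k * q) ^ i / i ! := by
  have hs := Real.summable_pow_div_factorial (2 ^ k * q)
  have hle : ((m : ℝ) + 1) ^ k * (q ^ m / m !) ≤ (2 ^ k * q) ^ m / m ! := by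
    have h1 : ((m : ℝ) + 1) ≤ 2 ^ m := by exact_mod_cast Nat.lt_two_pow_self (n := m)
    have h2 : ((m : ℝ) + 1) ^ k ≤ (2 ^ m) ^ k := pow_le_pow_left₀ (by positivity) h1 k
    have h3 : ((2 : ℝ) ^ m) ^ k = (2 ^ k) ^ m := by rw [← pow_mul, ← pow_mul, mul_comm]
    rw [mul_pow, mul_div_assoc]
    rw [h3] at h2
    exact mul_le_mul_of_nonneg_right h2 (by positivity)
  exact hle.trans (hs.le_tsum m fun j _ => by positivity)


/-- RH-FREE. A rank-one operator on unit (or zero) vectors has norm `≤ 1`. [folklore] -/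
private theorem l21_norm_rankOne_unit_le (ξ η : Lp ℂ 2 (haarAddCircle (T := (1:ℝ)))) :
    ‖InnerProductSpace.rankOne ℂ ((‖ξ‖⁻¹ : ℂ) • ξ) ((‖η‖⁻¹ : ℂ) • η)‖ ≤ 1 := by
  have h : ∀ v : Lp ℂ 2 (haarAddCircle (T := (1:ℝ))), ‖(‖v‖⁻¹ : ℂ) • v‖ ≤ 1 := by
    intro v
    rw [norm_smul, norm_inv, Complex.norm_real, Real.norm_of_nonneg (norm_nonneg _)]
    by_cases hv : ‖v‖ = 0
    · rw [hv]; simp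
    · rw [inv_mul_cancel₀ hv]
  rw [InnerProductSpace.norm_rankOne]
  calc ‖(‖ξ‖⁻¹ : ℂ) • ξ‖ * ‖(‖η‖⁻¹ : ℂ) • η‖ ≤ 1 * 1 :=
        mul_le_mul (h ξ) (h η) (norm_nonneg _) zero_le_one
    _ = 1 := mul_one _

/-- RH-FREE. The `m`-th partial sum of a series of rank-one operators has rank `≤ m` (its range lies in
the span of the first `m` vectors). [folklore] -/
private theorem l21_rank_partialSum_le (c : ℕ → ℂ) (x y : ℕ → Lp ℂ 2 (haarAddCircle (T := (1:ℝ))))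
    (m : ℕ) :
    Module.rank ℂ (LinearMap.range
      ((∑ n ∈ Finset.range m, c n • InnerProductSpace.rankOne ℂ (x n) (y n) :
        Lp ℂ 2 (haarAddCircle (T := (1:ℝ))) →L[ℂ] Lp ℂ 2 (haarAddCircle (T := (1:ℝ)))) :
        Lp ℂ 2 (haarAddCircle (T := (1:ℝ))) →ₗ[ℂ] Lp ℂ 2 (haarAddCircle (T := (1:ℝ))))) ≤ m := by
  classical
  set s : Finset (Lp ℂ 2 (haarAddCircle (T := (1:ℝ)))) := (Finset.range m).image x with hs
  have hsub : LinearMap.range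
      ((∑ n ∈ Finset.range m, c n • InnerProductSpace.rankOne ℂ (x n) (y n) :
        Lp ℂ 2 (haarAddCircle (T := (1:ℝ))) →L[ℂ] Lp ℂ 2 (haarAddCircle (T := (1:ℝ)))) :
        Lp ℂ 2 (haarAddCircle (T := (1:ℝ))) →ₗ[ℂ] Lp ℂ 2 (haarAddCircle (T := (1:ℝ)))) ≤
      Submodule.span ℂ (s : Set (Lp ℂ 2 (haarAddCircle (T := (1:ℝ))))) := by
    rintro _ ⟨v, rfl⟩
    rw [ContinuousLinearMap.coe_coe, FunLike.coe_sum, Finset.sum_apply]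
    refine Submodule.sum_mem _ fun n hn => ?_
    rw [FunLike.coe_smul, Pi.smul_apply, InnerProductSpace.rankOne_apply]
    refine Submodule.smul_mem _ _ (Submodule.smul_mem _ _ (Submodule.subset_span ?_))
    rw [hs, Finset.coe_image]
    exact ⟨n, Finset.mem_coe.mpr hn, rfl⟩
  have hcard : Module.rank ℂ (Submodule.span ℂ (s : Set (Lp ℂ 2 (haarAddCircle (T := (1:ℝ)))))) ≤
      (s.card : Cardinal) := rank_span_finset_le s
  have hc2 : s.card ≤ m := by
    rw [hs]
    exact Finset.card_image_le.trans (Finset.card_range m).le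
  have hc3 : (s.card : Cardinal) ≤ (m : Cardinal) := by exact_mod_cast hc2
  exact (Submodule.rank_mono hsub).trans (hcard.trans hc3)

/-- RH-FREE. **Theorem 2.3 ⇒ `(1 − 𝒫)κ𝒫` is an infinitesimal of infinite order** (second sentence of
Theorem 2.1): the `m`-th partial sum of the rank-one expansion has rank `≤ m` and the remainder has norm
`≤ Σ_{n≥m}|c_n| ≤ 4√π(Σ_j π^{2j}/j!)·π^{2m}/m! = O(m^{−k})` for every `k` — the printed argument «imposing
`m` linear conditions … reduces the sum to [a tail] whose norm is less than `Σ_m^∞|a_{−k}|` which is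
`O(m^{−N})`» run on Theorem 2.3's expansion. PROVED reduction.
[cite: ConnesConsani2021QuasiInner, Thm 2.1, proof (arXiv chunk p0005:L126–L136) with Thm 2.3 (p0006:L49–L57)] -/
theorem isInfiniteOrder_hardyOffDiag_kappaArch_of_thm_2_3 (h : thm_2_3) :
    IsInfiniteOrder (hardyOffDiag 1 (toLpOrZero ∞ haarAddCircle (circleRestrict 1 kappaArch))) := by
  set A := hardyOffDiag 1 (toLpOrZero ∞ haarAddCircle (circleRestrict 1 kappaArch)) with hA
  set x : ℕ → Lp ℂ 2 (haarAddCircle (T := (1:ℝ))) :=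
    fun n => (‖xiVec 1 (xArch n)‖⁻¹ : ℂ) • xiVec 1 (xArch n) with hx
  set y : ℕ → Lp ℂ 2 (haarAddCircle (T := (1:ℝ))) :=
    fun n => (‖etaVec 1 (xArch n)‖⁻¹ : ℂ) • etaVec 1 (xArch n) with hy
  set f : ℕ → (Lp ℂ 2 (haarAddCircle (T := (1:ℝ))) →L[ℂ] Lp ℂ 2 (haarAddCircle (T := (1:ℝ)))) :=
    fun n => (thm23Coeff n : ℂ) • InnerProductSpace.rankOne ℂ (x n) (y n) with hf
  have hsum : HasSum f A := h
  set b : ℕ → ℝ := fun n => 4 * Real.sqrt π * (π ^ 2) ^ n / n ! with hb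
  have hfb : ∀ n, ‖f n‖ ≤ b n := by
    intro n
    rw [hf, hb]
    simp only
    rw [norm_smul, Complex.norm_real, Real.norm_eq_abs]
    calc |thm23Coeff n| * ‖InnerProductSpace.rankOne ℂ (x n) (y n)‖ ≤ |thm23Coeff n| * 1 :=
          mul_le_mul_of_nonneg_left (l21_norm_rankOne_unit_le _ _) (abs_nonneg _)
      _ ≤ 4 * Real.sqrt π * (π ^ 2) ^ n / n ! := by rw [mul_one]; exact abs_thm23Coeff_le n
  have hbsum : Summable b := l21_summable_majorant
  refine IsInfiniteOrder.of_approx fun k => ?_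
  set S : ℝ := ∑' j : ℕ, (π ^ 2) ^ j / j ! with hS
  set Tk : ℝ := ∑' i : ℕ, (2 ^ k * π ^ 2) ^ i / i ! with hTk
  have hS0 : 0 ≤ S := tsum_nonneg fun j => by positivity
  refine ⟨4 * Real.sqrt π * S * Tk, fun m => ⟨∑ n ∈ Finset.range m, f n, ?_, ?_⟩⟩
  · rw [hf]
    exact l21_rank_partialSum_le (fun n => (thm23Coeff n : ℂ)) x y m
  · have htail : HasSum (fun j => f (j + m)) (A - ∑ n ∈ Finset.range m, f n) :=
      (hasSum_nat_add_iff' m).mpr hsum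
    have hbtail : HasSum (fun j => b (j + m)) (∑' j, b (j + m)) :=
      ((summable_nat_add_iff m).mpr hbsum).hasSum
    have h1 : ‖A - ∑ n ∈ Finset.range m, f n‖ ≤ ∑' j, b (j + m) :=
      htail.norm_le_of_bounded hbtail fun j => hfb (j + m)
    have h2 : ∑' j, b (j + m) ≤ 4 * Real.sqrt π * ((π ^ 2) ^ m / m !) * S := by
      have hSsum : HasSum (fun j : ℕ => 4 * Real.sqrt π * ((π ^ 2) ^ m / m !) * ((π ^ 2) ^ j / j !))
          (4 * Real.sqrt π * ((π ^ 2) ^ m / m !) * S) :=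
        (Real.summable_pow_div_factorial (π ^ 2)).hasSum.mul_left _
      refine hasSum_le (fun j => ?_) hbtail hSsum
      have hle := l21_pow_div_factorial_add_le (q := π ^ 2) (by positivity) m j
      rw [hb]
      calc 4 * Real.sqrt π * (π ^ 2) ^ (j + m) / ((j + m)! : ℝ)
          = 4 * Real.sqrt π * ((π ^ 2) ^ (j + m) / (j + m)!) := by ring
        _ ≤ 4 * Real.sqrt π * ((π ^ 2) ^ m / m ! * ((π ^ 2) ^ j / j !)) :=
          mul_le_mul_of_nonneg_left hle (by positivity)
        _ = _ := by ring
    have h3 := l21_pow_mul_pow_div_factorial_le (q := π ^ 2) (by positivity) k m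
    calc ‖A - ∑ n ∈ Finset.range m, f n‖ * ((m : ℝ) + 1) ^ k
        ≤ (4 * Real.sqrt π * ((π ^ 2) ^ m / m !) * S) * ((m : ℝ) + 1) ^ k :=
          mul_le_mul_of_nonneg_right (h1.trans h2) (by positivity)
      _ = 4 * Real.sqrt π * S * (((m : ℝ) + 1) ^ k * ((π ^ 2) ^ m / m !)) := by ring
      _ ≤ 4 * Real.sqrt π * S * Tk := mul_le_mul_of_nonneg_left h3 (by positivity)

/-- RH-FREE. **Theorem 2.1 follows from Theorem 2.3** (both sentences: quasi-inner = compactness,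
`isQuasiInnerLeftHalfPlane_rhoArch_of_thm_2_3`; infinite order,
`isInfiniteOrder_hardyOffDiag_kappaArch_of_thm_2_3`). PROVED reduction `thm_2_3 → thm_2_1`; the remaining
debt of Theorem 2.1 is thus exactly Theorem 2.3 (display «aminusk» + Lemma 2.2).
[cite: ConnesConsani2021QuasiInner, Thm 2.1 «thmquasiinner0» (p0005:L124–L136) with Thm 2.3 «thmkappa» (p0006:L49–L57)] -/
theorem thm_2_1_of_thm_2_3 (h : thm_2_3) : thm_2_1 :=
  ⟨isQuasiInnerLeftHalfPlane_rhoArch_of_thm_2_3 h, isInfiniteOrder_hardyOffDiag_kappaArch_of_thm_2_3 h⟩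

end ThmTwoOneOfTwoThree

section HolomorphicOffDiag

variable (T : ℝ) [hT : Fact (0 < T)]

/-- RH-FREE. **«For an holomorphic function one has `(1 − 𝒫)h_∞𝒫 = 0`»** (p0006:L87–L88), boundary-value
form: if `u ∈ L^∞(S¹)` has vanishing negative Fourier coefficients (`û(−k) = 0`, `k ≥ 1`, i.e. `u` is the
boundary function of an `H^∞` function), then the off-diagonal part `(1 − 𝒫)u𝒫` vanishes — `u·e_m ∈ H²`
for every `m ≥ 0` since its negative coefficients are `û(−k − m) = 0`, and `𝒫e_m = 0` for `m < 0`; the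
modes span a dense subspace. PROVED (RH-FREE; the mechanism behind Prop 2.4 ⇒ Thm 2.1 and behind
«the off diagonal part is computed by Lemma 2.2» in the proof of Thm 2.3).
[cite: ConnesConsani2021QuasiInner, §2, before Prop 2.4 (arXiv chunk p0006:L87–L88)] -/
theorem hardyOffDiag_eq_zero_of_fourierCoeff_neg_eq_zero (u : Lp ℂ ∞ (haarAddCircle (T := T)))
    (hu : ∀ k : ℕ, fourierCoeff (T := T) (u : AddCircle T → ℂ) (-(k + 1 : ℤ)) = 0) :
    hardyOffDiag T u = 0 := by
  have hdense : Dense (Submodule.span ℂ (Set.range (fourierLp (T := T) 2)) :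
      Set (Lp ℂ 2 (haarAddCircle (T := T)))) :=
    Submodule.dense_iff_topologicalClosure_eq_top.2 (span_fourierLp_closure_eq_top (by norm_num))
  refine ContinuousLinearMap.ext_on hdense ?_
  rintro _ ⟨m, rfl⟩
  rw [zero_apply]
  simp only [hardyOffDiag, offDiag, mul_apply_eq_comp]
  rcases m with k | k
  · rw [Int.ofNat_eq_natCast, hardyProjection_fourierLp_natCast k]
    have hmem : mulOp haarAddCircle u (fourierLp (T := T) 2 (k : ℤ)) ∈ hardySpace T := by
      rw [mem_hardySpace_iff]
      intro n
      have h := hu (n + k)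
      simp only [fourierCoeff, smul_eq_mul] at h
      rw [MeasureTheory.L2.inner_def, ← h]
      refine integral_congr_ae ?_
      filter_upwards [coeFn_mulOp haarAddCircle u (fourierLp (T := T) 2 (k : ℤ)),
        coeFn_fourierLp (T := T) 2 (k : ℤ), coeFn_fourierLp (T := T) 2 (-(n + 1 : ℤ))]
        with t h1 h2 h3
      rw [h1, h3, h2, RCLike.inner_apply', ← fourier_neg, neg_neg, neg_neg,
        show ((n + k : ℕ) : ℤ) + 1 = (n + 1 : ℤ) + k by push_cast; ring]
      simp only [fourier_add]
      ring
    rw [sub_apply, one_apply_eq_self, sub_eq_zero, hardyProjection, eq_comm]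
    exact Submodule.starProjection_eq_self_iff.2 hmem
  · rw [Int.negSucc_eq, hardyProjection_fourierLp_negSucc k, map_zero, map_zero]

end HolomorphicOffDiag

section SzegoNegCoefficients

variable (T : ℝ) [hT : Fact (0 < T)]

/-- RH-FREE. **The Fourier coefficients of `f_x = ξ_x`**: `⟨e_{−k−1} | ξ_x⟩ = x^k`, i.e.
`f_x = Σ_{k≥1} x^{k−1} z^{−k}` («since `xf_x = (1 − xz^{−1})^{−1} − 1`», the expansion by which «the negative
part of the Fourier expansion of `κ` is expressed (aminusk) as a linear combination of the `f_{x_n}`»).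
[cite: ConnesConsani2021QuasiInner, Lemma 2.2, proof (arXiv chunk p0006:L30) and Thm 2.3, proof (p0006:L59)] -/
theorem inner_fourierLp_negSucc_xiVec (x : ℂ) (hx : ‖x‖ < 1) (k : ℕ) :
    ⟪fourierLp (T := T) 2 (-(k + 1 : ℤ)), xiVec T x⟫_ℂ = x ^ k := by
  classical
  have h := hasSum_inner_fourierLp_of_hasSum (hasSum_xiVec (T := T) x hx) (-(k + 1 : ℤ))
  have h2 : (fun j : ℕ => if (-(k + 1 : ℤ)) = (-(j + 1 : ℤ)) then x ^ j else 0) =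
      fun j => if j = k then x ^ k else 0 := by
    funext j
    by_cases hjk : j = k
    · subst hjk; simp
    · have : (-(k + 1 : ℤ)) ≠ (-(j + 1 : ℤ)) := fun h' => hjk (by omega)
      rw [if_neg this, if_neg hjk]
  rw [h2] at h
  exact h.unique (hasSum_ite_eq k (x ^ k))

/-- RH-FREE. `⟨e_k | ξ_x⟩ = 0` for `k ≥ 0`: `f_x = ξ_x ∈ (H²)^⊥` has no non-negative Fourier modes.
[cite: ConnesConsani2021QuasiInner, Lemma 2.2, proof (arXiv chunk p0006:L30)] -/
theorem inner_fourierLp_natCast_xiVec (x : ℂ) (hx : ‖x‖ < 1) (k : ℕ) :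
    ⟪fourierLp (T := T) 2 (k : ℤ), xiVec T x⟫_ℂ = 0 := by
  classical
  have h := hasSum_inner_fourierLp_of_hasSum (hasSum_xiVec (T := T) x hx) (k : ℤ)
  have h2 : (fun j : ℕ => if (k : ℤ) = (-(j + 1 : ℤ)) then x ^ j else 0) = fun _ => 0 := by
    funext j
    have : (k : ℤ) ≠ (-(j + 1 : ℤ)) := by omega
    rw [if_neg this]
  rw [h2] at h
  exact h.unique hasSum_zero

/-- RH-FREE. The same in terms of `fourierCoeff`: `f̂_x(−k−1) = x^k` and `f̂_x(k) = 0` (`k ≥ 0`) for the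
`L²` boundary function `ξ_x` of `f_x`.
[cite: ConnesConsani2021QuasiInner, Lemma 2.2, proof (arXiv chunk p0006:L30) and Thm 2.3, proof (p0006:L59)] -/
theorem fourierCoeff_xiVec (x : ℂ) (hx : ‖x‖ < 1) (k : ℕ) :
    fourierCoeff (T := T) (xiVec T x : AddCircle T → ℂ) (-(k + 1 : ℤ)) = x ^ k ∧
      fourierCoeff (T := T) (xiVec T x : AddCircle T → ℂ) (k : ℤ) = 0 := by
  have key : ∀ n : ℤ, ⟪fourierLp (T := T) 2 n, xiVec T x⟫_ℂ =
      fourierCoeff (T := T) (xiVec T x : AddCircle T → ℂ) n := fun n => by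
    rw [← fourierBasis_repr, ← coe_fourierBasis]
    exact (fourierBasis.repr_apply_apply (xiVec T x) n).symm
  exact ⟨(key _).symm.trans (inner_fourierLp_negSucc_xiVec T x hx k),
    (key _).symm.trans (inner_fourierLp_natCast_xiVec T x hx k)⟩

end SzegoNegCoefficients

section ThmTwoThreeNormalisation

/-- RH-FREE. **The normalisation display of Theorem 2.3**: «`(4n+3)^{−2}‖ξ_{x_n}‖‖η_{x_n}‖ = 1/(32n+8)`»
(PROVED from `‖ξ_x‖‖η_x‖ = (1 − |x|²)⁻¹`, Lemma 2.2, and `1 − x_n² = (32n+8)/(4n+3)²`).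
[cite: ConnesConsani2021QuasiInner, Thm 2.3, proof, display (arXiv chunk p0006:L64–L66)] -/
theorem display_thm_2_3_norms (n : ℕ) :
    ((4 * (n : ℝ) + 3) ^ 2)⁻¹ * (‖xiVec 1 (xArch n : ℂ)‖ * ‖etaVec 1 (xArch n : ℂ)‖) =
      1 / (32 * n + 8) := by
  have hx : ‖(xArch n : ℂ)‖ < 1 := by
    rw [Complex.norm_real, Real.norm_eq_abs]; exact xArch_lt_one n
  rw [norm_xiVec_mul_norm_etaVec (T := 1) _ hx, Complex.norm_real, Real.norm_eq_abs, sq_abs, xArch]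
  have h : (4 * (n : ℝ) + 3) ≠ 0 := by positivity
  rw [← mul_inv, one_div]
  congr 1
  field_simp
  ring

/-- RH-FREE. **From display «uinftyoff» to «uinftyoff1»**: `α(n)|ξ_{x_n}⟩⟨η_{x_n}| = c_n |ξ_n⟩⟨η_n|` with the
unit vectors `ξ_n = ξ_{x_n}/‖ξ_{x_n}‖`, `η_n = η_{x_n}/‖η_{x_n}‖` and `c_n` the coefficient of Theorem 2.3
(«thus (uinftyoff1) follows from (uinftyoff)»). PROVED (the rescaling step of the proof of Theorem 2.3).
[cite: ConnesConsani2021QuasiInner, Thm 2.3, proof (arXiv chunk p0006:L59–L68)] -/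
theorem alphaArch_smul_rankOne (n : ℕ) :
    (alphaArch n : ℂ) • InnerProductSpace.rankOne ℂ (xiVec 1 (xArch n : ℂ)) (etaVec 1 (xArch n : ℂ)) =
      (thm23Coeff n : ℂ) •
        InnerProductSpace.rankOne ℂ ((‖xiVec 1 (xArch n : ℂ)‖⁻¹ : ℂ) • xiVec 1 (xArch n : ℂ))
          ((‖etaVec 1 (xArch n : ℂ)‖⁻¹ : ℂ) • etaVec 1 (xArch n : ℂ)) := by
  have hx : ‖(xArch n : ℂ)‖ < 1 := by
    rw [Complex.norm_real, Real.norm_eq_abs]; exact xArch_lt_one n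
  have hprod := norm_xiVec_mul_norm_etaVec (T := 1) _ hx
  rw [Complex.norm_real, Real.norm_eq_abs, sq_abs] at hprod
  set ξ := xiVec 1 (xArch n : ℂ) with hξ
  set η := etaVec 1 (xArch n : ℂ) with hη
  have hG1 : Real.Gamma ((n : ℝ) + 1) ≠ 0 := (Real.Gamma_pos_of_pos (by positivity)).ne'
  have hG2 : Real.Gamma ((n : ℝ) + 1 / 2) ≠ 0 := (Real.Gamma_pos_of_pos (by positivity)).ne'
  have h43 : (4 * (n : ℝ) + 3) ≠ 0 := by positivity
  have h41 : (4 * (n : ℝ) + 1) ≠ 0 := by positivity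
  have key : thm23Coeff n * (1 - xArch n ^ 2) = alphaArch n := by
    unfold thm23Coeff alphaArch xArch
    field_simp
    ring
  have hsc : (thm23Coeff n : ℂ) * (((‖ξ‖ : ℝ) : ℂ)⁻¹ * ((‖η‖ : ℝ) : ℂ)⁻¹) = alphaArch n := by
    rw [← mul_inv, ← Complex.ofReal_mul, hprod, ← Complex.ofReal_inv, inv_inv, ← Complex.ofReal_mul, key]
  ext1 v
  simp only [FunLike.coe_smul, Pi.smul_apply, InnerProductSpace.rankOne_apply,
    inner_smul_left, smul_smul, map_inv₀, Complex.conj_ofReal]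
  congr 1
  linear_combination (-⟪η, v⟫_ℂ) * hsc

end ThmTwoThreeNormalisation

section OffDiagLinear

variable (T : ℝ) [hT : Fact (0 < T)]

/-- RH-FREE. **The off-diagonal part as a continuous linear map of the symbol** `u ↦ (1 − 𝒫)u𝒫`,
`L^∞(S¹) → 𝓛(L²(S¹))` (Mathlib's Hölder action is a continuous bilinear map; composition with the fixed
projections is continuous linear) — the linearity/continuity in `u` used when «the negative part of the
Fourier expansion of `κ` is expressed as a linear combination of the `f_{x_n}` while the off diagonal part is
computed by Lemma 2.2» (p0006:L59). [cite: ConnesConsani2021QuasiInner, Thm 2.3, proof (arXiv chunk p0006:L59–L62) with Introduction, Definition (p0003:L5)] -/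
def hardyOffDiagL : Lp ℂ ∞ (haarAddCircle (T := T)) →L[ℂ]
    (Lp ℂ 2 (haarAddCircle (T := T)) →L[ℂ] Lp ℂ 2 (haarAddCircle (T := T))) :=
  ((ContinuousLinearMap.compL ℂ (Lp ℂ 2 (haarAddCircle (T := T))) (Lp ℂ 2 (haarAddCircle (T := T)))
      (Lp ℂ 2 (haarAddCircle (T := T))) (1 - hardyProjection T)).comp
    ((ContinuousLinearMap.compL ℂ (Lp ℂ 2 (haarAddCircle (T := T))) (Lp ℂ 2 (haarAddCircle (T := T)))
      (Lp ℂ 2 (haarAddCircle (T := T)))).flip (hardyProjection T))).comp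
    ((ContinuousLinearMap.mul ℂ ℂ).holderL (haarAddCircle (T := T)) ∞ 2 2)

/-- RH-FREE. `hardyOffDiagL T u = (1 − 𝒫)u𝒫 = hardyOffDiag T u` (unfolding lemma).
[cite: ConnesConsani2021QuasiInner, Introduction, Definition (arXiv chunk p0003:L5)] -/
theorem hardyOffDiagL_apply (u : Lp ℂ ∞ (haarAddCircle (T := T))) :
    hardyOffDiagL T u = hardyOffDiag T u := by
  simp only [hardyOffDiagL, ContinuousLinearMap.comp_apply, ContinuousLinearMap.flip_apply,
    ContinuousLinearMap.compL_apply, hardyOffDiag, offDiag, mulOp, ContinuousLinearMap.mul_def,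
    ContinuousLinearMap.comp_assoc]

/-- RH-FREE. **Summing the off-diagonal parts**: if `Σ c_i u_i = v` in `L^∞(S¹)` then
`Σ c_i (1 − 𝒫)u_i𝒫 = (1 − 𝒫)v𝒫` in operator norm (the interchange used in the proof of Thm 2.3,
p0006:L59–L62). PROVED. [cite: ConnesConsani2021QuasiInner, Thm 2.3, proof (arXiv chunk p0006:L59–L62)] -/
theorem hasSum_hardyOffDiag {ι : Type*} {u : ι → Lp ℂ ∞ (haarAddCircle (T := T))} {c : ι → ℂ}
    {v : Lp ℂ ∞ (haarAddCircle (T := T))} (h : HasSum (fun i => c i • u i) v) :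
    HasSum (fun i => c i • hardyOffDiag T (u i)) (hardyOffDiag T v) := by
  have h' := (hardyOffDiagL T).hasSum h
  simp only [map_smul, hardyOffDiagL_apply] at h'
  exact h'

end OffDiagLinear

section ArchNegativePart

open scoped Nat

/-- RH-FREE. `|f_x(v)| ≤ (1 − |x|)⁻¹` on the unit circle (`f_x(v) = v⁻¹(1 − xv⁻¹)⁻¹`, `|x| < 1`). [folklore] -/
private theorem l23_norm_szegoNeg_le {x : ℂ} (hx : ‖x‖ < 1) {v : ℂ} (hv : ‖v‖ = 1) :
    ‖szegoNeg x v‖ ≤ (1 - ‖x‖)⁻¹ := by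
  have h1 : 0 < 1 - ‖x‖ := by linarith
  simp only [szegoNeg]
  rw [norm_mul, norm_inv, hv, inv_one, one_mul, norm_inv]
  refine inv_anti₀ h1 ?_
  calc 1 - ‖x‖ = ‖(1 : ℂ)‖ - ‖x * v⁻¹‖ := by rw [norm_one, norm_mul, norm_inv, hv, inv_one, mul_one]
    _ ≤ ‖1 - x * v⁻¹‖ := norm_sub_norm_le 1 (x * v⁻¹)

/-- RH-FREE. `‖f_x‖_{L^∞(S¹)} ≤ (1 − |x|)⁻¹`. [folklore] -/
private theorem l23_norm_szegoNegLinfty_le (T : ℝ) [hT : Fact (0 < T)] {x : ℂ} (hx : ‖x‖ < 1) :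
    ‖toLpOrZero ∞ haarAddCircle (circleRestrict T (szegoNeg x))‖ ≤ (1 - ‖x‖)⁻¹ := by
  have h0 : 0 ≤ (1 - ‖x‖)⁻¹ := inv_nonneg.mpr (by linarith)
  obtain ⟨Fx, hFx, -⟩ : ∃ Fx : C(AddCircle T, ℂ), (⇑Fx = circleRestrict T (szegoNeg x)) ∧
      HasSum (fun k : ℕ => x ^ k • fourier (T := T) (-(k + 1 : ℤ))) Fx :=
    ⟨_, rfl, hasSum_geometric_fourier_negSucc (T := T) x hx⟩
  rw [← hFx, toLpOrZero_eq_toLp_continuousMap]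
  have hb := Lp.norm_le_of_ae_bound (f := ContinuousMap.toLp (E := ℂ) ∞ haarAddCircle ℂ Fx) h0 (by
    filter_upwards [ContinuousMap.coeFn_toLp (E := ℂ) (p := ∞) (μ := haarAddCircle) (𝕜 := ℂ) Fx]
      with y hy
    rw [hy, hFx]
    exact l23_norm_szegoNeg_le hx (Circle.norm_coe _))
  simpa [ENNReal.toReal_top] using hb

/-- RH-FREE. `|x(n)| ≤ 1 − 2/(4n+3)` (so `(1 − |x(n)|)⁻¹ ≤ (4n+3)/2`; note `x(0) = −1/3`). [folklore] -/
private theorem l23_abs_xArch_le (n : ℕ) : |xArch n| ≤ 1 - 2 / (4 * (n : ℝ) + 3) := by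
  have h : (0 : ℝ) < 4 * n + 3 := by positivity
  have hn : (0 : ℝ) ≤ n := n.cast_nonneg
  rw [xArch, abs_le]
  constructor
  · rw [show -(1 - 2 / (4 * (n : ℝ) + 3)) = -1 + 2 / (4 * (n : ℝ) + 3) by ring]
    have : 6 / (4 * (n : ℝ) + 3) ≤ 2 := by
      rw [div_le_iff₀ h]; linarith
    have e : (1 : ℝ) - 4 / (4 * n + 3) - (-1 + 2 / (4 * n + 3)) = 2 - 6 / (4 * n + 3) := by ring
    linarith
  · have : 2 / (4 * (n : ℝ) + 3) ≤ 4 / (4 * (n : ℝ) + 3) := by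
      apply div_le_div_of_nonneg_right (by norm_num) h.le
    linarith

/-- RH-FREE. The termwise bound `|α(n)|·‖f_{x(n)}‖_∞ ≤ |α(n)|(1 − |x(n)|)⁻¹ ≤ 16√π π^{2n}/n!`. [folklore] -/
private theorem l23_abs_alphaArch_mul_le (n : ℕ) :
    |alphaArch n| * (1 - |xArch n|)⁻¹ ≤ 16 * Real.sqrt π * (π ^ 2) ^ n / n ! := by
  have hG1 : Real.Gamma ((n : ℝ) + 1) = n ! := Real.Gamma_nat_eq_factorial n
  have hG2 := l21_half_le_Gamma_nat_add_half n
  have hG2pos : 0 < Real.Gamma ((n : ℝ) + 1 / 2) := by linarith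
  have hfac : (0 : ℝ) < n ! := by positivity
  have h43 : (0 : ℝ) < 4 * n + 3 := by positivity
  have hx1 : |xArch n| < 1 := xArch_lt_one n
  have hxle := l23_abs_xArch_le n
  -- (1 - |x|)⁻¹ ≤ (4n+3)/2
  have hinv : (1 - |xArch n|)⁻¹ ≤ (4 * (n : ℝ) + 3) / 2 := by
    rw [inv_le_comm₀ (by linarith) (by positivity)]
    rw [show ((4 * (n : ℝ) + 3) / 2)⁻¹ = 2 / (4 * (n : ℝ) + 3) by rw [inv_div]]
    linarith
  have habs : |alphaArch n| = 16 * (Real.sqrt π * (π ^ 2) ^ n) * ((4 * (n : ℝ) + 3) ^ 2)⁻¹ /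
      (n ! * Real.Gamma ((n : ℝ) + 1 / 2)) := by
    unfold alphaArch
    rw [hG1, abs_div, abs_mul, abs_mul, abs_mul, abs_pow, abs_neg, abs_one, one_pow, one_mul,
      abs_of_pos (by norm_num : (0:ℝ) < 16),
      abs_of_nonneg (by positivity : (0:ℝ) ≤ Real.sqrt π * π ^ (2 * n)),
      abs_of_pos (by positivity : (0:ℝ) < ((4 * (n : ℝ) + 3) ^ 2)⁻¹),
      abs_of_pos (by positivity : (0:ℝ) < n ! * Real.Gamma ((n : ℝ) + 1 / 2)), pow_mul]
  rw [habs]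
  calc 16 * (Real.sqrt π * (π ^ 2) ^ n) * ((4 * (n : ℝ) + 3) ^ 2)⁻¹ /
        (n ! * Real.Gamma ((n : ℝ) + 1 / 2)) * (1 - |xArch n|)⁻¹
      ≤ 16 * (Real.sqrt π * (π ^ 2) ^ n) * ((4 * (n : ℝ) + 3) ^ 2)⁻¹ /
        (n ! * Real.Gamma ((n : ℝ) + 1 / 2)) * ((4 * (n : ℝ) + 3) / 2) :=
        mul_le_mul_of_nonneg_left hinv (by positivity)
    _ = 8 * (Real.sqrt π * (π ^ 2) ^ n) / ((4 * (n : ℝ) + 3) * n ! * Real.Gamma ((n : ℝ) + 1 / 2)) := by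
        field_simp
        ring
    _ ≤ 8 * (Real.sqrt π * (π ^ 2) ^ n) / (1 * n ! * (1 / 2)) := by
        apply div_le_div_of_nonneg_left (by positivity) (by positivity)
        exact mul_le_mul (mul_le_mul_of_nonneg_right (by linarith) hfac.le) hG2 (by norm_num)
          (by positivity)
    _ = 16 * Real.sqrt π * (π ^ 2) ^ n / n ! := by
        field_simp
        ring

/-- RH-FREE. The series `Σ α(n) f_{x(n)}` converges absolutely in `L^∞(S¹)`. [folklore] -/
private theorem l23_summable_norm :
    Summable fun n : ℕ => ‖(alphaArch n : ℂ) •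
      toLpOrZero ∞ haarAddCircle (circleRestrict 1 (szegoNeg (xArch n : ℂ)))‖ := by
  have hmaj : Summable fun n : ℕ => 16 * Real.sqrt π * (π ^ 2) ^ n / n ! := by
    have := (Real.summable_pow_div_factorial (π ^ 2)).mul_left (16 * Real.sqrt π)
    refine this.congr fun n => ?_
    ring
  refine Summable.of_nonneg_of_le (fun n => norm_nonneg _) (fun n => ?_) hmaj
  have hx : ‖(xArch n : ℂ)‖ < 1 := by
    rw [Complex.norm_real, Real.norm_eq_abs]; exact xArch_lt_one n
  rw [norm_smul, Complex.norm_real, Real.norm_eq_abs]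
  calc |alphaArch n| * ‖toLpOrZero ∞ haarAddCircle (circleRestrict 1 (szegoNeg (xArch n : ℂ)))‖
      ≤ |alphaArch n| * (1 - ‖(xArch n : ℂ)‖)⁻¹ :=
        mul_le_mul_of_nonneg_left (l23_norm_szegoNegLinfty_le 1 hx) (abs_nonneg _)
    _ = |alphaArch n| * (1 - |xArch n|)⁻¹ := by rw [Complex.norm_real, Real.norm_eq_abs]
    _ ≤ _ := l23_abs_alphaArch_mul_le n

/-- RH-FREE. **The negative part of the Fourier expansion of `κ`, as a function**: the norm-convergent sum
`Σ_n α(n) f_{x(n)}` in `L^∞(S¹)` («The negative part of the Fourier expansion of `κ` is expressed (aminusk)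
as a linear combination of the `f_{x_n}`», proof of Thm 2.3).  RH-FREE.
[cite: ConnesConsani2021QuasiInner, Thm 2.3, proof (arXiv chunk p0006:L59)] -/
def kappaArchNegPart : Lp ℂ ∞ (haarAddCircle (T := 1)) :=
  ∑' n : ℕ, (alphaArch n : ℂ) • toLpOrZero ∞ haarAddCircle (circleRestrict 1 (szegoNeg (xArch n : ℂ)))

/-- RH-FREE. The series `Σ α(n) f_{x(n)}` converges in `L^∞(S¹)` to `kappaArchNegPart`.
[cite: ConnesConsani2021QuasiInner, Thm 2.3, proof (arXiv chunk p0006:L59)] -/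
theorem hasSum_kappaArchNegPart :
    HasSum (fun n : ℕ => (alphaArch n : ℂ) •
      toLpOrZero ∞ haarAddCircle (circleRestrict 1 (szegoNeg (xArch n : ℂ)))) kappaArchNegPart :=
  l23_summable_norm.of_norm.hasSum

/-- RH-FREE. **Theorem 2.3 for the model symbol**: `(1 − 𝒫)(Σ α(n)f_{x(n)})𝒫 = Σ c_n |ξ_n⟩⟨η_n|` with
Theorem 2.3's coefficients and unit vectors — «the off diagonal part is computed by Lemma 2.2 … thus
(uinftyoff1) follows from (uinftyoff)» — PROVED (interchange by `hasSum_hardyOffDiag`, Lemma 2.2 =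
`hardyOffDiag_szegoNeg`, rescaling `alphaArch_smul_rankOne`).
[cite: ConnesConsani2021QuasiInner, Thm 2.3, proof (arXiv chunk p0006:L59–L68)] -/
theorem hasSum_hardyOffDiag_kappaArchNegPart :
    HasSum
      (fun n : ℕ => (thm23Coeff n : ℂ) •
        InnerProductSpace.rankOne ℂ ((‖xiVec 1 (xArch n)‖⁻¹ : ℂ) • xiVec 1 (xArch n))
          ((‖etaVec 1 (xArch n)‖⁻¹ : ℂ) • etaVec 1 (xArch n)))
      (hardyOffDiag 1 kappaArchNegPart) := by
  have h := hasSum_hardyOffDiag (T := 1) hasSum_kappaArchNegPart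
  have hx : ∀ n : ℕ, ‖(xArch n : ℂ)‖ < 1 := fun n => by
    rw [Complex.norm_real, Real.norm_eq_abs]; exact xArch_lt_one n
  have heq : (fun n : ℕ => (alphaArch n : ℂ) •
      hardyOffDiag 1 (toLpOrZero ∞ haarAddCircle (circleRestrict 1 (szegoNeg (xArch n : ℂ))))) =
      fun n : ℕ => (thm23Coeff n : ℂ) •
        InnerProductSpace.rankOne ℂ ((‖xiVec 1 (xArch n)‖⁻¹ : ℂ) • xiVec 1 (xArch n))
          ((‖etaVec 1 (xArch n)‖⁻¹ : ℂ) • etaVec 1 (xArch n)) := by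
    funext n
    rw [hardyOffDiag_szegoNeg (T := 1) _ (hx n), alphaArch_smul_rankOne]
  rw [heq] at h
  exact h

/-- RH-FREE. **Theorem 2.3 reduces to the identification of off-diagonal parts**: if `(1 − 𝒫)κ𝒫 =
(1 − 𝒫)(Σ α(n)f_{x(n)})𝒫` (which follows from display «aminusk», the negative Fourier coefficients of `κ`,
together with `hardyOffDiag_eq_zero_of_fourierCoeff_neg_eq_zero`), then Theorem 2.3 holds. PROVED
reduction. [cite: ConnesConsani2021QuasiInner, Thm 2.3, proof (arXiv chunk p0006:L59–L68)] -/
theorem thm_2_3_of_hardyOffDiag_eq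
    (h : hardyOffDiag 1 (toLpOrZero ∞ haarAddCircle (circleRestrict 1 kappaArch)) =
      hardyOffDiag 1 kappaArchNegPart) : thm_2_3 := by
  unfold thm_2_3
  rw [h]
  exact hasSum_hardyOffDiag_kappaArchNegPart

end ArchNegativePart

end QuasiInner

end Literature.NumberTheory.ConnesConsani2021
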